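import Summits.QuantumFields.YangMills.Theses.CoincidenceRotationBootstrap
import Literature.MathematicalPhysics.QuantumFieldTheory.LatticeGaugeProofs
import Literature.MathematicalPhysics.QuantumFieldTheory.OSReconstructionNoE1
import Literature.MathematicalPhysics.QuantumFieldTheory.ConstructiveQFTWave0OddRPProofs

/-!
# Disproof of `HypercubicLimit` — standing adversary; crux `stmt-QuantumFields-16154` (the
# WEAK-COUPLING re-type, cycle 1, §13) on top of crux `stmt-QuantumFields-8646` (cycles 1–3, §§0–12)

## §13 summary — what the re-type `stmt-QuantumFields-16154` changes (read this first)

The live crux is `Summit.QuantumFields.YangMills.Theses.CoincidenceRotationBootstrap.HypercubicLimit`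
(item `stmt-QuantumFields-16154`; the SAME body is `MirrorModularBoosts.WeakCouplingHypercubicLimit`):
the 8646 body with ONE new conjunct in front, `sch.HasWeakCouplingLimit` (`β_k → +∞`; sign checked:
`wilsonWeight = exp(−β·∑ₚ(N − Re tr ρ U_p))`, so `β → +∞` concentrates at `U_p = 1` — weak coupling).
* `hypercubicLimit_iff` (§0, now for the 16154 decl): crux ⇔ `∀ G …, ∃ r sch S, β_k → ∞ ∧ Clauses r sch S`;
  `hypercubicLimit_imp_8646`: the re-type is MONOTONE (16154 → 8646 body, kept here as the local
  `HypercubicLimit8646` because no robustly importable Theses module carries it any more — see "tree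
  state" below), so EVERY negative result of §§1–12 and every landed `Theorems/HypercubicLimit/Negative/*`
  lemma applies to the new crux verbatim (`weak_false_without_nonabelian`, §13).
* **The junk witness is gone — the re-type moves weight onto the gap clause** (§13, NEW):
  in 8646 the two non-triviality clauses were the ENTIRE obstruction (§2: vacuum family + `β ≡ 0`
  scheme satisfy everything else, the lattice gap being free at `β = 0`, §1).  With `β_k → ∞` that
  witness dies (`not_junkWitness_weak`), and the crux MINUS both non-triviality clauses is no longer a
  theorem: `exists_clausesWithoutNontriviality_weak_iff` — it is EXACTLY `WeakCouplingLatticeGap r`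
  (`∃ sch, β_k → ∞ ∧ ∃ Δ > 0, HasLatticeMassGap r sch Δ`), and `weakCouplingLatticeGap_iff_rates`
  strips the scheme packaging: ⇔ `∃ β_k → +∞, ∃ L_k, ∃ ε_k > 0` (NO condition tying `ε_k`, `L_k`, `β_k`:
  the spacing `a_k` absorbs every rate) such that for every pair of local gauge-invariant observables,
  with a pair-dependent `k`-uniform constant, the torus time-correlations at `β_k` decay like
  `e^{−ε_k n}` for `n ≤ S` on EVERY torus of half-side `S ≥ L_k`.  That is the uniform lattice mass gap
  at a sequence of arbitrarily weak couplings (Chatterjee 1803.01950 Problem 5.1 along a sequence;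
  Jaffe–Witten §5) — open for every non-abelian `G` in `d = 4`.  So the re-typed crux has TWO
  independent open halves with no junk model for either: UV (non-triviality of the renormalised
  curvature as `β_k → ∞`, §§3, 8, 9) and IR (this §13).  For provers: the IR half is exactly the
  socket `LatticeGapFeedsScheme.lean` (landed, p-id in the lead's notes) feeds; nothing else about
  the scheme is constrained by it.
* §14 (NEW, landed p122411 `Negative/ConvergesAlongTests.lean`): `Converges` UPGRADES ITSELF by multilinear
  Banach–Steinhaus on closed subspaces of `𝓢` — lattice two-point functions along MOVING test functions
  (`u_k → u₀`, `v_k → v₀` in closed off-diagonal subspaces) converge to `𝔖₂(u₀ ⊗ v₀)` for ANY `c_k`; the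
  census obstruction "no k-uniform modulus of continuity" is superseded; the E/B split of §11 is the one
  remaining obstruction to "uniform lattice-unit clustering ⇒ trivial limit" (details §14).
* `HasWeakCouplingLimit` makes §9 (`β_k ≠ 0` eventually) automatic (`eventually_beta_ne_zero_of_weak`),
  but §9 stays informative: it holds WITHOUT the new conjunct.  Dropping `HasWeakCouplingLimit` gives
  back 8646 (stamped, open) — so no `_false_without_HasWeakCouplingLimit` theorem can exist short of
  refuting 8646; the conjunct is a restriction on witnesses, not a hypothesis.
* Why 16154 resists (no kill): as for 8646 (below) — no junk `G` (faithful `r` ⇒ Lie; connected,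
  non-abelian), no junk values of `S` (all clauses live on `⁰𝒮`), and now no junk scheme either.  The
  only `G`-uniform obstruction to the new pair (`β_k → ∞`, `HasLatticeMassGap`) would be the abelian
  Coulomb phase (`Literature.Barriers.QuantumFields.AbelianMasslessPhaseD4`, itself OPEN for Wilson's
  action, and `U(1)` is excluded by `IsSimpleCompactGroup`); finite subgroups are excluded by
  connectedness and are massive at large `β` anyway (`DiscreteSubgroupFreezing`).  IN PRINT, the one
  scenario under which the re-typed crux FAILS while the 8646 body could survive is the heterodox
  Patrascioiu–Seiler conjecture of a zero-temperature deconfining transition at FINITE `β_c` in `d = 4`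
  non-abelian lattice Yang–Mills with a massless weak-coupling phase (Patrascioiu–Seiler–Linke–Stamatescu,
  Nuovo Cim. B (1989) doi:10.1007/bf02906319; Patrascioiu–Seiler, PRL 74 (1995) 1924
  doi:10.1103/physrevlett.74.1924 "Superinstantons …"; arXiv:hep-th/0002153 "Absence of asymptotic freedom
  in non-abelian models"): there `HasLatticeMassGap` fails along every `β_k → ∞` (no exponential clustering
  beyond `β_c`) exactly as for `U(1)`, so `sch.HasWeakCouplingLimit ∧ HasLatticeMassGap` is unsatisfiable —
  the new conjunct is a bet AGAINST that scenario (numerically disfavoured, neither proved nor refuted;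
  lit sweep 2026-08-16 degraded: searchd ECONNRESET, OpenAlex/S2 429, found via Crossref/zbMATH/arXiv).
* TREE STATE WARNING (2026-08-16T19:00Z, for the lead/planner): `Theses/PencilRigidity.lean` dropped its
  decl `HypercubicLimit` at the 17:42Z restatement, but `Theorems/HypercubicLimit/Negative/OneFieldReduction.lean`
  (`hypercubicLimit_iff_oneField`) and `…/BetaMustLeaveZero.lean` (`hypercubicLimit_witness_beta_ne_zero`)
  still name `PencilRigidity.HypercubicLimit`, and `Theses/MirrorModularBoosts.lean` imports
  `OneFieldReduction` — on a fresh build those three modules fail (the farm currently serves stale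
  oleans: `MirrorModularBoosts.WeakCouplingHypercubicLimit` is "unknown identifier" there).  This file
  therefore imports `Theses/CoincidenceRotationBootstrap` (fresh, same item) and states the 16154
  theorems against ITS decl.

## Cycles 1–3 (crux `stmt-QuantumFields-8646`): original header

`HypercubicLimit` (8646 body; shared verbatim at the time by routes PencilRigidity / MirrorModularBoosts /
CoincidenceRotationBootstrap) = "for every compact simple Lie group `G` there is a Wilson scheme
`sch`, a faithful unitary `r` and a labelled Schwinger family `S` on `ℝ⁴` over ALL gauge-invariant
lattice observables with E0–E4 (minus rotations, plus proper-hypercubic invariance), convergence of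
all joint lattice `n`-point functions to `S` on real off-diagonal tensors, non-triviality and
non-Gaussianity of the curvature species, a continuum mass gap and a volume-uniform lattice gap".
It is the Clay existence-and-gap problem minus `SO(4)`; no kill is expected and none was found.
This file records, as CHECKED Lean (rc 0, no `sorry` unless marked near-miss), what any proof
must use and which parts of the statement carry no weight.  Prose lives in docstrings only.

## Relation to the tree (read before re-proving) — what is LANDED from this file

* §1/§2 were found independently for the sibling crux `LatticeGapOnTrajectory` and are landed there:
  `Summit.QuantumFields.YangMills.Theorems.LatticeGapOnTrajectory.Negative.hasLatticeMassGap_of_zero_coupling`,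
  `…gap_clauses_junk_reachable` (`Theorems/LatticeGapOnTrajectory/Negative/ZeroCouplingGap.lean`).
* From THIS file, accepted into `Summits/QuantumFields/YangMills/Theorems/HypercubicLimit/Negative/`
  (namespace `Summit.QuantumFields.YangMills.Theorems.HypercubicLimit.Negative`, all `--supports 8646`):
  `AllTimesGapFalse.lean` (p70342, §5/§5b), `NonTrivialityBridge.lean` (p70412, §3: bridge, converse,
  `twoPointNontrivial_iff_real`), `NonabelianLoadBearing.lean` (p71139, §3: `twoPointNontrivial_iff_lattice`,
  `hypercubicLimit_false_without_nonabelian`), `ExtendByZero.lean` (p70480, §4) + `OneFieldReduction.lean`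
  (p71166, §4: `hypercubicLimit_iff_oneField`), `TruncatedOSForm.lean` (p71188, §8: `osTrunc_cauchySchwarz`,
  `twoPointNontrivial_iff_diagonal`, `twoPointNontrivial_iff_lattice_diagonal`).  IMPORT those; this work
  file keeps its own copies only to stay self-contained.
* Cycle 3 IMPORTED the sibling crux's landed `β ≡ 0` collapse
  (`Theorems/CurvatureBoostCovariance/Negative/BetaZeroTie.lean`, p71676: `latticeSchwinger_beta_zero`,
  `tie_beta_zero_factorises`) for §9 (import REMOVED in crux-16154 cycle 1 — its chain reaches the
  non-building `Theses/MirrorModularBoosts.lean`; §9 is now a pointer to the landed p72480), and mirrors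
  the PICKED line's objects verbatim in §10
  (`Targets.*`; the lead's file is `Cruxes/HypercubicLimit/Lines/conditional-mean-telescoping.lean`).
  LANDED from cycle 3 (ACCEPTED, `--supports 8646`, namespace `…Theorems.HypercubicLimit.Negative`):
  `BetaMustLeaveZero.lean` (p72480: §9 — `eventually_beta_ne_zero_of_converges_nontrivial`,
  `not_twoPointNontrivial_of_frequently_beta_zero`, `hypercubicLimit_witness_beta_ne_zero`) and
  `ReflectedDensity.lean` (p73007: §§11–12 — `torusPlaquette`, `torusDensity`, `thetaZ`, `reflDensity`,
  `rpSquare` verbatim from the picked line; `torusDensity_timeReflect`, `reflDensity_sub_torusDensity`,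
  `sum_mul_reflDensity_sub`, `rpSquare_nonneg`).  The lead / closure prover should IMPORT these.

## Findings (index)

* §0 `hypercubicLimit_iff` — the crux unbundled into `Clauses r sch S` (definitional).
* §1 **`β ≡ 0` blindness of the uniform lattice gap** (new in cycle 2, any scheme):
  `wilsonMeasure_zero` (Wilson's measure at `β = 0` is product Haar),
  `latticeConnectedCorr_zero_eq_zero` (exact decorrelation beyond twice the support scale),
  `integral_configShift_torusLift` (translation invariance of torus means, every `β`),
  `hasLatticeMassGap_of_beta_eq_zero` (EVERY scheme with `β_k = 0` has `HasLatticeMassGap r sch Δ`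
  for EVERY `Δ`, every `G`, `r`; the volume condition is not even used).  Moral for provers: the
  clause `HasLatticeMassGap` constrains a witness only through the coupling sequence `β_k` it
  shares with the convergence clause; it is the convergence clause + non-triviality that force
  `β_k` off the strong-coupling fixed point.
* §2 `clausesWithoutNontriviality_vacuum` — with both non-triviality clauses deleted the crux is
  a THEOREM for every compact `G` and every `r` (vacuum family + degenerate scheme); so the two
  non-triviality clauses are the entire obstruction, and every other clause is jointly satisfiable
  by junk.
* §3 **Bridge real → complex** `not_twoPointNontrivial_of_factorizes`: if `𝔖₂` factorises on
  every REAL off-diagonal tensor `u ⊗ v` (the only objects the convergence clause speaks about)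
  then the complex, time-ordered clause `TwoPointNontrivial` fails (decompose `θF̄₁ ⊗ G₁` into
  four real tensors supported in `{t<0} × {t>0}`, hence in `⁰𝒮`).  Application: for the trivial
  group every lattice `n`-point function is the product of one-point functions
  (`latticeSchwinger_eq_prod_of_subsingleton`), so Converges ⇒ factorisation ⇒ no witness:
  `hypercubicLimit_false_without_nonabelian` — weakening `IsCompactSimpleLieGroup` to
  "compact, connected, linear" makes the crux FALSE (`G = PUnit`); non-abelianness is
  load-bearing, and it enters ONLY through the non-triviality clause.
  Converse `twoPointNontrivial_of_real` and the characterisations `twoPointNontrivial_iff_real`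
  (non-triviality ⇔ ONE real truncated two-point value `𝔖₂(u ⊗ v) ≠ 𝔖₁(u)𝔖₁(v)` with
  `supp u ⊆ {t<0}`, `supp v ⊆ {t>0}`) and `twoPointNontrivial_iff_lattice` (under `Converges`:
  ⇔ the truncated LATTICE two-point function of the smeared species on such a pair does not tend
  to `0` along the scheme) — the single number a prover must keep away from zero.
* §4 **One-field reduction** (new in cycle 2) `hypercubicLimit_iff_oneField`:
  `HypercubicLimit ↔ ∀ G …, ∃ r sch (S₁ : SchwingerFamily ℝ⁴), Clauses₁ r sch S₁` — ONE scalar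
  field (the curvature) with E0–E4 + translations + hypercubic invariance, `Converges₁` (verbatim
  the first clause of the route's `W₁`), non-triviality, non-Gaussianity, `HasMassGap`, and
  `HasLatticeMassGap`.  Proof: restriction to the constant label string one way; the other way
  renormalise every other species to zero (`onlySpecies`, `c_s ≡ 0` off the curvature) and extend
  the one-field family by zero (`extendByZero`), which preserves every OS axiom
  (`osClauses_extendByZero`; E2 by zeroing the test functions of "bad" label strings).  So the
  labelled ALL-species packaging ("the reconstructed Hilbert space is that of the whole theory")
  carries no weight beyond `HasLatticeMassGap`, which sees `(a_k, β_k, L_k)` only (§1): a prover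
  may construct a single scalar field, an ideator should not expect help from the other species.
* §5 `hasLatticeMassGap_of_nonpos` (`Δ ≤ 0` ⇒ the lattice clause holds for EVERY scheme: `0 < Δ`
  is load-bearing); `latticeConnectedCorr_add_side` (torus time-correlations are PERIODIC with
  period `2S+1`); `latticeConnectedCorr_eq_zero_of_allTimes` (the natural strengthening of
  `HasLatticeMassGap` dropping `n ≤ S` forces every connected torus correlation, every variance
  included, to vanish eventually — degenerate; the restriction `n ≤ S` is essential, not cosmetic);
  §5b makes this an outright refutation of the strengthening: `isOpenPosMeasure_wilsonMeasure`
  (Wilson's measure charges every open set), `variance_pos`, `actionDensity_ne` (the curvature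
  observable separates `1` from the commutator configuration `dirConfig a b` for non-commuting
  `a, b` — `eq_one_of_re_trace_eq_card`), hence `not_hasLatticeMassGapAllTimes` for every
  non-abelian `G`, every faithful `r`, every scheme, every `Δ > 0`, and `not_clauses_with_allTimes`.
* §5c `hasLatticeMassGap_anti`, `hasMassGap_anti`, `gaps_iff_separate`: both gap clauses are downward
  closed in the rate, so ONE common `Δ` ⇔ two separate gaps (the shared `Δ` is not load-bearing).
* §8 **Reflection-positivity upgrade (new in cycle 2)**, via the tree's `OSReconstructionNoE1` (GNS
  Hilbert space from E2 + translations): the truncated OS form `T(a,b) = 𝔖₂(θa ⊗ b) − 𝔖₁(θa)𝔖₁(b)`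
  is the Gram form of the vacuum-subtracted field vectors (`osTrunc_eq_inner`), hence
  `osTrunc_cauchySchwarz` (`|T(a,b)|² ≤ T(a,a)T(b,b)`), `osTrunc_self` (`T(a,a) = ‖χ_a‖² ≥ 0`), and
  `twoPointNontrivial_iff_diagonal`: non-triviality ⇔ `T(v,v) > 0` for ONE real positive-time `v`;
  in lattice terms `twoPointNontrivial_iff_lattice_diagonal`: ⇔ the truncated reflection-symmetric
  lattice two-point function `⟨Φ_k(θv)Φ_k(v)⟩ − ⟨Φ_k(θv)⟩⟨Φ_k(v)⟩` of the smeared curvature converges to a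
  strictly POSITIVE number for one `v` — the prover's target is a positivity statement, the
  adversary's a vanishing statement.
* §7 `latticeSchwinger_one`: closed form `⟨Φ_k(f)⟩ = c_s(k) a_k⁴ (⟨O_s⟩_k − m_s(k)) ∑_{x∈box} f(a_k x)` (any
  `β`): at `n = 1` the convergence clause is a Riemann-sum statement; `m_s` is bookkeeping.
* §6 `pairwise_mul_eq_zero_of_isOffDiagonal₃`: audit of the non-Gaussianity clause's sub-tensors.
* §9 **(cycle 3) `β` must leave `0`**: `factorizes_of_frequently_beta_zero`,
  `not_twoPointNontrivial_of_frequently_beta_zero`, `not_clauses_of_frequently_beta_zero`,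
  `eventually_beta_ne_zero_of_clauses`, `hypercubicLimit_witness_beta_ne_zero`,
  `threePoint_trunc_eq_zero_of_frequently_beta_zero` — for EVERY `c_k, m_k, a_k, L_k` and every
  faithful `r`, a scheme with `β_k = 0` frequently cannot witness the clauses (the curvature is an exact
  c-number field on off-diagonal real tensors there; bridge §3).  With §1 this nails the strong-coupling
  end from both sides: at `β = 0` the lattice-gap clause is free and the non-triviality clause is dead.
* §10 **(cycle 3) Targets = the PICKED line `conditional-mean-telescoping`** (7 stubs): verbatim
  mirror of its objects; `cubeEdges_zero` / `exterior_zero` / `influence_radius_zero` (the `R = 0` edge: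
  influence = plain `Lᵖ` norm, (T) = Hölder there), `telescoping_n_zero` / `telescoping_n_one`, and a
  PROOF of the registered stub (M) `influenceAntitone_holds : InfluenceAntitone` (tower +
  `Lᵖ`-contraction; positive, offered as evidence).  Paper audit of all seven stubs in the §10
  docblock: none refutable by a junk/degenerate instance, none vacuous; (WIₙ) restated as a uniform
  stretched-exponential tail bound for `E[δp | ext_R]/‖·‖₂`, consistent with Gaussian chaos at `R = 1`
  and with semiclassical lumps at `R ≍ ξ` (`γ = 1`); (NG)'s constant is `O(g²)` (free `F²` has zero
  three-point function at separated points in `d = 4`).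
* §11 **(cycle 3) the lattice mirror of the curvature** (`thetaZ`, `torusPlaquette_timeReflect_temporal`
  / `_spatial`, `torusDensity_eq_sum`, `torusDensity_timeReflect`, `reflDensity_sub_torusDensity`,
  `sum_mul_reflDensity_sub`): under the odd-torus `Θ` the action density at `x` becomes the REFLECTED
  density at `θx` (temporal plaquettes hang down), `P̃ = P − ∇₀⁻E`; smeared, the swap is the electric
  part against a forward difference of the test function — one lattice spacing of a derivative times
  the uncontrolled `c_k`.  This is the precise obstruction to an adversary-side "`ξ_lat·a_k ↛ 0` is
  necessary" theorem for general witnesses, and the estimate the closure prover owes for E2.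
* §12 **(cycle 3) `rpSquare_nonneg`**: the line's reference quantity `A(β,S,R)` is a genuine OS square,
  `≥ 0` for `β ≥ 0`, `1 ≤ R ≤ S` (tree `wilsonExpectation_oddReflectionPositive`; the four links of
  `p₀₁(R e₀)` lie in `P ∪ M`) — no sign trap in (W2)/(WI₂)/(NG); the guards are exactly these.

## Why the crux resists (no kill; recorded for ideators)

* No junk `G`: `LatticeRep G` embeds `G` continuously and injectively into `U(N)`, so `G` is a
  compact Hausdorff (hence Lie) group, connected and non-abelian with simple Lie algebra — a genuine
  `SU(n)/SO(n)/Sp(n)/exceptional` quotient.  §3 shows the first junk candidate (`PUnit`) is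
  excluded exactly by non-abelianness.
* No junk values of `S`: every clause evaluates `S` only on `⁰𝒮` (time-ordered supports, or
  explicit `IsOffDiagonal`) or in arities `0, 1`; in `ThreePointNonGaussian` the two-point
  sub-tensors `g ⊗ h`, `f ⊗ h`, `f ⊗ g` are automatically in `⁰𝒮` because `f ⊗ g ⊗ h ∈ ⁰𝒮` forces
  `fg = gh = fh = 0` pointwise and, for smooth functions with `gh ≡ 0`, at every point all
  derivatives of `g` or all derivatives of `h` vanish (paper argument: a point where some
  derivative of `g` is non-zero has a neighbourhood on which `{g ≠ 0}` is dense).  So the freedom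
  of the witness off `⁰𝒮` is never exploitable.
* Witness freedom does not help: `β_k` is free but SHARED between `Converges` and
  `HasLatticeMassGap` (§1: at `β ≡ 0` the gap clause is free but the lattice correlations are
  ultralocal); `c_s(k)` is free but on off-diagonal real tensors `f ⊗ g` (with `fg ≡ 0`, hence `g`
  flat on `{f ≠ 0}`) a lattice-scale correlation length contributes `O(a_k^M)` for every `M`, so no
  polynomial `c_k` rescues a non-trivial limit at fixed/strong coupling, and a super-polynomial
  `c_k` cannot serve all test functions at once (no slowest vanishing order).  Non-triviality thus
  forces a lattice correlation length `ξ_k ≳ 1/a_k`, i.e. `β_k → β_c` — the open problem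
  (Bałaban stops at UV stability; no IR control; Chatterjee's Problems 5.1–5.2).
* `β_k` must leave `0` (§9, theorem) but nothing proved forces `β_k → ∞`: for `0 < β` small the
  Osterwalder–Seiler cluster expansion gives a finite lattice correlation length, and the §8 RP form
  then says `T_k(θu ⊗ τ_s u) ≤ e^{−2(s/a_k) m(β_k)} T_k(θu ⊗ u)`, which kills every limit IF the shift
  `s` is a lattice vector for all large `k` (M-adic schemes) — for a general `a_k` the comparison needs
  a `k`-uniform modulus of continuity of the lattice functionals in the test function, which the
  statement does not provide (recorded obstruction; the M-adic case is a clean target for cycle 4).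
* The three invariance clauses (translations by all `a ∈ ℝ⁴`, proper signed permutations) are
  NOT formal consequences of `Converges` (lattice symmetries act by `a_k ℤ⁴`-translations and by
  plaquette relabellings that move the curvature's six plaquettes to other orthants; passing to
  the limit would need a modulus of continuity of the lattice functionals uniform in `k`, which
  the statement does not provide) — independent but physically automatic clauses; no lever.
-/

noncomputable section

open scoped SchwartzMap ComplexConjugate ComplexOrder ENNReal Matrix InnerProductSpace
open MeasureTheory Filter Topology Complex ProbabilityTheory
open Literature.MathematicalPhysics.AQFT Literature.MathematicalPhysics.QuantumLattice
open Literature.MathematicalPhysics.QuantumFieldTheory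
open Literature.Probability.LatticeModels (Site Torus.proj)

namespace Summit.QuantumFields.YangMills.Cruxes.HypercubicLimit.Disproof

local notation "E4" => EuclideanSpace ℝ (Fin 4)
local notation "ZdEdge4" => Literature.MathematicalPhysics.QuantumLattice.ZdEdge 4

/-! ## §0 The crux unbundled -/

section Clauses

variable {ι : Type}

/-- OS clauses E0 (normalisation, hermiticity), E0', E2, E3, E4, translation invariance and
proper-hypercubic invariance on `⁰𝒮` — the first conjunct block of the crux (any label type). -/
def OSClauses (S : LabelledSchwingerFamily ι E4) : Prop :=
  S.IsNormalized ∧ S.IsHermitian ∧ S.HasLinearGrowth ∧ S.IsReflectionPositive ∧ S.IsSymmetric ∧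
    S.HasClusterProperty ∧
    (∀ (n : ℕ) (k : Fin n → ι) (a : E4) (F : 𝓢((Fin n → E4), ℂ)), IsOffDiagonal F →
      S n k (translateMulti a F) = S n k F) ∧
    (∀ (n : ℕ) (k : Fin n → ι) (R : E4 ≃ₗᵢ[ℝ] E4),
      LinearMap.det (R.toLinearEquiv : E4 →ₗ[ℝ] E4) = 1 →
      (∀ i : Fin 4, ∃ j : Fin 4, R (EuclideanSpace.single i 1) = EuclideanSpace.single j 1 ∨
        R (EuclideanSpace.single i 1) = -EuclideanSpace.single j 1) →
      ∀ F : 𝓢((Fin n → E4), ℂ), IsOffDiagonal F → S n k (linActMulti R F) = S n k F)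

/-- Non-triviality of the species `s` (truncated two-point function not identically zero on
time-ordered arguments) — the crux's clause, `OSData.IsNontrivial` unbundled. -/
def TwoPointNontrivial (S : LabelledSchwingerFamily ι E4) (s : ι) : Prop :=
  ∃ (F₁ G₁ : 𝓢((Fin 1 → E4), ℂ)) (H₁ : 𝓢((Fin (1 + 1) → E4), ℂ)),
    IsTimeOrdered F₁ ∧ IsTimeOrdered G₁ ∧ IsAppendTensorOf H₁ (osAdjoint F₁) G₁ ∧
      S (1 + 1) (fun _ => s) H₁ ≠ S 1 (fun _ => s) (osAdjoint F₁) * S 1 (fun _ => s) G₁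

/-- Non-Gaussianity of the species `s` (some connected three-point function is non-zero) — the
crux's clause, `OSData.IsNonGaussian` unbundled. -/
def ThreePointNonGaussian (S : LabelledSchwingerFamily ι E4) (s : ι) : Prop :=
  ∃ (f g h : 𝓢(E4, ℂ)) (Ffgh : 𝓢((Fin 3 → E4), ℂ)) (Fgh Ffh Ffg : 𝓢((Fin 2 → E4), ℂ))
    (Ff Fg Fh : 𝓢((Fin 1 → E4), ℂ)),
    IsTensorOf Ffgh ![f, g, h] ∧ IsOffDiagonal Ffgh ∧ IsTensorOf Fgh ![g, h] ∧
    IsTensorOf Ffh ![f, h] ∧ IsTensorOf Ffg ![f, g] ∧ IsTensorOf Ff ![f] ∧ IsTensorOf Fg ![g] ∧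
    IsTensorOf Fh ![h] ∧
      S 3 (fun _ => s) Ffgh - S 1 (fun _ => s) Ff * S 2 (fun _ => s) Fgh -
        S 1 (fun _ => s) Fg * S 2 (fun _ => s) Ffh - S 1 (fun _ => s) Fh * S 2 (fun _ => s) Ffg +
        2 * (S 1 (fun _ => s) Ff * S 1 (fun _ => s) Fg * S 1 (fun _ => s) Fh) ≠ 0

variable {G : Type} [Group G] [TopologicalSpace G] [IsTopologicalGroup G] [CompactSpace G]
  [MeasurableSpace G] [BorelSpace G]

/-- The convergence clause (`IsYangMillsFor` unbundled): joint lattice `n`-point functions of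
every species string converge along `sch` on real off-diagonal tensors. -/
def Converges (r : LatticeRep G) (sch : SpeciesScheme (YMSpecies G))
    (S : LabelledSchwingerFamily (YMSpecies G) E4) : Prop :=
  ∀ (n : ℕ), n ≠ 0 → ∀ (σ : Fin n → YMSpecies G) (f : Fin n → 𝓢(E4, ℝ)) (F : 𝓢((Fin n → E4), ℂ)),
    IsTensorOf F (fun i => ofRealTest (f i)) → IsOffDiagonal F →
      Tendsto (fun k : ℕ => ((latticeSchwinger r.ρ sch (fun s => s.F) k n σ f : ℝ) : ℂ))
        atTop (𝓝 (S n σ F))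

/-- The two gap clauses with a common rate. -/
def Gaps {κ : Type} (r : LatticeRep G) (sch : SpeciesScheme κ)
    (S : LabelledSchwingerFamily ι E4) : Prop :=
  ∃ Δ : ℝ, 0 < Δ ∧ S.HasMassGap Δ ∧ HasLatticeMassGap r sch Δ

/-- All clauses of the crux for one gauge group and one witness `(r, sch, S)`. -/
def Clauses (r : LatticeRep G) (sch : SpeciesScheme (YMSpecies G))
    (S : LabelledSchwingerFamily (YMSpecies G) E4) : Prop :=
  OSClauses S ∧ Converges r sch S ∧ TwoPointNontrivial S r.curvature ∧
    ThreePointNonGaussian S r.curvature ∧ Gaps r sch S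

end Clauses

/-- **The 8646 body, kept locally** (`= MirrorModularBoosts.HypercubicLimit`, item
`stmt-QuantumFields-8646`, by `Iff.rfl` whenever that module builds; `Theses/PencilRigidity.lean`
dropped the decl on 2026-08-16): every compact simple Lie group admits a witness `(r, sch, S)` of
`Clauses`.  All of §§1–12 are statements about `Clauses`, hence about this Prop. -/
def HypercubicLimit8646 : Prop :=
  ∀ (G : Type) [Group G] [TopologicalSpace G] [IsTopologicalGroup G] [CompactSpace G],
    IsCompactSimpleLieGroup G →
      letI : MeasurableSpace G := borel G
      haveI : BorelSpace G := ⟨rfl⟩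
      ∃ (r : LatticeRep G) (sch : SpeciesScheme (YMSpecies G))
        (S : LabelledSchwingerFamily (YMSpecies G) E4), Clauses r sch S

/-- **The live crux (item `stmt-QuantumFields-16154`), unbundled.** `HypercubicLimit` (route
CoincidenceRotationBootstrap; verbatim `MirrorModularBoosts.WeakCouplingHypercubicLimit`) says:
every compact simple Lie group admits a witness `(r, sch, S)` of `Clauses` whose scheme is AT WEAK
COUPLING, `sch.HasWeakCouplingLimit` (`β_k → +∞`) — definitional unfolding. -/
theorem hypercubicLimit_iff :
    Summit.QuantumFields.YangMills.Theses.CoincidenceRotationBootstrap.HypercubicLimit ↔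
      ∀ (G : Type) [Group G] [TopologicalSpace G] [IsTopologicalGroup G] [CompactSpace G],
        IsCompactSimpleLieGroup G →
          letI : MeasurableSpace G := borel G
          haveI : BorelSpace G := ⟨rfl⟩
          ∃ (r : LatticeRep G) (sch : SpeciesScheme (YMSpecies G))
            (S : LabelledSchwingerFamily (YMSpecies G) E4), sch.HasWeakCouplingLimit ∧ Clauses r sch S :=
  Iff.rfl

/-- **The re-type is monotone**: the weak-coupling crux implies the 8646 body (drop the new
conjunct), so every negative lemma about `Clauses` / `HypercubicLimit8646` (§§1–12 and the landed
`Theorems/HypercubicLimit/Negative/*`) bears on the live crux verbatim. -/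
theorem hypercubicLimit_imp_8646
    (h : Summit.QuantumFields.YangMills.Theses.CoincidenceRotationBootstrap.HypercubicLimit) :
    HypercubicLimit8646 := by
  intro G _ _ _ _ hG
  obtain ⟨r, sch, S, -, hc⟩ := hypercubicLimit_iff.1 h G hG
  exact ⟨r, sch, S, hc⟩

/-! ## §1 `β = 0`: Wilson's measure is product Haar and the uniform lattice gap is automatic

### Independence of disjoint coordinate blocks under a finite product measure -/

/-- Functions of disjoint coordinate blocks are uncorrelated under a finite product probability
measure (real-valued version of the tree's `LatticeRP.integral_mul_eq_of_dependsOn`). -/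
theorem integral_mul_eq_of_dependsOn_disjoint {ι X : Type*} [Fintype ι] [DecidableEq ι]
    [MeasurableSpace X] (μ₀ : Measure X) [IsProbabilityMeasure μ₀] {S T : Finset ι}
    (hST : Disjoint S T) {f g : (ι → X) → ℝ} (hf : Measurable f) (hg : Measurable g)
    (hfS : DependsOn f (S : Set ι)) (hgT : DependsOn g (T : Set ι)) :
    ∫ U, f U * g U ∂(Measure.pi fun _ : ι => μ₀) =
      (∫ U, f U ∂(Measure.pi fun _ : ι => μ₀)) * ∫ U, g U ∂(Measure.pi fun _ : ι => μ₀) := by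
  obtain ⟨x₀⟩ : Nonempty (ι → X) := by
    have : Nonempty X := MeasureTheory.nonempty_of_isProbabilityMeasure μ₀
    infer_instance
  have hind : iIndepFun (fun i (U : ι → X) => U i) (Measure.pi fun _ : ι => μ₀) :=
    iIndepFun_pi (X := fun _ : ι => @id X) fun _ => aemeasurable_id
  have hXY : IndepFun (fun (U : ι → X) (i : S) => U i) (fun (U : ι → X) (i : T) => U i)
      (Measure.pi fun _ : ι => μ₀) :=
    hind.indepFun_finset S T hST fun i => measurable_pi_apply i
  set f' : (S → X) → ℝ := fun a => f (Function.updateFinset x₀ S a)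
  set g' : (T → X) → ℝ := fun b => g (Function.updateFinset x₀ T b)
  have hf' : Measurable f' := hf.comp measurable_updateFinset
  have hg' : Measurable g' := hg.comp measurable_updateFinset
  have hff : ∀ U, f' (fun i : S => U i) = f U := fun U =>
    hfS fun i hi => by simp [Function.updateFinset, Finset.mem_coe.1 hi]
  have hgg : ∀ U, g' (fun i : T => U i) = g U := fun U =>
    hgT fun i hi => by simp [Function.updateFinset, Finset.mem_coe.1 hi]
  have := hXY.integral_fun_comp_mul_comp
    (measurable_pi_lambda _ fun i => measurable_pi_apply _).aemeasurable
    (measurable_pi_lambda _ fun i => measurable_pi_apply _).aemeasurable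
    hf'.aestronglyMeasurable hg'.aestronglyMeasurable
  simpa only [hff, hgg] using this

/-! ### `β = 0`: the Wilson measure is product Haar; the uniform lattice gap is automatic -/

section BetaZero

variable {G : Type} [Group G] [TopologicalSpace G] [IsTopologicalGroup G] [CompactSpace G]
  [MeasurableSpace G] [BorelSpace G]

/-- At `β = 0` Wilson's measure is the product of Haar probability measures over the edges
(whatever the representation). -/
theorem wilsonMeasure_zero {N : ℕ} (ρ : G →* Matrix (Fin N) (Fin N) ℂ) (L : ℕ) [NeZero L] :
    wilsonMeasure (d := 4) (L := L) ρ 0 = Measure.pi fun _ : Edge 4 L => haarProbability G := by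
  have h1 : (fun U : GaugeConfig 4 L G => ENNReal.ofReal (Real.exp (-0 * wilsonAction ρ U))) =
      fun _ => 1 := by
    funext U; simp
  have h2 : (Measure.pi fun _ : Edge 4 L => haarProbability G).withDensity
      (fun U : GaugeConfig 4 L G => ENNReal.ofReal (Real.exp (-0 * wilsonAction ρ U))) =
      Measure.pi fun _ : Edge 4 L => haarProbability G := by
    rw [h1]; exact withDensity_one
  simp only [wilsonMeasure, partitionFunction, wilsonWeight, h2, measure_univ, inv_one, one_smul]

omit [Group G] [TopologicalSpace G] [IsTopologicalGroup G] [CompactSpace G] [BorelSpace G] in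
/-- The periodic lift is measurable. -/
theorem measurable_torusLift' (L : ℕ) : Measurable (torusLift (d := 4) (G := G) L) :=
  measurable_pi_lambda _ fun _ => measurable_pi_apply _

/-- **Translation invariance of the torus means**: shifting the observable on `ℤ⁴` before the
periodic lift does not change its Wilson expectation (any `β`). -/
theorem integral_configShift_torusLift {N : ℕ} (ρ : G →* Matrix (Fin N) (Fin N) ℂ) (β : ℝ)
    (L : ℕ) [NeZero L] (B : LGConfig 4 G → ℝ) (w : Site 4) :
    ∫ U, B (configShift w (torusLift L U)) ∂(wilsonMeasure (d := 4) (L := L) ρ β) =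
      ∫ U, B (torusLift L U) ∂(wilsonMeasure (d := 4) (L := L) ρ β) := by
  have h := wilsonExpectation_comp_torusConfigShift (d := 4) (L := L) ρ β (Torus.proj L w)
    (toTorusObservable L B)
  rw [← toTorusObservable_comp_configShift] at h
  simpa [wilsonExpectation, toTorusObservable] using h

omit [TopologicalSpace G] [IsTopologicalGroup G] [CompactSpace G] [BorelSpace G] [Group G]
  [MeasurableSpace G] in
/-- Two torus edges below lattice edges whose time coordinates differ by `t` with
`0 < t < L` are distinct. -/
theorem torusEdge_ne_of_time {L : ℕ} {e e' : ZdEdge4} (h0 : 0 < e'.1 0 - e.1 0)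
    (hL : e'.1 0 - e.1 0 < L) : torusEdge L e ≠ torusEdge L e' := by
  intro h
  have h' : (e.1 0 : ZMod L) = (e'.1 0 : ZMod L) := by
    have := congrArg (fun p : Edge 4 L => p.1 0) h
    simpa [torusEdge] using this
  rw [ZMod.intCast_eq_intCast_iff_dvd_sub] at h'
  have hz := Int.eq_zero_of_dvd_of_natAbs_lt_natAbs h'
    (Int.natAbs_lt_natAbs_of_nonneg_of_lt h0.le hL)
  omega

/-- **At `β = 0`, connected time-correlations vanish beyond the support scale**: if the time
coordinates of the supports of `A, B` are bounded by `M`, then on the torus of side `2S+1`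
the connected correlation at time separation `2M < n ≤ S` is `0` (independence of disjoint edge
blocks under product Haar, plus translation invariance of the mean). -/
theorem latticeConnectedCorr_zero_eq_zero {N : ℕ} (ρ : G →* Matrix (Fin N) (Fin N) ℂ)
    (A B : YMSpecies G) (M S n : ℕ) (hA : ∀ e ∈ A.supp, (e.1 0).natAbs ≤ M)
    (hB : ∀ e ∈ B.supp, (e.1 0).natAbs ≤ M) (hn1 : 2 * M < n) (hn2 : n ≤ S) :
    latticeConnectedCorr ρ 0 (2 * S + 1) A.F B.F n = 0 := by
  classical
  have hlift := measurable_torusLift' (G := G) (2 * S + 1)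
  have hmean := integral_configShift_torusLift ρ 0 (2 * S + 1) B.F (-Pi.single 0 (n : ℤ))
  rw [wilsonMeasure_zero] at hmean
  set v : Site 4 := Pi.single 0 (n : ℤ) with hv
  set SA : Finset (Edge 4 (2 * S + 1)) := A.supp.image (torusEdge (2 * S + 1)) with hSA
  set TB : Finset (Edge 4 (2 * S + 1)) :=
    B.supp.image (fun e => torusEdge (2 * S + 1) (e.1 - -v, e.2)) with hTB
  have hdepA : DependsOn (fun U : GaugeConfig 4 (2 * S + 1) G => A.F (torusLift (2 * S + 1) U))
      (SA : Set (Edge 4 (2 * S + 1))) := by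
    intro U V hUV
    refine A.isCylinder fun e he => ?_
    exact hUV _ (Finset.mem_coe.2 (Finset.mem_image_of_mem _ he))
  have hdepB : DependsOn (fun U : GaugeConfig 4 (2 * S + 1) G =>
      B.F (configShift (-v) (torusLift (2 * S + 1) U))) (TB : Set (Edge 4 (2 * S + 1))) := by
    intro U V hUV
    refine B.isCylinder fun e he => ?_
    simp only [Literature.MathematicalPhysics.QuantumLattice.configShift_apply, torusLift,
      Function.comp_apply]
    exact hUV _ (Finset.mem_coe.2 (Finset.mem_image.2 ⟨e, he, rfl⟩))
  have hdisj : Disjoint SA TB := by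
    rw [Finset.disjoint_left]
    rintro t htA htB
    obtain ⟨e, he, rfl⟩ := Finset.mem_image.1 htA
    obtain ⟨e', he', h⟩ := Finset.mem_image.1 htB
    have hAe := hA e he
    have hBe := hB e' he'
    have h1 : (e.1 0 : ℤ) ≤ M := by omega
    have h2 : -(M : ℤ) ≤ e'.1 0 := by omega
    have ht : ((e'.1 - -v, e'.2) : ZdEdge4).1 0 = e'.1 0 + n := by
      simp [hv]
    refine torusEdge_ne_of_time (L := 2 * S + 1) (e := e) (e' := (e'.1 - -v, e'.2)) ?_ ?_ h.symm
    · rw [ht]; omega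
    · rw [ht]; push_cast; omega
  have hmA : Measurable fun U : GaugeConfig 4 (2 * S + 1) G => A.F (torusLift (2 * S + 1) U) :=
    A.measurable.comp hlift
  have hmB : Measurable fun U : GaugeConfig 4 (2 * S + 1) G =>
      B.F (configShift (-v) (torusLift (2 * S + 1) U)) :=
    B.measurable.comp ((configShift (-v)).measurable.comp hlift)
  have key := integral_mul_eq_of_dependsOn_disjoint (haarProbability G) hdisj hmA hmB hdepA hdepB
  unfold latticeConnectedCorr
  rw [wilsonMeasure_zero, key, hmean, sub_self]

omit [MeasurableSpace G] [BorelSpace G] [Group G] [TopologicalSpace G] [IsTopologicalGroup G]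
  [CompactSpace G] in
/-- The half-sides of a species scheme tend to infinity (from `a_k → 0` and `a_k L_k → ∞`). -/
theorem SpeciesScheme.tendsto_L_atTop {ι : Type} (sch : SpeciesScheme ι) :
    Tendsto (fun k => (sch.L k : ℝ)) atTop atTop := by
  have ha : ∀ᶠ k in atTop, sch.a k ≤ 1 := sch.tendsto_a.eventually (eventually_le_nhds one_pos)
  refine tendsto_atTop_mono' atTop ?_ sch.tendsto_L
  filter_upwards [ha] with k hk
  have hL : (0 : ℝ) ≤ sch.L k := Nat.cast_nonneg _
  calc sch.a k * sch.L k ≤ 1 * sch.L k := by gcongr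
    _ = sch.L k := one_mul _

/-- **`HasLatticeMassGap` is automatic at `β ≡ 0`, for EVERY rate `Δ`** (any spacings, volumes,
renormalisations, any `G`, `r`; the volume condition `S ≥ L_k` is not even used): beyond twice
the support scale the connected correlations vanish identically, below it they are bounded, and
`e^{-Δ a_k n} ≥ e^{-2|Δ|M}` there once `a_k ≤ 1`.
The uniform lattice gap clause therefore carries information only through the coupling `β_k` it
shares with the convergence clause. -/
theorem hasLatticeMassGap_of_beta_eq_zero {ι : Type} (r : LatticeRep G) (sch : SpeciesScheme ι)
    (hβ : ∀ k, sch.β k = 0) (Δ : ℝ) : HasLatticeMassGap r sch Δ := by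
  classical
  intro A B
  obtain ⟨CA, hCA⟩ := A.bounded
  obtain ⟨CB, hCB⟩ := B.bounded
  have hCA0 : 0 ≤ CA := le_trans (abs_nonneg _) (hCA fun _ => 1)
  have hCB0 : 0 ≤ CB := le_trans (abs_nonneg _) (hCB fun _ => 1)
  set M : ℕ := (A.supp ∪ B.supp).sup fun e => (e.1 0).natAbs with hM
  have hAM : ∀ e ∈ A.supp, (e.1 0).natAbs ≤ M := fun e he =>
    Finset.le_sup (f := fun e : ZdEdge4 => (e.1 0).natAbs) (Finset.mem_union_left _ he)
  have hBM : ∀ e ∈ B.supp, (e.1 0).natAbs ≤ M := fun e he =>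
    Finset.le_sup (f := fun e : ZdEdge4 => (e.1 0).natAbs) (Finset.mem_union_right _ he)
  refine ⟨2 * (CA * CB) * Real.exp (|Δ| * (2 * M)), ?_⟩
  have ha : ∀ᶠ k in atTop, sch.a k ≤ 1 := sch.tendsto_a.eventually (eventually_le_nhds one_pos)
  filter_upwards [ha] with k hak S _ n hnS
  by_cases hn : 2 * M < n
  · rw [hβ k, latticeConnectedCorr_zero_eq_zero r.ρ A B M S n hAM hBM hn hnS, abs_zero]
    positivity
  · have hn : n ≤ 2 * M := Nat.le_of_not_lt hn
    -- bounded regime: |corr| ≤ 2 C_A C_B ≤ C e^{-Δ a_k n}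
    haveI hπ : IsProbabilityMeasure (wilsonMeasure (d := 4) (L := 2 * S + 1) r.ρ (sch.β k)) := by
      rw [hβ k, wilsonMeasure_zero]; infer_instance
    have hb1 : ‖∫ U, A.F (torusLift (2 * S + 1) U) *
        B.F (configShift (-Pi.single 0 (n : ℤ)) (torusLift (2 * S + 1) U))
        ∂(wilsonMeasure (d := 4) (L := 2 * S + 1) r.ρ (sch.β k))‖ ≤ CA * CB := by
      refine (norm_integral_le_of_norm_le_const (C := CA * CB) ?_).trans (by simp)
      refine Eventually.of_forall fun U => ?_
      rw [norm_mul, Real.norm_eq_abs, Real.norm_eq_abs]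
      exact mul_le_mul (hCA _) (hCB _) (abs_nonneg _) hCA0
    have hb2 : ‖∫ U, A.F (torusLift (2 * S + 1) U)
        ∂(wilsonMeasure (d := 4) (L := 2 * S + 1) r.ρ (sch.β k))‖ ≤ CA := by
      refine (norm_integral_le_of_norm_le_const (C := CA) ?_).trans (by simp)
      exact Eventually.of_forall fun U => by rw [Real.norm_eq_abs]; exact hCA _
    have hb3 : ‖∫ U, B.F (torusLift (2 * S + 1) U)
        ∂(wilsonMeasure (d := 4) (L := 2 * S + 1) r.ρ (sch.β k))‖ ≤ CB := by
      refine (norm_integral_le_of_norm_le_const (C := CB) ?_).trans (by simp)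
      exact Eventually.of_forall fun U => by rw [Real.norm_eq_abs]; exact hCB _
    have hcorr : |latticeConnectedCorr r.ρ (sch.β k) (2 * S + 1) A.F B.F n| ≤ 2 * (CA * CB) := by
      unfold latticeConnectedCorr
      rw [← Real.norm_eq_abs]
      refine (norm_sub_le _ _).trans ?_
      rw [norm_mul]
      have := mul_le_mul hb2 hb3 (norm_nonneg _) hCA0
      linarith
    refine hcorr.trans ?_
    have hexp : Real.exp (-(|Δ| * (2 * M))) ≤ Real.exp (-(Δ * (sch.a k * n))) := by
      apply Real.exp_le_exp.2
      have ha0 : 0 ≤ sch.a k := (sch.a_pos k).le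
      have hn' : (n : ℝ) ≤ 2 * M := by exact_mod_cast hn
      have h1 : Δ * (sch.a k * n) ≤ |Δ| * (sch.a k * n) :=
        mul_le_mul_of_nonneg_right (le_abs_self Δ) (by positivity)
      have h2 : |Δ| * (sch.a k * n) ≤ |Δ| * (1 * (2 * M)) :=
        mul_le_mul_of_nonneg_left (mul_le_mul hak hn' (by positivity) zero_le_one) (abs_nonneg _)
      linarith
    calc 2 * (CA * CB) = 2 * (CA * CB) * Real.exp (|Δ| * (2 * M)) * Real.exp (-(|Δ| * (2 * M))) := by
          rw [mul_assoc (2 * (CA * CB)), ← Real.exp_add, add_neg_cancel, Real.exp_zero, mul_one]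
      _ ≤ 2 * (CA * CB) * Real.exp (|Δ| * (2 * M)) * Real.exp (-(Δ * (sch.a k * n))) := by
          gcongr

end BetaZero

/-! ## §2 The two non-triviality clauses are the only obstruction -/

section WithoutNontriviality

variable {ι : Type}

/-- The vacuum-only family satisfies every OS clause of the crux, translations and the
hypercubic clause included. -/
theorem osClauses_vacuum : OSClauses (OSData.vacuum ι 4).schwinger := by
  have h : OSAxiomsSchwinger (OSData.vacuum ι 4).schwinger := (OSData.vacuum ι 4).osAxioms
  exact ⟨h.normalized, h.hermitian, h.linearGrowth, h.reflectionPositive, h.symmetric, h.cluster,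
    fun n k a F hF => h.invariant.1 n k a F hF, fun n k R hR _ F hF => h.invariant.2 n k R hR F hF⟩

/-- The vacuum-only family has no non-trivial species. -/
theorem not_twoPointNontrivial_vacuum (s : ι) :
    ¬ TwoPointNontrivial (OSData.vacuum ι 4).schwinger s :=
  OSData.not_isNontrivial_vacuum (d := 4) s

/-- The vacuum-only family has no non-Gaussian species. -/
theorem not_threePointNonGaussian_vacuum (s : ι) :
    ¬ ThreePointNonGaussian (OSData.vacuum ι 4).schwinger s :=
  OSData.not_isNonGaussian_vacuum (d := 4) s

variable {G : Type} [Group G] [TopologicalSpace G] [IsTopologicalGroup G] [CompactSpace G]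
  [MeasurableSpace G] [BorelSpace G]

/-- The crux's clauses with BOTH non-triviality clauses deleted. -/
def ClausesWithoutNontriviality (r : LatticeRep G) (sch : SpeciesScheme (YMSpecies G))
    (S : LabelledSchwingerFamily (YMSpecies G) E4) : Prop :=
  OSClauses S ∧ Converges r sch S ∧ Gaps r sch S

/-- For EVERY compact group and EVERY lattice representation, the degenerate scheme
(`β ≡ 0`, `c ≡ m ≡ 0`) and the vacuum-only family satisfy all clauses of the crux except the
two non-triviality clauses — with every rate `Δ` (here `Δ = 1`). -/
theorem clausesWithoutNontriviality_vacuum (r : LatticeRep G) :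
    ClausesWithoutNontriviality r (SpeciesScheme.zero _) (OSData.vacuum (YMSpecies G) 4).schwinger :=
  ⟨osClauses_vacuum, isYangMillsFor_vacuum r,
    ⟨1, one_pos, OSData.vacuum_hasMassGap (ι := YMSpecies G) (d := 4) 1,
      hasLatticeMassGap_of_beta_eq_zero r _ (fun _ => rfl) 1⟩⟩

end WithoutNontriviality

/-! ## §3 From real off-diagonal tensors to the complex time-ordered clause -/

section Bridge

variable {ι : Type}

/-- Real part of a complex test function on `ℝ⁴`. -/
def reTest (F : 𝓢(E4, ℂ)) : 𝓢(E4, ℝ) := SchwartzMap.postcompCLM (𝕜 := ℝ) Complex.reCLM F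

/-- Imaginary part of a complex test function on `ℝ⁴`. -/
def imTest (F : 𝓢(E4, ℂ)) : 𝓢(E4, ℝ) := SchwartzMap.postcompCLM (𝕜 := ℝ) Complex.imCLM F

@[simp] theorem reTest_apply (F : 𝓢(E4, ℂ)) (x : E4) : reTest F x = (F x).re := rfl

@[simp] theorem imTest_apply (F : 𝓢(E4, ℂ)) (x : E4) : imTest F x = (F x).im := rfl

/-- The one-variable function `y ↦ conj F₁(θy)` behind `osAdjoint F₁` for a one-point `F₁`. -/
def adjOne (F₁ : 𝓢((Fin 1 → E4), ℂ)) : 𝓢(E4, ℂ) :=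
  starTest (SchwartzMap.compCLMOfContinuousLinearEquiv ℂ
    ((timeReflection 4).toContinuousLinearEquiv.trans
      (ContinuousLinearEquiv.funUnique (Fin 1) ℝ E4).symm) F₁)

theorem adjOne_apply (F₁ : 𝓢((Fin 1 → E4), ℂ)) (y : E4) :
    adjOne F₁ y = conj (F₁ (fun _ => timeReflection 4 y)) := by
  simp only [adjOne, starTest_apply, SchwartzMap.compCLMOfContinuousLinearEquiv_apply,
    Function.comp_apply, ContinuousLinearEquiv.trans_apply,
    ContinuousLinearEquiv.coe_funUnique_symm]
  rfl

/-- The one-variable function `y ↦ G₁(y)` of a one-point `G₁`. -/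
def oneVar (G₁ : 𝓢((Fin 1 → E4), ℂ)) : 𝓢(E4, ℂ) :=
  SchwartzMap.compCLMOfContinuousLinearEquiv ℂ (ContinuousLinearEquiv.funUnique (Fin 1) ℝ E4).symm G₁

theorem oneVar_apply (G₁ : 𝓢((Fin 1 → E4), ℂ)) (y : E4) : oneVar G₁ y = G₁ (fun _ => y) := by
  simp only [oneVar, SchwartzMap.compCLMOfContinuousLinearEquiv_apply, Function.comp_apply,
    ContinuousLinearEquiv.coe_funUnique_symm]
  rfl

theorem eq_const_of_fin_one (x : Fin 1 → E4) : x = fun _ => x 0 := by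
  funext i; rw [Subsingleton.elim i 0]

theorem osAdjoint_one_apply (F₁ : 𝓢((Fin 1 → E4), ℂ)) (x : Fin 1 → E4) :
    osAdjoint F₁ x = adjOne F₁ (x 0) := by
  rw [osAdjoint_apply, adjOne_apply]
  congr 2
  funext i
  rw [Subsingleton.elim (Fin.rev i) 0]

theorem one_apply_eq_oneVar (G₁ : 𝓢((Fin 1 → E4), ℂ)) (x : Fin 1 → E4) :
    G₁ x = oneVar G₁ (x 0) := by
  rw [oneVar_apply]
  exact congrArg G₁ (eq_const_of_fin_one x)

/-- Support of `y ↦ conj F₁(θy)`: strictly negative times (closed half-space control). -/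
theorem tsupport_adjOne_subset {F₁ : 𝓢((Fin 1 → E4), ℂ)} (hF₁ : IsTimeOrdered F₁)
    (w : 𝓢(E4, ℝ)) (hw : Function.support w ⊆ Function.support (adjOne F₁)) :
    tsupport w ⊆ {y : E4 | y 0 < 0} := by
  set K : Set E4 := (fun y : E4 => fun _ : Fin 1 => timeReflection 4 y) ⁻¹'
    tsupport (F₁ : (Fin 1 → E4) → ℂ) with hK
  have hKc : IsClosed K :=
    (isClosed_tsupport _).preimage (continuous_pi fun _ => (timeReflection 4).continuous)
  have hsub : Function.support w ⊆ K := by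
    intro y hy
    have h1 := hw hy
    rw [Function.mem_support, adjOne_apply, map_ne_zero] at h1
    exact subset_tsupport _ (Function.mem_support.2 h1)
  refine (closure_minimal hsub hKc).trans fun y hy => ?_
  have h := (hF₁ hy).1 0
  simp only [timeReflection_apply] at h
  simpa using h

/-- Support of `y ↦ G₁(y)`: strictly positive times. -/
theorem tsupport_oneVar_subset {G₁ : 𝓢((Fin 1 → E4), ℂ)} (hG₁ : IsTimeOrdered G₁)
    (w : 𝓢(E4, ℝ)) (hw : Function.support w ⊆ Function.support (oneVar G₁)) :
    tsupport w ⊆ {y : E4 | 0 < y 0} := by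
  set K : Set E4 := (fun y : E4 => fun _ : Fin 1 => y) ⁻¹' tsupport (G₁ : (Fin 1 → E4) → ℂ)
  have hKc : IsClosed K := (isClosed_tsupport _).preimage (continuous_pi fun _ => continuous_id)
  have hsub : Function.support w ⊆ K := by
    intro y hy
    have h1 := hw hy
    rw [Function.mem_support, oneVar_apply] at h1
    exact subset_tsupport _ (Function.mem_support.2 h1)
  refine (closure_minimal hsub hKc).trans fun y hy => ?_
  exact (hG₁ hy).1 0

theorem support_reTest_subset (F : 𝓢(E4, ℂ)) :
    Function.support (reTest F) ⊆ Function.support F := by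
  intro y hy h
  exact hy (by simp [h])

theorem support_imTest_subset (F : 𝓢(E4, ℂ)) :
    Function.support (imTest F) ⊆ Function.support F := by
  intro y hy h
  exact hy (by simp [h])

/-- A real two-tensor `u ⊗ v` with `u` supported in negative and `v` in positive times is in `⁰𝒮`. -/
theorem isOffDiagonal_of_halfSpaces {u v : 𝓢(E4, ℝ)} (hu : tsupport u ⊆ {y : E4 | y 0 < 0})
    (hv : tsupport v ⊆ {y : E4 | 0 < y 0}) {T : 𝓢((Fin (1 + 1) → E4), ℂ)}
    (hT : IsTensorOf T (fun i => ofRealTest (![u, v] i))) : IsOffDiagonal T := by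
  apply IsOffDiagonal.of_tsupport_subset
  set K : Set (Fin (1 + 1) → E4) := {x | x 0 ∈ tsupport u ∧ x 1 ∈ tsupport v}
  have hKc : IsClosed K :=
    ((isClosed_tsupport _).preimage (continuous_apply 0)).inter
      ((isClosed_tsupport _).preimage (continuous_apply 1))
  have hsub : Function.support (T : (Fin (1 + 1) → E4) → ℂ) ⊆ K := by
    intro x hx
    rw [Function.mem_support, hT x] at hx
    simp only [Fin.prod_univ_succ, Fin.prod_univ_zero, Matrix.cons_val_zero, Matrix.cons_val_succ,
      ofRealTest_apply, mul_one] at hx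
    refine ⟨subset_tsupport _ ?_, subset_tsupport _ ?_⟩
    · intro h; apply hx; simp [h]
    · intro h; apply hx; simp [h]
  refine (closure_minimal hsub hKc).trans ?_
  rintro x ⟨hx0, hx1⟩ ⟨i, j, hij, hxij⟩
  have h0 := hu hx0
  have h1 := hv hx1
  simp only [Set.mem_setOf_eq] at h0 h1
  fin_cases i <;> fin_cases j
  · exact hij rfl
  · simp at hxij; rw [hxij] at h0; linarith
  · simp at hxij; rw [hxij] at h1; linarith
  · exact hij rfl

/-- Real one-point tensor `x ↦ w(x 0)`. -/
def tensor₁ (w : 𝓢(E4, ℝ)) : 𝓢((Fin 1 → E4), ℂ) :=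
  SchwartzMap.tensorFin 1 (fun i => ofRealTest (![w] i))

/-- Real two-point tensor `x ↦ u(x 0) v(x 1)`. -/
def tensor₂ (u v : 𝓢(E4, ℝ)) : 𝓢((Fin (1 + 1) → E4), ℂ) :=
  SchwartzMap.tensorFin (1 + 1) (fun i => ofRealTest (![u, v] i))

theorem isTensorOf_tensor₁ (w : 𝓢(E4, ℝ)) : IsTensorOf (tensor₁ w) (fun i => ofRealTest (![w] i)) :=
  isTensorOf_tensorFin _

theorem isTensorOf_tensor₂ (u v : 𝓢(E4, ℝ)) :
    IsTensorOf (tensor₂ u v) (fun i => ofRealTest (![u, v] i)) :=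
  isTensorOf_tensorFin _

@[simp] theorem tensor₁_apply (w : 𝓢(E4, ℝ)) (x : Fin 1 → E4) : tensor₁ w x = (w (x 0) : ℂ) := by
  rw [isTensorOf_tensor₁ w x]
  simp

@[simp] theorem tensor₂_apply (u v : 𝓢(E4, ℝ)) (x : Fin (1 + 1) → E4) :
    tensor₂ u v x = (u (x 0) : ℂ) * (v (x 1) : ℂ) := by
  rw [isTensorOf_tensor₂ u v x]
  simp [Fin.prod_univ_succ]

/-- **Bridge (real tensors ⇒ complex clause).** If the two-point function of the species `s`
factorises on every REAL off-diagonal tensor `u ⊗ v` into the product of the one-point values,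
then the (complex, time-ordered) non-triviality clause of the crux fails for `s`.  This is the
form in which the convergence clause (which only speaks about real tensors) controls
`TwoPointNontrivial`. -/
theorem not_twoPointNontrivial_of_factorizes (S : LabelledSchwingerFamily ι E4) (s : ι)
    (hfac : ∀ (u v : 𝓢(E4, ℝ)), tsupport u ⊆ {y : E4 | y 0 < 0} → tsupport v ⊆ {y : E4 | 0 < y 0} →
      S (1 + 1) (fun _ => s) (tensor₂ u v) = S 1 (fun _ => s) (tensor₁ u) * S 1 (fun _ => s) (tensor₁ v)) :
    ¬ TwoPointNontrivial S s := by
  rintro ⟨F₁, G₁, H₁, hF₁, hG₁, hH₁, hne⟩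
  apply hne
  set ur := reTest (adjOne F₁)
  set ui := imTest (adjOne F₁)
  set vr := reTest (oneVar G₁)
  set vi := imTest (oneVar G₁)
  have hur : tsupport ur ⊆ {y : E4 | y 0 < 0} := tsupport_adjOne_subset hF₁ _ (support_reTest_subset _)
  have hui : tsupport ui ⊆ {y : E4 | y 0 < 0} := tsupport_adjOne_subset hF₁ _ (support_imTest_subset _)
  have hvr : tsupport vr ⊆ {y : E4 | 0 < y 0} := tsupport_oneVar_subset hG₁ _ (support_reTest_subset _)
  have hvi : tsupport vi ⊆ {y : E4 | 0 < y 0} := tsupport_oneVar_subset hG₁ _ (support_imTest_subset _)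
  -- pointwise decompositions
  have hH : ∀ x, H₁ x = adjOne F₁ (x 0) * oneVar G₁ (x 1) := by
    intro x
    rw [hH₁ x, osAdjoint_one_apply, one_apply_eq_oneVar]
    rfl
  have hdecH : H₁ = tensor₂ ur vr + (I : ℂ) • tensor₂ ur vi + (I : ℂ) • tensor₂ ui vr - tensor₂ ui vi := by
    ext x
    simp only [sub_apply, add_apply, smul_apply, smul_eq_mul,
      tensor₂_apply, hH x, ur, ui, vr, vi, reTest_apply, imTest_apply]
    apply Complex.ext <;> simp
  have hdecF : osAdjoint F₁ = tensor₁ ur + (I : ℂ) • tensor₁ ui := by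
    ext x
    simp only [add_apply, smul_apply, smul_eq_mul, tensor₁_apply,
      osAdjoint_one_apply, ur, ui, reTest_apply, imTest_apply]
    apply Complex.ext <;> simp
  have hdecG : G₁ = tensor₁ vr + (I : ℂ) • tensor₁ vi := by
    ext x
    simp only [add_apply, smul_apply, smul_eq_mul, tensor₁_apply,
      one_apply_eq_oneVar G₁ x, vr, vi, reTest_apply, imTest_apply]
    apply Complex.ext <;> simp
  have lhs : S (1 + 1) (fun _ => s) H₁ =
      S 1 (fun _ => s) (tensor₁ ur) * S 1 (fun _ => s) (tensor₁ vr) +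
      I * (S 1 (fun _ => s) (tensor₁ ur) * S 1 (fun _ => s) (tensor₁ vi)) +
      I * (S 1 (fun _ => s) (tensor₁ ui) * S 1 (fun _ => s) (tensor₁ vr)) -
      S 1 (fun _ => s) (tensor₁ ui) * S 1 (fun _ => s) (tensor₁ vi) := by
    rw [hdecH, map_sub, map_add, map_add, map_smul, map_smul, smul_eq_mul, smul_eq_mul,
      hfac _ _ hur hvr, hfac _ _ hur hvi, hfac _ _ hui hvr, hfac _ _ hui hvi]
  have rhs : S 1 (fun _ => s) (osAdjoint F₁) * S 1 (fun _ => s) G₁ =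
      (S 1 (fun _ => s) (tensor₁ ur) + I * S 1 (fun _ => s) (tensor₁ ui)) *
      (S 1 (fun _ => s) (tensor₁ vr) + I * S 1 (fun _ => s) (tensor₁ vi)) := by
    rw [hdecF, hdecG, map_add, map_add, map_smul, map_smul, smul_eq_mul, smul_eq_mul]
  rw [lhs, rhs]
  linear_combination (-(S 1 (fun _ => s) (tensor₁ ui) * S 1 (fun _ => s) (tensor₁ vi))) * I_mul_I

/-! ### The converse: real positive-time witnesses certify `TwoPointNontrivial` -/

/-- The one-point test function `x ↦ u(θ x₀)` whose OS adjoint is `tensor₁ u`. -/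
def thetaTensor₁ (u : 𝓢(E4, ℝ)) : 𝓢((Fin 1 → E4), ℂ) := tensor₁ (thetaTest 4 u)

@[simp] theorem thetaTensor₁_apply (u : 𝓢(E4, ℝ)) (x : Fin 1 → E4) :
    thetaTensor₁ u x = (u (timeReflection 4 (x 0)) : ℂ) := by
  simp [thetaTensor₁]

theorem osAdjoint_thetaTensor₁ (u : 𝓢(E4, ℝ)) : osAdjoint (thetaTensor₁ u) = tensor₁ u := by
  ext x
  rw [osAdjoint_apply, thetaTensor₁_apply, tensor₁_apply, Complex.conj_ofReal]
  rw [Subsingleton.elim (Fin.rev (0 : Fin 1)) 0, timeReflection_timeReflection]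

/-- A real one-point tensor supported in positive times is time-ordered. -/
theorem isTimeOrdered_tensor₁ {v : 𝓢(E4, ℝ)} (hv : tsupport v ⊆ {y : E4 | 0 < y 0}) :
    IsTimeOrdered (tensor₁ v) := by
  intro x hx
  have hK : IsClosed ((fun x : Fin 1 → E4 => x 0) ⁻¹' tsupport v) :=
    (isClosed_tsupport _).preimage (continuous_apply 0)
  have hsub : Function.support (tensor₁ v : (Fin 1 → E4) → ℂ) ⊆ (fun x : Fin 1 → E4 => x 0) ⁻¹' tsupport v := by
    intro y hy
    rw [Function.mem_support, tensor₁_apply, Complex.ofReal_ne_zero] at hy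
    exact subset_tsupport _ (Function.mem_support.2 hy)
  have h0 : 0 < x 0 0 := hv (closure_minimal hsub hK hx)
  refine ⟨fun i => by rw [Subsingleton.elim i 0]; exact h0, fun i j hij => ?_⟩
  exact absurd (Subsingleton.elim i j) (ne_of_lt hij)

/-- `x ↦ u(θx₀)` with `u` supported in negative times is time-ordered. -/
theorem isTimeOrdered_thetaTensor₁ {u : 𝓢(E4, ℝ)} (hu : tsupport u ⊆ {y : E4 | y 0 < 0}) :
    IsTimeOrdered (thetaTensor₁ u) := by
  apply isTimeOrdered_tensor₁
  have hK : IsClosed ((timeReflection 4) ⁻¹' tsupport u) :=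
    (isClosed_tsupport _).preimage (timeReflection 4).continuous
  have hsub : Function.support (thetaTest 4 u) ⊆ (timeReflection 4) ⁻¹' tsupport u := by
    intro y hy
    rw [Function.mem_support, thetaTest_apply] at hy
    exact subset_tsupport _ (Function.mem_support.2 hy)
  refine (closure_minimal hsub hK).trans fun y hy => ?_
  have h := hu hy
  simp only [Set.mem_setOf_eq, timeReflection_apply] at h
  simpa using h

/-- **Real certificate of non-triviality**: a real pair `u` (negative times), `v` (positive
times) on which the truncated two-point function does not vanish witnesses the crux's complex,
time-ordered clause (`F₁ = u ∘ θ`, `G₁ = v`, `H₁ = θF̄₁ ⊗ G₁ = u ⊗ v`). -/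
theorem twoPointNontrivial_of_real (S : LabelledSchwingerFamily ι E4) (s : ι) {u v : 𝓢(E4, ℝ)}
    (hu : tsupport u ⊆ {y : E4 | y 0 < 0}) (hv : tsupport v ⊆ {y : E4 | 0 < y 0})
    (hne : S (1 + 1) (fun _ => s) (tensor₂ u v) ≠ S 1 (fun _ => s) (tensor₁ u) * S 1 (fun _ => s) (tensor₁ v)) :
    TwoPointNontrivial S s := by
  refine ⟨thetaTensor₁ u, tensor₁ v, tensor₂ u v, isTimeOrdered_thetaTensor₁ hu,
    isTimeOrdered_tensor₁ hv, fun x => ?_, ?_⟩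
  · rw [osAdjoint_thetaTensor₁, tensor₂_apply, tensor₁_apply, tensor₁_apply]
    rfl
  · rwa [osAdjoint_thetaTensor₁]


/-- **`TwoPointNontrivial` ⇔ one REAL truncated two-point value at separated half-spaces is
non-zero.**  This is the exact form in which the crux's non-triviality clause must be verified. -/
theorem twoPointNontrivial_iff_real (S : LabelledSchwingerFamily ι E4) (s : ι) :
    TwoPointNontrivial S s ↔ ∃ u v : 𝓢(E4, ℝ), tsupport u ⊆ {y : E4 | y 0 < 0} ∧
      tsupport v ⊆ {y : E4 | 0 < y 0} ∧
      S (1 + 1) (fun _ => s) (tensor₂ u v) ≠ S 1 (fun _ => s) (tensor₁ u) * S 1 (fun _ => s) (tensor₁ v) := by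
  constructor
  · intro h
    by_contra hall
    push Not at hall
    exact not_twoPointNontrivial_of_factorizes S s (fun u v hu hv => hall u v hu hv) h
  · rintro ⟨u, v, hu, hv, hne⟩
    exact twoPointNontrivial_of_real S s hu hv hne

end Bridge

/-! ### The trivial gauge group: non-abelianness of `G` is load-bearing -/

section Subsingleton

variable {G : Type} [Group G] [TopologicalSpace G] [IsTopologicalGroup G] [CompactSpace G]
  [MeasurableSpace G] [BorelSpace G]

omit [Group G] [TopologicalSpace G] [IsTopologicalGroup G] [CompactSpace G] [MeasurableSpace G]
  [BorelSpace G] in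
/-- One-point test functions are automatically off-diagonal (no pair of distinct indices). -/
theorem isOffDiagonal_fin_one {E : Type*} [NormedAddCommGroup E] [NormedSpace ℝ E]
    (F : 𝓢((Fin 1 → E), ℂ)) : IsOffDiagonal F := by
  rintro x ⟨i, j, hij, -⟩
  exact absurd (Subsingleton.elim i j) hij

/-- **Non-triviality in lattice terms.** Under the convergence clause, `TwoPointNontrivial S s`
is EXACTLY: for some real `u` (negative times) and `v` (positive times) the truncated lattice
two-point function of the smeared species `s` does NOT tend to zero along the scheme.  With §4
this is the one number a prover has to keep away from `0` (and an adversary would have to force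
to `0`): `lim_k ⟨Φ_k(u) Φ_k(v)⟩ − ⟨Φ_k(u)⟩⟨Φ_k(v)⟩ ≠ 0` for the smeared curvature `Φ_k`. -/
theorem twoPointNontrivial_iff_lattice (r : LatticeRep G) (sch : SpeciesScheme (YMSpecies G))
    (S : LabelledSchwingerFamily (YMSpecies G) E4) (hconv : Converges r sch S) (s : YMSpecies G) :
    TwoPointNontrivial S s ↔ ∃ u v : 𝓢(E4, ℝ), tsupport u ⊆ {y : E4 | y 0 < 0} ∧
      tsupport v ⊆ {y : E4 | 0 < y 0} ∧
      ¬ Tendsto (fun k : ℕ =>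
          latticeSchwinger r.ρ sch (fun s => s.F) k (1 + 1) (fun _ => s) ![u, v] -
            latticeSchwinger r.ρ sch (fun s => s.F) k 1 (fun _ => s) ![u] *
              latticeSchwinger r.ρ sch (fun s => s.F) k 1 (fun _ => s) ![v]) atTop (𝓝 0) := by
  rw [twoPointNontrivial_iff_real]
  refine exists_congr fun u => exists_congr fun v => and_congr_right fun hu =>
    and_congr_right fun hv => ?_
  have h2 := hconv (1 + 1) (by norm_num) (fun _ => s) ![u, v] (tensor₂ u v) (isTensorOf_tensor₂ u v)
    (isOffDiagonal_of_halfSpaces hu hv (isTensorOf_tensor₂ u v))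
  have hu1 := hconv 1 one_ne_zero (fun _ => s) ![u] (tensor₁ u) (isTensorOf_tensor₁ u)
    (isOffDiagonal_fin_one _)
  have hv1 := hconv 1 one_ne_zero (fun _ => s) ![v] (tensor₁ v) (isTensorOf_tensor₁ v)
    (isOffDiagonal_fin_one _)
  set f : ℕ → ℝ := fun k =>
    latticeSchwinger r.ρ sch (fun s => s.F) k (1 + 1) (fun _ => s) ![u, v] -
      latticeSchwinger r.ρ sch (fun s => s.F) k 1 (fun _ => s) ![u] *
        latticeSchwinger r.ρ sch (fun s => s.F) k 1 (fun _ => s) ![v] with hf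
  have hT : Tendsto (fun k : ℕ => (f k : ℂ)) atTop
      (𝓝 (S (1 + 1) (fun _ => s) (tensor₂ u v) -
        S 1 (fun _ => s) (tensor₁ u) * S 1 (fun _ => s) (tensor₁ v))) :=
    (h2.sub (hu1.mul hv1)).congr fun k => by simp only [hf]; push_cast; ring
  change _ ↔ ¬ Tendsto f atTop (𝓝 0)
  constructor
  · intro hne hreal
    apply hne
    have hc : Tendsto (fun k : ℕ => (f k : ℂ)) atTop (𝓝 ((0 : ℝ) : ℂ)) :=
      (Complex.continuous_ofReal.tendsto 0).comp hreal
    rw [Complex.ofReal_zero] at hc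
    exact sub_eq_zero.1 (tendsto_nhds_unique hT hc)
  · intro hreal heq
    apply hreal
    rw [sub_eq_zero.2 heq] at hT
    have := (Complex.continuous_re.tendsto 0).comp hT
    simpa [Function.comp_def] using this

/-- For a gauge group with one element every lattice `n`-point function is the product of the
one-point functions (all observables are deterministic). -/
theorem latticeSchwinger_eq_prod_of_subsingleton [Subsingleton G] {N : ℕ} {κ : Type}
    (ρ : G →* Matrix (Fin N) (Fin N) ℂ) (hρ : Continuous ρ) (sch : SpeciesScheme κ)
    (obs : κ → LGConfig 4 G → ℝ) (k n : ℕ) (σ : Fin n → κ) (f : Fin n → 𝓢(E4, ℝ)) :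
    latticeSchwinger ρ sch obs k n σ f =
      ∏ i, latticeSchwinger ρ sch obs k 1 (fun _ => σ i) (fun _ => f i) := by
  haveI := isProbabilityMeasure_wilsonMeasure (d := 4) (L := sch.side k) ρ hρ (sch.β k)
  have hconst : ∀ (h : GaugeConfig 4 (sch.side k) G → ℝ) (U₀ : GaugeConfig 4 (sch.side k) G),
      ∫ U, h U ∂(wilsonMeasure (d := 4) (L := sch.side k) ρ (sch.β k)) = h U₀ := by
    intro h U₀
    have hc : (fun U => h U) = fun _ => h U₀ := funext fun U => congrArg h (Subsingleton.elim U U₀)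
    rw [hc, integral_const, smul_eq_mul, probReal_univ, one_mul]
  set U₀ : GaugeConfig 4 (sch.side k) G := fun _ => 1
  unfold latticeSchwinger
  rw [hconst _ U₀]
  refine Finset.prod_congr rfl fun i _ => ?_
  rw [hconst _ U₀, Fin.prod_univ_one]

/-- **Trivial gauge group ⇒ the two-point function factorises on real tensors** (from the
convergence clause alone, by uniqueness of limits). -/
theorem factorizes_of_converges_subsingleton [Subsingleton G] (r : LatticeRep G)
    (sch : SpeciesScheme (YMSpecies G)) (S : LabelledSchwingerFamily (YMSpecies G) E4)
    (hconv : Converges r sch S) (s : YMSpecies G) (u v : 𝓢(E4, ℝ))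
    (hod : IsOffDiagonal (tensor₂ u v)) :
    S (1 + 1) (fun _ => s) (tensor₂ u v) = S 1 (fun _ => s) (tensor₁ u) * S 1 (fun _ => s) (tensor₁ v) := by
  have h2 := hconv (1 + 1) (by norm_num) (fun _ => s) ![u, v] (tensor₂ u v) (isTensorOf_tensor₂ u v) hod
  have hu := hconv 1 one_ne_zero (fun _ => s) ![u] (tensor₁ u) (isTensorOf_tensor₁ u)
    (isOffDiagonal_fin_one _)
  have hv := hconv 1 one_ne_zero (fun _ => s) ![v] (tensor₁ v) (isTensorOf_tensor₁ v)
    (isOffDiagonal_fin_one _)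
  refine tendsto_nhds_unique h2 ?_
  have hprod : ∀ k, ((latticeSchwinger r.ρ sch (fun s => s.F) k (1 + 1) (fun _ => s) ![u, v] : ℝ) : ℂ) =
      ((latticeSchwinger r.ρ sch (fun s => s.F) k 1 (fun _ => s) ![u] : ℝ) : ℂ) *
      ((latticeSchwinger r.ρ sch (fun s => s.F) k 1 (fun _ => s) ![v] : ℝ) : ℂ) := by
    intro k
    rw [latticeSchwinger_eq_prod_of_subsingleton r.ρ r.continuous, Fin.prod_univ_two]
    push_cast
    congr 2
  simp_rw [hprod]
  exact hu.mul hv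

/-- **The crux's conclusion fails for the trivial group** (which is compact, connected and has a
faithful unitary representation — everything in `IsCompactSimpleLieGroup` except non-abelianness):
the convergence clause forces factorisation, the bridge kills `TwoPointNontrivial`.  Hence any
proof must use that `G` is non-abelian. -/
theorem not_converges_and_twoPointNontrivial_of_subsingleton [Subsingleton G] (r : LatticeRep G)
    (sch : SpeciesScheme (YMSpecies G)) (S : LabelledSchwingerFamily (YMSpecies G) E4)
    (hconv : Converges r sch S) : ¬ TwoPointNontrivial S r.curvature :=
  not_twoPointNontrivial_of_factorizes S r.curvature fun u v hu hv =>
    factorizes_of_converges_subsingleton r sch S hconv _ u v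
      (isOffDiagonal_of_halfSpaces hu hv (isTensorOf_tensor₂ u v))

/-- The trivial group has a (faithful, continuous, unitary) lattice representation. -/
def punitRep : LatticeRep PUnit :=
  ⟨1, 1, continuous_const, fun a b _ => Subsingleton.elim a b, fun _ => by simp⟩

/-- The trivial group is connected and linear: of `IsCompactSimpleLieGroup` it misses exactly
non-abelianness (and it is not `IsSimpleCompactGroup`). -/
theorem punit_connected_not_simple :
    ConnectedSpace PUnit ∧ Nonempty (LatticeRep PUnit) ∧ ¬ IsSimpleCompactGroup PUnit :=
  ⟨inferInstance, ⟨punitRep⟩, fun h => by obtain ⟨a, b, hab⟩ := h.2.1; exact hab (Subsingleton.elim _ _)⟩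

/-- **`HypercubicLimit` is false without "non-abelian"**: weakening the hypothesis
`IsCompactSimpleLieGroup G` to "compact, connected, with a faithful unitary representation" makes
the statement false (witness `G = PUnit`), already at the level of Converges ∧ TwoPointNontrivial. -/
theorem hypercubicLimit_false_without_nonabelian :
    ¬ (∀ (G : Type) [Group G] [TopologicalSpace G] [IsTopologicalGroup G] [CompactSpace G],
        ConnectedSpace G → Nonempty (LatticeRep G) →
          letI : MeasurableSpace G := borel G
          haveI : BorelSpace G := ⟨rfl⟩
          ∃ (r : LatticeRep G) (sch : SpeciesScheme (YMSpecies G))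
            (S : LabelledSchwingerFamily (YMSpecies G) E4),
            Converges r sch S ∧ TwoPointNontrivial S r.curvature) := by
  intro h
  letI : MeasurableSpace PUnit := borel PUnit
  haveI : BorelSpace PUnit := ⟨rfl⟩
  obtain ⟨r, sch, S, hconv, hnt⟩ := h PUnit inferInstance ⟨punitRep⟩
  exact not_converges_and_twoPointNontrivial_of_subsingleton r sch S hconv hnt

end Subsingleton

/-! ## §4 The all-species packaging is not load-bearing: reduction to ONE scalar field -/

section OneField

variable {ι : Type}

/-! ### Label-string bookkeeping -/

theorem all_comp_rev_iff {n : ℕ} (k : Fin n → ι) (c₀ : ι) :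
    (∀ i, (k ∘ Fin.rev) i = c₀) ↔ ∀ i, k i = c₀ :=
  ⟨fun h i => by simpa using h (Fin.rev i), fun h i => h _⟩

theorem all_append_iff {n m : ℕ} (k : Fin n → ι) (k' : Fin m → ι) (c₀ : ι) :
    (∀ i, Fin.append k k' i = c₀) ↔ (∀ i, k i = c₀) ∧ ∀ j, k' j = c₀ := by
  refine ⟨fun h => ⟨fun i => by simpa using h (Fin.castAdd m i), fun j => by simpa using h (Fin.natAdd n j)⟩,
    fun h i => ?_⟩
  induction i using Fin.addCases with
  | left i => simpa using h.1 i
  | right j => simpa using h.2 j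

theorem all_comp_perm_iff {n : ℕ} (k : Fin n → ι) (π : Equiv.Perm (Fin n)) (c₀ : ι) :
    (∀ i, (k ∘ π) i = c₀) ↔ ∀ i, k i = c₀ :=
  ⟨fun h i => by simpa using h (π.symm i), fun h i => h _⟩

theorem append_const (n m : ℕ) (c₀ : ι) :
    Fin.append (fun _ : Fin n => c₀) (fun _ : Fin m => c₀) = fun _ => c₀ := by
  funext i
  induction i using Fin.addCases with
  | left i => simp
  | right j => simp

/-! ### Extension by zero of a one-field family to a labelled family -/

/-- The labelled family which is `S₁` on the constant label string `c₀ ⋯ c₀` and `0` on every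
other label string ("all other species renormalised to zero"). -/
def extendByZero (c₀ : ι) (S₁ : SchwingerFamily E4) : LabelledSchwingerFamily ι E4 :=
  fun n k => by classical exact if (∀ i, k i = c₀) then S₁ n else 0

variable (c₀ : ι) (S₁ : SchwingerFamily E4)

theorem extendByZero_of_all {n : ℕ} {k : Fin n → ι} (h : ∀ i, k i = c₀) :
    extendByZero c₀ S₁ n k = S₁ n := by
  simp [extendByZero, h]

theorem extendByZero_of_not_all {n : ℕ} {k : Fin n → ι} (h : ¬ ∀ i, k i = c₀) :
    extendByZero c₀ S₁ n k = 0 := by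
  unfold extendByZero
  rw [if_neg h]

@[simp] theorem extendByZero_const (n : ℕ) : extendByZero c₀ S₁ n (fun _ => c₀) = S₁ n :=
  extendByZero_of_all c₀ S₁ fun _ => rfl

theorem isTimeOrdered_zero {d : ℕ} [NeZero d] {n : ℕ} :
    IsTimeOrdered (0 : 𝓢((Fin n → EuclideanSpace ℝ (Fin d)), ℂ)) := by
  have h0 : ((0 : 𝓢((Fin n → EuclideanSpace ℝ (Fin d)), ℂ)) : (Fin n → EuclideanSpace ℝ (Fin d)) → ℂ)
      = 0 := rfl
  rw [IsTimeOrdered, h0, tsupport_zero]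
  exact Set.empty_subset _

theorem osAdjoint_zero {n : ℕ} : osAdjoint (0 : 𝓢((Fin n → E4), ℂ)) = 0 := by
  ext x
  rw [osAdjoint_apply]
  change conj (0 : ℂ) = 0
  exact map_zero _

variable {c₀ S₁}

theorem isNormalized_extendByZero (h : S₁.toLabelled.IsNormalized) :
    (extendByZero c₀ S₁).IsNormalized := fun k F => by
  rw [extendByZero_of_all c₀ S₁ (fun i => i.elim0)]
  exact h (fun _ => ()) F

theorem isHermitian_extendByZero (h : S₁.toLabelled.IsHermitian) :
    (extendByZero c₀ S₁).IsHermitian := fun n k F hF => by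
  by_cases hk : ∀ i, k i = c₀
  · rw [extendByZero_of_all c₀ S₁ hk, extendByZero_of_all c₀ S₁ ((all_comp_rev_iff k c₀).2 hk)]
    exact h n (fun _ => ()) F hF
  · rw [extendByZero_of_not_all c₀ S₁ hk,
      extendByZero_of_not_all c₀ S₁ (mt (all_comp_rev_iff k c₀).1 hk)]
    simp

theorem hasLinearGrowth_extendByZero (h : S₁.toLabelled.HasLinearGrowth) :
    (extendByZero c₀ S₁).HasLinearGrowth := by
  intro T
  obtain ⟨s, α, β, hb⟩ := h Finset.univ
  refine ⟨s, max α 0, β, fun n k _ F hF => ?_⟩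
  have hnn : 0 ≤ (n.factorial : ℝ) ^ β * schwartzNorm (n * s) F :=
    mul_nonneg (Real.rpow_nonneg (Nat.cast_nonneg _) _) (schwartzNorm_nonneg _ _)
  by_cases hk : ∀ i, k i = c₀
  · rw [extendByZero_of_all c₀ S₁ hk]
    calc ‖S₁ n F‖ = ‖S₁.toLabelled n (fun _ => ()) F‖ := rfl
      _ ≤ α * (n.factorial : ℝ) ^ β * schwartzNorm (n * s) F :=
          hb n (fun _ => ()) (fun _ => Finset.mem_univ _) F hF
      _ ≤ max α 0 * (n.factorial : ℝ) ^ β * schwartzNorm (n * s) F := by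
          rw [mul_assoc, mul_assoc]; exact mul_le_mul_of_nonneg_right (le_max_left _ _) hnn
  · rw [extendByZero_of_not_all c₀ S₁ hk]
    simp only [zero_apply, norm_zero]
    rw [mul_assoc]; exact mul_nonneg (le_max_right _ _) hnn

theorem isReflectionPositive_extendByZero (h : S₁.toLabelled.IsReflectionPositive) :
    (extendByZero c₀ S₁).IsReflectionPositive := by
  classical
  intro N deg lab F hF H hH
  let good : Fin N → Prop := fun j => ∀ i, lab j i = c₀
  let F' : (j : Fin N) → 𝓢((Fin (deg j) → E4), ℂ) := fun j => if good j then F j else 0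
  let H' : (i j : Fin N) → 𝓢((Fin (deg i + deg j) → E4), ℂ) :=
    fun i j => if good i ∧ good j then H i j else 0
  have hF' : ∀ j, IsTimeOrdered (F' j) := fun j => by
    by_cases hj : good j
    · simp only [F', if_pos hj]; exact hF j
    · simp only [F', if_neg hj]; exact isTimeOrdered_zero
  have hH' : ∀ i j, IsAppendTensorOf (H' i j) (osAdjoint (F' i)) (F' j) := fun i j => by
    by_cases hi : good i
    · by_cases hj : good j
      · simp only [H', F', if_pos hi, if_pos hj, if_pos (And.intro hi hj)]; exact hH i j
      · simp only [H', F', if_neg hj, if_neg (fun h : good i ∧ good j => hj h.2)]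
        intro x; simp
    · simp only [H', F', if_neg hi, if_neg (fun h : good i ∧ good j => hi h.1), osAdjoint_zero]
      intro x; simp
  have key := h N deg (fun j _ => ()) F' hF' H' hH'
  have hterm : ∀ i j, extendByZero c₀ S₁ (deg i + deg j) (Fin.append (lab i ∘ Fin.rev) (lab j)) (H i j) =
      S₁.toLabelled (deg i + deg j) (Fin.append ((fun _ => ()) ∘ Fin.rev) (fun _ => ())) (H' i j) := by
    intro i j
    by_cases hij : good i ∧ good j
    · rw [extendByZero_of_all c₀ S₁ ((all_append_iff _ _ c₀).2
        ⟨(all_comp_rev_iff _ c₀).2 hij.1, hij.2⟩)]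
      simp only [H', if_pos hij, SchwingerFamily.toLabelled_apply]
    · rw [extendByZero_of_not_all c₀ S₁ (fun hall => hij
        ⟨(all_comp_rev_iff _ c₀).1 ((all_append_iff _ _ c₀).1 hall).1, ((all_append_iff _ _ c₀).1 hall).2⟩)]
      simp only [H', if_neg hij, SchwingerFamily.toLabelled_apply, map_zero,
        zero_apply]
  simp only [hterm]
  exact key

theorem isSymmetric_extendByZero (h : S₁.toLabelled.IsSymmetric) :
    (extendByZero c₀ S₁).IsSymmetric := fun n k π F hF => by
  by_cases hk : ∀ i, k i = c₀
  · rw [extendByZero_of_all c₀ S₁ hk, extendByZero_of_all c₀ S₁ ((all_comp_perm_iff k π c₀).2 hk)]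
    exact h n (fun _ => ()) π F hF
  · rw [extendByZero_of_not_all c₀ S₁ hk,
      extendByZero_of_not_all c₀ S₁ (mt (all_comp_perm_iff k π c₀).1 hk)]
    simp

theorem hasClusterProperty_extendByZero (h : S₁.toLabelled.HasClusterProperty) :
    (extendByZero c₀ S₁).HasClusterProperty := by
  intro n m k k' F G hF hG a ha0 ha H hH
  by_cases hk : ∀ i, k i = c₀
  · by_cases hk' : ∀ j, k' j = c₀
    · have hall : ∀ i, Fin.append (k ∘ Fin.rev) k' i = c₀ :=
        (all_append_iff _ _ c₀).2 ⟨(all_comp_rev_iff _ c₀).2 hk, hk'⟩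
      simp only [extendByZero_of_all c₀ S₁ hall, extendByZero_of_all c₀ S₁ hk',
        extendByZero_of_all c₀ S₁ ((all_comp_rev_iff _ c₀).2 hk)]
      simpa using h n m (fun _ => ()) (fun _ => ()) F G hF hG a ha0 ha H hH
    · have hnall : ¬ ∀ i, Fin.append (k ∘ Fin.rev) k' i = c₀ :=
        fun hall => hk' ((all_append_iff _ _ c₀).1 hall).2
      simp only [extendByZero_of_not_all c₀ S₁ hnall, extendByZero_of_not_all c₀ S₁ hk']
      simp
  · have hnall : ¬ ∀ i, Fin.append (k ∘ Fin.rev) k' i = c₀ :=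
      fun hall => hk ((all_comp_rev_iff _ c₀).1 ((all_append_iff _ _ c₀).1 hall).1)
    simp only [extendByZero_of_not_all c₀ S₁ hnall,
      extendByZero_of_not_all c₀ S₁ (mt (all_comp_rev_iff k c₀).1 hk)]
    simp

theorem hasMassGap_extendByZero {Δ : ℝ} (h : S₁.toLabelled.HasMassGap Δ) :
    (extendByZero c₀ S₁).HasMassGap Δ := by
  intro n m k k' F G hF hG
  by_cases hk : ∀ i, k i = c₀
  · by_cases hk' : ∀ j, k' j = c₀
    · obtain ⟨C, hC⟩ := h n m (fun _ => ()) (fun _ => ()) F G hF hG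
      refine ⟨C, fun t ht H hH => ?_⟩
      have hall : ∀ i, Fin.append (k ∘ Fin.rev) k' i = c₀ :=
        (all_append_iff _ _ c₀).2 ⟨(all_comp_rev_iff _ c₀).2 hk, hk'⟩
      simp only [extendByZero_of_all c₀ S₁ hall, extendByZero_of_all c₀ S₁ hk',
        extendByZero_of_all c₀ S₁ ((all_comp_rev_iff _ c₀).2 hk)]
      simpa using hC t ht H hH
    · refine ⟨0, fun t ht H hH => ?_⟩
      have hnall : ¬ ∀ i, Fin.append (k ∘ Fin.rev) k' i = c₀ :=
        fun hall => hk' ((all_append_iff _ _ c₀).1 hall).2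
      simp [extendByZero_of_not_all c₀ S₁ hnall, extendByZero_of_not_all c₀ S₁ hk']
  · refine ⟨0, fun t ht H hH => ?_⟩
    have hnall : ¬ ∀ i, Fin.append (k ∘ Fin.rev) k' i = c₀ :=
      fun hall => hk ((all_comp_rev_iff _ c₀).1 ((all_append_iff _ _ c₀).1 hall).1)
    simp [extendByZero_of_not_all c₀ S₁ hnall,
      extendByZero_of_not_all c₀ S₁ (mt (all_comp_rev_iff k c₀).1 hk)]

theorem osClauses_extendByZero (h : OSClauses S₁.toLabelled) : OSClauses (extendByZero c₀ S₁) := by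
  obtain ⟨h0, h1, h2, h3, h4, h5, h6, h7⟩ := h
  refine ⟨isNormalized_extendByZero h0, isHermitian_extendByZero h1, hasLinearGrowth_extendByZero h2,
    isReflectionPositive_extendByZero h3, isSymmetric_extendByZero h4,
    hasClusterProperty_extendByZero h5, fun n k a F hF => ?_, fun n k R hR hperm F hF => ?_⟩
  · by_cases hk : ∀ i, k i = c₀
    · rw [extendByZero_of_all c₀ S₁ hk]; exact h6 n (fun _ => ()) a F hF
    · rw [extendByZero_of_not_all c₀ S₁ hk]; rfl
  · by_cases hk : ∀ i, k i = c₀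
    · rw [extendByZero_of_all c₀ S₁ hk]; exact h7 n (fun _ => ()) R hR hperm F hF
    · rw [extendByZero_of_not_all c₀ S₁ hk]; rfl

/-! ### Restriction of a labelled family to one constant label -/

/-- The one-field family of the species `c₀`. -/
def restrictTo (c₀ : ι) (S : LabelledSchwingerFamily ι E4) : SchwingerFamily E4 :=
  fun n => S n (fun _ => c₀)

@[simp] theorem restrictTo_toLabelled (c₀ : ι) (S : LabelledSchwingerFamily ι E4) (n : ℕ)
    (k : Fin n → Unit) : (restrictTo c₀ S).toLabelled n k = S n (fun _ => c₀) := rfl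

theorem osClauses_restrictTo (c₀ : ι) {S : LabelledSchwingerFamily ι E4} (h : OSClauses S) :
    OSClauses (restrictTo c₀ S).toLabelled := by
  obtain ⟨h0, h1, h2, h3, h4, h5, h6, h7⟩ := h
  refine ⟨fun k F => h0 _ F, fun n k F hF => h1 n _ F hF, ?_, ?_, fun n k π F hF => h4 n _ π F hF,
    ?_, fun n k a F hF => h6 n _ a F hF, fun n k R hR hperm F hF => h7 n _ R hR hperm F hF⟩
  · intro T
    obtain ⟨s, α, β, hb⟩ := h2 {c₀}
    exact ⟨s, α, β, fun n k _ F hF => hb n (fun _ => c₀) (fun _ => Finset.mem_singleton_self _) F hF⟩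
  · intro N deg lab F hF H hH
    have key := h3 N deg (fun j _ => c₀) F hF H hH
    simp only [Function.comp_def, append_const] at key
    simpa [restrictTo, Function.comp_def, append_const] using key
  · intro n m k k' F G hF hG a ha0 ha H hH
    have key := h5 n m (fun _ => c₀) (fun _ => c₀) F G hF hG a ha0 ha H hH
    simp only [Function.comp_def, append_const] at key
    simpa [restrictTo, Function.comp_def, append_const] using key

theorem hasMassGap_restrictTo (c₀ : ι) {S : LabelledSchwingerFamily ι E4} {Δ : ℝ}
    (h : S.HasMassGap Δ) : (restrictTo c₀ S).toLabelled.HasMassGap Δ :=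
  h.restrict fun _ : Unit => c₀

variable {G : Type} [Group G] [TopologicalSpace G] [IsTopologicalGroup G] [CompactSpace G]
  [MeasurableSpace G] [BorelSpace G]

/-- One-field convergence: the curvature species alone — verbatim the first clause of the route
file's `W₁` (items `DiagonalMirrorRPR`, `CurvatureKernelBound`). -/
def Converges₁ (r : LatticeRep G) (sch : SpeciesScheme (YMSpecies G)) (S₁ : SchwingerFamily E4) :
    Prop :=
  ∀ (n : ℕ), n ≠ 0 → ∀ (f : Fin n → 𝓢(E4, ℝ)) (F : 𝓢((Fin n → E4), ℂ)),
    IsTensorOf F (fun i => ofRealTest (f i)) → IsOffDiagonal F →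
      Tendsto (fun k : ℕ =>
        ((latticeSchwinger r.ρ sch (fun s => s.F) k n (fun _ => r.curvature) f : ℝ) : ℂ))
        atTop (𝓝 (S₁ n F))

/-- **The one-field version of the crux's clauses**: a single Schwinger family (the curvature
field) with E0–E4 + translations + hypercubic invariance, convergence of the curvature `n`-point
functions, non-triviality, non-Gaussianity, continuum gap, and the uniform lattice gap. -/
def Clauses₁ (r : LatticeRep G) (sch : SpeciesScheme (YMSpecies G)) (S₁ : SchwingerFamily E4) :
    Prop :=
  OSClauses S₁.toLabelled ∧ Converges₁ r sch S₁ ∧ TwoPointNontrivial S₁.toLabelled () ∧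
    ThreePointNonGaussian S₁.toLabelled () ∧ Gaps r sch S₁.toLabelled

/-- **Restriction**: a witness of the crux's clauses gives a one-field witness (same `r`, `sch`). -/
theorem clauses₁_of_clauses {r : LatticeRep G} {sch : SpeciesScheme (YMSpecies G)}
    {S : LabelledSchwingerFamily (YMSpecies G) E4} (h : Clauses r sch S) :
    Clauses₁ r sch (restrictTo r.curvature S) := by
  obtain ⟨hos, hconv, hnt, hng, Δ, hΔ, hgap, hlat⟩ := h
  exact ⟨osClauses_restrictTo _ hos, fun n hn f F hF hod => hconv n hn _ f F hF hod, hnt, hng,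
    Δ, hΔ, hasMassGap_restrictTo _ hgap, hlat⟩

/-- The scheme keeping the renormalisations of `s₀` and renormalising every other species to `0`. -/
def onlySpecies (sch : SpeciesScheme (YMSpecies G)) (s₀ : YMSpecies G) :
    SpeciesScheme (YMSpecies G) :=
  { sch with c := fun s k => by classical exact if s = s₀ then sch.c s k else 0 }

omit [Group G] [TopologicalSpace G] [IsTopologicalGroup G] [CompactSpace G] [BorelSpace G] in
theorem smearedLatticeField_zero_c (O : LGConfig 4 G → ℝ)
    (Λ : Finset (Literature.Probability.LatticeModels.Site 4)) (a m : ℝ) (f : 𝓢(E4, ℝ))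
    (U : LGConfig 4 G) : smearedLatticeField O Λ a 0 m f U = 0 := by
  simp [smearedLatticeField]

/-- With a species of zero multiplicative renormalisation in the string, the lattice `n`-point
function vanishes. -/
theorem latticeSchwinger_onlySpecies_of_ne (r : LatticeRep G) (sch : SpeciesScheme (YMSpecies G))
    (s₀ : YMSpecies G) (k n : ℕ) (σ : Fin n → YMSpecies G) (f : Fin n → 𝓢(E4, ℝ)) {i₀ : Fin n}
    (hi₀ : σ i₀ ≠ s₀) :
    latticeSchwinger r.ρ (onlySpecies sch s₀) (fun s => s.F) k n σ f = 0 := by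
  unfold latticeSchwinger
  have h0 : (onlySpecies sch s₀).c (σ i₀) k = 0 := by
    simp [onlySpecies, hi₀]
  have : ∀ U : GaugeConfig 4 ((onlySpecies sch s₀).side k) G,
      ∏ i, smearedLatticeField ((fun s : YMSpecies G => s.F) (σ i))
        (Literature.Probability.LatticeModels.box 4 ((onlySpecies sch s₀).L k))
        ((onlySpecies sch s₀).a k) ((onlySpecies sch s₀).c (σ i) k) ((onlySpecies sch s₀).m (σ i) k)
        (f i) (torusLift ((onlySpecies sch s₀).side k) U) = 0 := fun U =>
    Finset.prod_eq_zero (Finset.mem_univ i₀) (by rw [h0, smearedLatticeField_zero_c])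
  simp_rw [this, integral_zero]

/-- On the distinguished species the modified scheme has the original lattice functions. -/
theorem latticeSchwinger_onlySpecies_self (r : LatticeRep G) (sch : SpeciesScheme (YMSpecies G))
    (s₀ : YMSpecies G) (k n : ℕ) (f : Fin n → 𝓢(E4, ℝ)) :
    latticeSchwinger r.ρ (onlySpecies sch s₀) (fun s => s.F) k n (fun _ => s₀) f =
      latticeSchwinger r.ρ sch (fun s => s.F) k n (fun _ => s₀) f := by
  have hc : (onlySpecies sch s₀).c s₀ k = sch.c s₀ k := by simp [onlySpecies]
  unfold latticeSchwinger
  simp_rw [hc]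
  rfl

/-- **Extension**: a one-field witness gives a witness of ALL the crux's clauses — renormalise
every other species to zero and extend the family by zero. -/
theorem clauses_of_clauses₁ {r : LatticeRep G} {sch : SpeciesScheme (YMSpecies G)}
    {S₁ : SchwingerFamily E4} (h : Clauses₁ r sch S₁) :
    Clauses r (onlySpecies sch r.curvature) (extendByZero r.curvature S₁) := by
  obtain ⟨hos, hconv, hnt, hng, Δ, hΔ, hgap, hlat⟩ := h
  refine ⟨osClauses_extendByZero hos, ?_, ?_, ?_, Δ, hΔ, hasMassGap_extendByZero hgap, hlat⟩
  · intro n hn σ f F hF hod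
    by_cases hσ : ∀ i, σ i = r.curvature
    · obtain rfl : σ = fun _ => r.curvature := funext hσ
      rw [extendByZero_const]
      simp_rw [latticeSchwinger_onlySpecies_self]
      exact hconv n hn f F hF hod
    · push Not at hσ
      obtain ⟨i₀, hi₀⟩ := hσ
      rw [extendByZero_of_not_all _ _ (fun hall => hi₀ (hall i₀))]
      simp_rw [latticeSchwinger_onlySpecies_of_ne r sch r.curvature _ n σ f hi₀]
      simp
  · simpa [TwoPointNontrivial] using hnt
  · simpa [ThreePointNonGaussian] using hng

/-- **`HypercubicLimit` ⇔ its one-field version.** The labelled, all-species packaging of the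
crux (species = ALL gauge-invariant lattice observables, "so that the reconstructed Hilbert space
is that of the whole theory") carries no weight: per-species renormalisations are witness data,
`c_s ≡ 0` silences every species but the curvature, and the extension by zero of a one-field OS
family is a labelled OS family.  The ONLY all-observable content left is `HasLatticeMassGap`,
which sees `(a_k, β_k, L_k)` alone (§1).  A prover may therefore construct ONE scalar field. -/
theorem hypercubicLimit8646_iff_oneField :
    HypercubicLimit8646 ↔
      ∀ (G : Type) [Group G] [TopologicalSpace G] [IsTopologicalGroup G] [CompactSpace G],
        IsCompactSimpleLieGroup G →
          letI : MeasurableSpace G := borel G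
          haveI : BorelSpace G := ⟨rfl⟩
          ∃ (r : LatticeRep G) (sch : SpeciesScheme (YMSpecies G)) (S₁ : SchwingerFamily E4),
            Clauses₁ r sch S₁ := by
  refine forall_congr' fun G => forall_congr' fun _ => forall_congr' fun _ => forall_congr' fun _ =>
    forall_congr' fun _ => forall_congr' fun _ => ⟨?_, ?_⟩
  · rintro ⟨r, sch, S, h⟩
    letI : MeasurableSpace G := borel G
    haveI : BorelSpace G := ⟨rfl⟩
    exact ⟨r, sch, _, clauses₁_of_clauses h⟩
  · rintro ⟨r, sch, S₁, h⟩
    letI : MeasurableSpace G := borel G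
    haveI : BorelSpace G := ⟨rfl⟩
    exact ⟨r, _, _, clauses_of_clauses₁ h⟩

omit [TopologicalSpace G] [IsTopologicalGroup G] [CompactSpace G] [BorelSpace G] in
/-- The species-silencing scheme has the same couplings, so it is at weak coupling iff the
original scheme is (definitional). -/
theorem hasWeakCouplingLimit_onlySpecies (sch : SpeciesScheme (YMSpecies G)) (s₀ : YMSpecies G) :
    (onlySpecies sch s₀).HasWeakCouplingLimit ↔ sch.HasWeakCouplingLimit :=
  Iff.rfl

/-- **The live crux (16154) ⇔ its one-field version**, weak coupling carried along: the
one-field reduction never touches `β_k` (restriction keeps `sch`; extension only zeroes `c_s` off the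
curvature), so the weak-coupling crux is equally a statement about ONE scalar field. -/
theorem hypercubicLimit_iff_oneField :
    Summit.QuantumFields.YangMills.Theses.CoincidenceRotationBootstrap.HypercubicLimit ↔
      ∀ (G : Type) [Group G] [TopologicalSpace G] [IsTopologicalGroup G] [CompactSpace G],
        IsCompactSimpleLieGroup G →
          letI : MeasurableSpace G := borel G
          haveI : BorelSpace G := ⟨rfl⟩
          ∃ (r : LatticeRep G) (sch : SpeciesScheme (YMSpecies G)) (S₁ : SchwingerFamily E4),
            sch.HasWeakCouplingLimit ∧ Clauses₁ r sch S₁ := by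
  rw [hypercubicLimit_iff]
  refine forall_congr' fun G => forall_congr' fun _ => forall_congr' fun _ => forall_congr' fun _ =>
    forall_congr' fun _ => forall_congr' fun _ => ⟨?_, ?_⟩
  · rintro ⟨r, sch, S, hw, h⟩
    letI : MeasurableSpace G := borel G
    haveI : BorelSpace G := ⟨rfl⟩
    exact ⟨r, sch, _, hw, clauses₁_of_clauses h⟩
  · rintro ⟨r, sch, S₁, hw, h⟩
    letI : MeasurableSpace G := borel G
    haveI : BorelSpace G := ⟨rfl⟩
    exact ⟨r, _, _, (hasWeakCouplingLimit_onlySpecies sch r.curvature).2 hw, clauses_of_clauses₁ h⟩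

end OneField

/-! ## §5 `0 < Δ` is load-bearing; periodicity kills the "all time separations" strengthening -/

section Rates

variable {G : Type} [Group G] [TopologicalSpace G] [IsTopologicalGroup G] [CompactSpace G]
  [MeasurableSpace G] [BorelSpace G]

/-- **A priori bound**: connected torus correlations of bounded observables are bounded by
`2 C_A C_B`, at every coupling (Wilson's measure is a probability measure for continuous `ρ`). -/
theorem abs_latticeConnectedCorr_le (r : LatticeRep G) (β : ℝ) (S : ℕ) [NeZero S]
    {A B : LGConfig 4 G → ℝ} {CA CB : ℝ} (hA : ∀ U, |A U| ≤ CA) (hB : ∀ U, |B U| ≤ CB) (n : ℕ) :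
    |latticeConnectedCorr r.ρ β S A B n| ≤ 2 * (CA * CB) := by
  haveI := isProbabilityMeasure_wilsonMeasure (d := 4) (L := S) r.ρ r.continuous β
  have hCA0 : 0 ≤ CA := le_trans (abs_nonneg _) (hA fun _ => 1)
  have hb1 : ‖∫ U, A (torusLift S U) * B (configShift (-Pi.single 0 (n : ℤ)) (torusLift S U))
      ∂(wilsonMeasure (d := 4) (L := S) r.ρ β)‖ ≤ CA * CB := by
    refine (norm_integral_le_of_norm_le_const (C := CA * CB) ?_).trans (by simp)
    refine Eventually.of_forall fun U => ?_
    rw [norm_mul, Real.norm_eq_abs, Real.norm_eq_abs]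
    exact mul_le_mul (hA _) (hB _) (abs_nonneg _) hCA0
  have hb2 : ‖∫ U, A (torusLift S U) ∂(wilsonMeasure (d := 4) (L := S) r.ρ β)‖ ≤ CA := by
    refine (norm_integral_le_of_norm_le_const (C := CA) ?_).trans (by simp)
    exact Eventually.of_forall fun U => by rw [Real.norm_eq_abs]; exact hA _
  have hb3 : ‖∫ U, B (torusLift S U) ∂(wilsonMeasure (d := 4) (L := S) r.ρ β)‖ ≤ CB := by
    refine (norm_integral_le_of_norm_le_const (C := CB) ?_).trans (by simp)
    exact Eventually.of_forall fun U => by rw [Real.norm_eq_abs]; exact hB _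
  unfold latticeConnectedCorr
  rw [← Real.norm_eq_abs]
  refine (norm_sub_le _ _).trans ?_
  rw [norm_mul]
  have := mul_le_mul hb2 hb3 (norm_nonneg _) hCA0
  linarith

/-- **`0 < Δ` is load-bearing**: for `Δ ≤ 0` EVERY scheme has `HasLatticeMassGap r sch Δ`
(the bound `C e^{-Δ a_k n} ≥ C` is implied by boundedness of the observables). -/
theorem hasLatticeMassGap_of_nonpos {ι : Type} (r : LatticeRep G) (sch : SpeciesScheme ι) {Δ : ℝ}
    (hΔ : Δ ≤ 0) : HasLatticeMassGap r sch Δ := by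
  intro A B
  obtain ⟨CA, hCA⟩ := A.bounded
  obtain ⟨CB, hCB⟩ := B.bounded
  refine ⟨2 * (CA * CB), Eventually.of_forall fun k S _ n _ => ?_⟩
  refine (abs_latticeConnectedCorr_le r (sch.β k) (2 * S + 1) hCA hCB n).trans ?_
  have h2 : 0 ≤ 2 * (CA * CB) :=
    le_trans (abs_nonneg _) (abs_latticeConnectedCorr_le r (sch.β k) (2 * S + 1) hCA hCB n)
  have hexp : 1 ≤ Real.exp (-(Δ * (sch.a k * n))) := by
    rw [Real.one_le_exp_iff]
    have : 0 ≤ sch.a k * n := mul_nonneg (sch.a_pos k).le (Nat.cast_nonneg _)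
    nlinarith
  calc 2 * (CA * CB) = 2 * (CA * CB) * 1 := (mul_one _).symm
    _ ≤ 2 * (CA * CB) * Real.exp (-(Δ * (sch.a k * n))) := mul_le_mul_of_nonneg_left hexp h2

omit [TopologicalSpace G] [IsTopologicalGroup G] [CompactSpace G] [BorelSpace G] [Group G] in
/-- **Periodicity of the shifted lift**: shifting by a full period of the torus in the time
direction changes nothing. -/
theorem configShift_torusLift_add_period (L : ℕ) (U : GaugeConfig 4 L G) (n : ℕ) :
    configShift (-Pi.single 0 ((n + L : ℕ) : ℤ)) (torusLift L U) =
      configShift (-Pi.single 0 (n : ℤ)) (torusLift L U) := by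
  funext e
  simp only [Literature.MathematicalPhysics.QuantumLattice.configShift_apply, torusLift,
    Function.comp_apply, torusEdge]
  congr 2
  funext i
  simp only [Literature.Probability.LatticeModels.Torus.proj_apply, Pi.sub_apply, Pi.neg_apply]
  by_cases hi : i = 0
  · subst hi; simp
  · simp [Pi.single_eq_of_ne hi]

/-- **Torus time-correlations are periodic** with period the side of the torus. -/
theorem latticeConnectedCorr_add_side {N : ℕ} (ρ : G →* Matrix (Fin N) (Fin N) ℂ) (β : ℝ)
    (L : ℕ) [NeZero L] (A B : LGConfig 4 G → ℝ) (n : ℕ) :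
    latticeConnectedCorr ρ β L A B (n + L) = latticeConnectedCorr ρ β L A B n := by
  unfold latticeConnectedCorr
  simp_rw [configShift_torusLift_add_period]

/-- Iterated periodicity. -/
theorem latticeConnectedCorr_add_mul_side {N : ℕ} (ρ : G →* Matrix (Fin N) (Fin N) ℂ) (β : ℝ)
    (L : ℕ) [NeZero L] (A B : LGConfig 4 G → ℝ) (n m : ℕ) :
    latticeConnectedCorr ρ β L A B (n + m * L) = latticeConnectedCorr ρ β L A B n := by
  induction m with
  | zero => simp
  | succ m ih => rw [Nat.succ_mul, ← add_assoc, latticeConnectedCorr_add_side, ih]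

/-- The NATURAL STRENGTHENING of `HasLatticeMassGap` with the restriction `n ≤ S` on the time
separation removed ("exponential decay at ALL separations on every large torus"). -/
def HasLatticeMassGapAllTimes {ι : Type} (r : LatticeRep G) (sch : SpeciesScheme ι) (Δ : ℝ) : Prop :=
  ∀ A B : YMSpecies G, ∃ C : ℝ, ∀ᶠ k in atTop, ∀ S : ℕ, sch.L k ≤ S → ∀ n : ℕ,
    |latticeConnectedCorr r.ρ (sch.β k) (2 * S + 1) A.F B.F n| ≤ C * Real.exp (-(Δ * (sch.a k * n)))

/-- **The all-times strengthening is degenerate**: by periodicity it forces EVERY connected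
torus correlation of every pair of gauge-invariant observables — in particular every variance
(`n = 0`) — to vanish on all large tori for all large `k`: the lattice states would have to be
deterministic on gauge-invariant observables.  (With any observable of positive variance, e.g. a
plaquette under the fully supported Wilson measure, it is outright false; the restriction `n ≤ S`
in `HasLatticeMassGap` is exactly what avoids this.) -/
theorem latticeConnectedCorr_eq_zero_of_allTimes {ι : Type} {r : LatticeRep G} {sch : SpeciesScheme ι}
    {Δ : ℝ} (hΔ : 0 < Δ) (h : HasLatticeMassGapAllTimes r sch Δ) (A B : YMSpecies G) :
    ∀ᶠ k in atTop, ∀ S : ℕ, sch.L k ≤ S → ∀ n : ℕ,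
      latticeConnectedCorr r.ρ (sch.β k) (2 * S + 1) A.F B.F n = 0 := by
  obtain ⟨C, hC⟩ := h A B
  filter_upwards [hC] with k hk S hS n
  have hrate : 0 < Δ * (sch.a k * (2 * S + 1 : ℕ)) :=
    mul_pos hΔ (mul_pos (sch.a_pos k) (by positivity))
  -- the bound along the periodic copies n + m (2S+1) tends to 0
  have hlim : Tendsto (fun m : ℕ => C * Real.exp (-(Δ * (sch.a k * ((n + m * (2 * S + 1) : ℕ) : ℝ)))))
      atTop (𝓝 0) := by
    have hexp : Tendsto (fun m : ℕ => Real.exp (-(Δ * (sch.a k * ((n + m * (2 * S + 1) : ℕ) : ℝ)))))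
        atTop (𝓝 0) := by
      have h1 : Tendsto (fun m : ℕ => Δ * (sch.a k * ((n + m * (2 * S + 1) : ℕ) : ℝ))) atTop atTop := by
        have : (fun m : ℕ => Δ * (sch.a k * ((n + m * (2 * S + 1) : ℕ) : ℝ))) =
            fun m : ℕ => Δ * (sch.a k * (2 * S + 1 : ℕ)) * (m : ℝ) + Δ * (sch.a k * n) := by
          funext m; push_cast; ring
        rw [this]
        exact tendsto_atTop_add_const_right _ _
          (Tendsto.const_mul_atTop hrate tendsto_natCast_atTop_atTop)
      exact Real.tendsto_exp_atBot.comp (tendsto_neg_atTop_atBot.comp h1)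
    simpa using hexp.const_mul C
  have hbound : ∀ m : ℕ, |latticeConnectedCorr r.ρ (sch.β k) (2 * S + 1) A.F B.F n| ≤
      C * Real.exp (-(Δ * (sch.a k * ((n + m * (2 * S + 1) : ℕ) : ℝ)))) := fun m => by
    rw [← latticeConnectedCorr_add_mul_side r.ρ (sch.β k) (2 * S + 1) A.F B.F n m]
    exact hk S hS _
  have h0 : |latticeConnectedCorr r.ρ (sch.β k) (2 * S + 1) A.F B.F n| ≤ 0 :=
    ge_of_tendsto' hlim hbound
  exact abs_eq_zero.1 (le_antisymm h0 (abs_nonneg _))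

end Rates


/-! ### §5c The common rate `Δ` is not load-bearing -/

section Rates2

variable {ι κ : Type} {G : Type} [Group G] [TopologicalSpace G] [IsTopologicalGroup G] [CompactSpace G]
  [MeasurableSpace G] [BorelSpace G]

/-- `HasLatticeMassGap` is downward closed in the rate. -/
theorem hasLatticeMassGap_anti (r : LatticeRep G) (sch : SpeciesScheme κ) {Δ Δ' : ℝ} (hle : Δ' ≤ Δ)
    (h : HasLatticeMassGap r sch Δ) : HasLatticeMassGap r sch Δ' := by
  intro A B
  obtain ⟨C, hC⟩ := h A B
  refine ⟨max C 0, ?_⟩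
  filter_upwards [hC] with k hk S hS n hn
  refine (hk S hS n hn).trans ?_
  have han : 0 ≤ sch.a k * n := mul_nonneg (sch.a_pos k).le (Nat.cast_nonneg _)
  calc C * Real.exp (-(Δ * (sch.a k * n)))
      ≤ max C 0 * Real.exp (-(Δ * (sch.a k * n))) :=
        mul_le_mul_of_nonneg_right (le_max_left _ _) (Real.exp_pos _).le
    _ ≤ max C 0 * Real.exp (-(Δ' * (sch.a k * n))) :=
        mul_le_mul_of_nonneg_left (Real.exp_le_exp.2 (by nlinarith)) (le_max_right _ _)

omit [Group G] [TopologicalSpace G] [IsTopologicalGroup G] [CompactSpace G] [BorelSpace G] in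
/-- The labelled continuum `HasMassGap` is downward closed in the rate. -/
theorem hasMassGap_anti (S : LabelledSchwingerFamily ι E4) {Δ Δ' : ℝ} (hle : Δ' ≤ Δ)
    (h : S.HasMassGap Δ) : S.HasMassGap Δ' := by
  intro n m k k' F G' hF hG
  obtain ⟨C, hC⟩ := h n m k k' F G' hF hG
  refine ⟨max C 0, fun t ht H hH => (hC t ht H hH).trans ?_⟩
  calc C * Real.exp (-Δ * t) ≤ max C 0 * Real.exp (-Δ * t) :=
        mul_le_mul_of_nonneg_right (le_max_left _ _) (Real.exp_pos _).le
    _ ≤ max C 0 * Real.exp (-Δ' * t) :=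
        mul_le_mul_of_nonneg_left (Real.exp_le_exp.2 (by nlinarith)) (le_max_right _ _)

/-- **The common rate is not load-bearing**: asking for ONE `Δ > 0` serving both gap clauses is the
same as asking for the two gaps separately (take the minimum). -/
theorem gaps_iff_separate (r : LatticeRep G) (sch : SpeciesScheme κ) (S : LabelledSchwingerFamily ι E4) :
    (∃ Δ : ℝ, 0 < Δ ∧ S.HasMassGap Δ ∧ HasLatticeMassGap r sch Δ) ↔
      (∃ Δ₁ : ℝ, 0 < Δ₁ ∧ S.HasMassGap Δ₁) ∧ (∃ Δ₂ : ℝ, 0 < Δ₂ ∧ HasLatticeMassGap r sch Δ₂) := by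
  constructor
  · rintro ⟨Δ, hΔ, h1, h2⟩
    exact ⟨⟨Δ, hΔ, h1⟩, ⟨Δ, hΔ, h2⟩⟩
  · rintro ⟨⟨Δ₁, h1, hg1⟩, ⟨Δ₂, h2, hg2⟩⟩
    exact ⟨min Δ₁ Δ₂, lt_min h1 h2, hasMassGap_anti S (min_le_left _ _) hg1,
      hasLatticeMassGap_anti r sch (min_le_right _ _) hg2⟩

end Rates2

/-! ### §5b The all-times strengthening is FALSE for every non-abelian `G` (positive variances) -/

section Variance

/-- A unitary matrix with `Re tr U = N` is the identity (`‖U − 1‖² = 2N − 2 Re tr U`). -/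
theorem eq_one_of_re_trace_eq_card {N : ℕ} {U : Matrix (Fin N) (Fin N) ℂ}
    (hU : U ∈ Matrix.unitaryGroup (Fin N) ℂ) (h : U.trace.re = N) : U = 1 := by
  have hUU : star U * U = 1 := Matrix.mem_unitaryGroup_iff'.1 hU
  have hM : ((U - 1)ᴴ * (U - 1)).trace = 0 := by
    have hexp : (U - 1)ᴴ * (U - 1) = 2 • (1 : Matrix (Fin N) (Fin N) ℂ) - U - Uᴴ := by
      rw [Matrix.conjTranspose_sub, Matrix.conjTranspose_one, sub_mul, mul_sub, mul_sub, one_mul,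
        mul_one, one_mul, ← Matrix.star_eq_conjTranspose, hUU]
      rw [two_smul]; abel
    rw [hexp, Matrix.trace_sub, Matrix.trace_sub, Matrix.trace_smul, Matrix.trace_one,
      Matrix.trace_conjTranspose, Fintype.card_fin]
    apply Complex.ext
    · simp [h]; ring
    · simp
  have := Matrix.trace_conjTranspose_mul_self_eq_zero_iff.1 hM
  exact sub_eq_zero.1 this

variable {G : Type} [Group G] [TopologicalSpace G] [IsTopologicalGroup G] [CompactSpace G]
  [MeasurableSpace G] [BorelSpace G]

/-- The configuration on `ℤ⁴` with every link in direction `0` equal to `a`, in direction `1`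
equal to `b`, and all others `1`. -/
def dirConfig (a b : G) : LGConfig 4 G := fun e => if e.2 = 0 then a else if e.2 = 1 then b else 1

/-- Its torus version (any side); the periodic lift of the torus version is `dirConfig`. -/
def dirConfigT (L : ℕ) (a b : G) : GaugeConfig 4 L G :=
  fun e => if e.2 = 0 then a else if e.2 = 1 then b else 1

omit [TopologicalSpace G] [IsTopologicalGroup G] [CompactSpace G] [MeasurableSpace G] [BorelSpace G] in
theorem torusLift_dirConfigT (L : ℕ) (a b : G) : torusLift L (dirConfigT L a b) = dirConfig a b := by
  funext e; rfl

omit [TopologicalSpace G] [IsTopologicalGroup G] [CompactSpace G] [MeasurableSpace G] [BorelSpace G] in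
theorem torusLift_one (L : ℕ) : torusLift L (fun _ => (1 : G)) = (fun _ => (1 : G) : LGConfig 4 G) := by
  funext e; rfl

omit [TopologicalSpace G] [IsTopologicalGroup G] [CompactSpace G] [MeasurableSpace G] [BorelSpace G] in
/-- The Wilson action density of the trivial configuration is `6N`. -/
theorem actionDensity_const_one {N : ℕ} (ρ : G →* Matrix (Fin N) (Fin N) ℂ) :
    actionDensity ρ (fun _ => (1 : G)) = 6 * N := by
  simp [actionDensity, plaquetteObs, plaquetteHolonomyZd, Fin.sum_univ_four, Matrix.trace_one]
  ring

omit [TopologicalSpace G] [IsTopologicalGroup G] [CompactSpace G] [MeasurableSpace G] [BorelSpace G] in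
/-- The action density of `dirConfig a b` is `Re tr ρ(aba⁻¹b⁻¹) + 5N`. -/
theorem actionDensity_dirConfig {N : ℕ} (ρ : G →* Matrix (Fin N) (Fin N) ℂ) (a b : G) :
    actionDensity ρ (dirConfig a b) = (ρ (a * b * a⁻¹ * b⁻¹)).trace.re + 5 * N := by
  simp [actionDensity, plaquetteObs, plaquetteHolonomyZd, dirConfig, Fin.sum_univ_four,
    Matrix.trace_one]
  ring

omit [IsTopologicalGroup G] [CompactSpace G] [MeasurableSpace G] [BorelSpace G] in
/-- **For a non-abelian `G` and a faithful `ρ`, the curvature observable is not constant**. -/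
theorem actionDensity_ne (r : LatticeRep G) {a b : G} (hab : a * b ≠ b * a) :
    actionDensity r.ρ (dirConfig a b) ≠ actionDensity r.ρ (fun _ => (1 : G)) := by
  rw [actionDensity_dirConfig, actionDensity_const_one]
  intro h
  have htr : (r.ρ (a * b * a⁻¹ * b⁻¹)).trace.re = r.N := by linarith
  have h1 : r.ρ (a * b * a⁻¹ * b⁻¹) = 1 := eq_one_of_re_trace_eq_card (r.mem_unitary _) htr
  have h2 : a * b * a⁻¹ * b⁻¹ = 1 := r.injective (by rw [h1, map_one])
  apply hab
  calc a * b = a * b * a⁻¹ * b⁻¹ * (b * a) := by group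
    _ = b * a := by rw [h2, one_mul]

/-- **Wilson's measure charges every non-empty open set** (continuous `ρ`): the density
`e^{-βS}` is bounded below and product Haar is positive on opens. -/
theorem isOpenPosMeasure_wilsonMeasure {N : ℕ} (ρ : G →* Matrix (Fin N) (Fin N) ℂ)
    (hρ : Continuous ρ) (β : ℝ) (L : ℕ) [NeZero L] :
    Measure.IsOpenPosMeasure (wilsonMeasure (d := 4) (L := L) ρ β) := by
  haveI : Measure.IsOpenPosMeasure (haarProbability G) := by
    unfold haarProbability; infer_instance
  haveI hprob := isProbabilityMeasure_wilsonMeasure (d := 4) (L := L) ρ hρ β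
  obtain ⟨B, hB⟩ := exists_abs_wilsonAction_le (d := 4) (L := L) ρ hρ
  refine ⟨fun O hO hne => ?_⟩
  set π : Measure (GaugeConfig 4 L G) := Measure.pi fun _ : Edge 4 L => haarProbability G with hπ
  have hπO : π O ≠ 0 := hO.measure_ne_zero π hne
  have hZ : (partitionFunction (d := 4) (L := L) ρ β)⁻¹ ≠ 0 := by
    intro h0
    have h1 : wilsonMeasure (d := 4) (L := L) ρ β Set.univ = 1 := measure_univ
    simp [wilsonMeasure, h0] at h1
  have hw : ∀ U : GaugeConfig 4 L G,
      ENNReal.ofReal (Real.exp (-(|β| * B))) ≤ ENNReal.ofReal (Real.exp (-β * wilsonAction ρ U)) := by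
    intro U
    apply ENNReal.ofReal_le_ofReal
    apply Real.exp_le_exp.2
    have h1 : β * wilsonAction ρ U ≤ |β * wilsonAction ρ U| := le_abs_self _
    have h2 : |β * wilsonAction ρ U| ≤ |β| * B := by
      rw [abs_mul]; exact mul_le_mul_of_nonneg_left (hB U) (abs_nonneg _)
    linarith
  have hlow : ENNReal.ofReal (Real.exp (-(|β| * B))) * π O ≤ wilsonWeight (d := 4) (L := L) ρ β O := by
    calc ENNReal.ofReal (Real.exp (-(|β| * B))) * π O
        = ∫⁻ _ in O, ENNReal.ofReal (Real.exp (-(|β| * B))) ∂π := (setLIntegral_const _ _).symm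
      _ ≤ ∫⁻ U in O, ENNReal.ofReal (Real.exp (-β * wilsonAction ρ U)) ∂π := lintegral_mono fun U => hw U
      _ ≤ wilsonWeight (d := 4) (L := L) ρ β O := withDensity_apply_le _ _
  have hpos : wilsonWeight (d := 4) (L := L) ρ β O ≠ 0 := by
    refine ne_of_gt (lt_of_lt_of_le ?_ hlow)
    exact ENNReal.mul_pos (ENNReal.ofReal_pos.2 (Real.exp_pos _)).ne' hπO
  simp only [wilsonMeasure, Measure.smul_apply, smul_eq_mul, ne_eq, mul_eq_zero, hZ, hpos, or_self,
    not_false_eq_true]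

omit [MeasurableSpace G] [BorelSpace G] [Group G] [IsTopologicalGroup G] in
/-- A continuous observable of torus configurations has compact support (compact space). -/
theorem hasCompactSupport_of_gaugeConfig {L : ℕ} (f : GaugeConfig 4 L G → ℝ) : HasCompactSupport f :=
  (isClosed_tsupport f).isCompact

/-- **Positive variance**: under any Wilson measure (continuous faithful `ρ`), a continuous
observable taking two different values has `∫ P² − (∫ P)² > 0`. -/
theorem variance_pos (r : LatticeRep G) (β : ℝ) (L : ℕ) [NeZero L]
    {P : GaugeConfig 4 L G → ℝ} (hP : Continuous P) {U V : GaugeConfig 4 L G} (hUV : P U ≠ P V) :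
    0 < ∫ W, P W * P W ∂(wilsonMeasure (d := 4) (L := L) r.ρ β) -
      (∫ W, P W ∂(wilsonMeasure (d := 4) (L := L) r.ρ β)) *
        ∫ W, P W ∂(wilsonMeasure (d := 4) (L := L) r.ρ β) := by
  haveI : SecondCountableTopology G :=
    (r.continuous.isClosedEmbedding r.injective).isEmbedding.secondCountableTopology
  haveI := isProbabilityMeasure_wilsonMeasure (d := 4) (L := L) r.ρ r.continuous β
  haveI := isOpenPosMeasure_wilsonMeasure (G := G) r.ρ r.continuous β L
  set μ := wilsonMeasure (d := 4) (L := L) r.ρ β with hμ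
  set c : ℝ := ∫ W, P W ∂μ with hc
  have hg : Continuous fun W => (P W - c) ^ 2 := by fun_prop
  have hint : Integrable P μ := hP.integrable_of_hasCompactSupport (hasCompactSupport_of_gaugeConfig P)
  have hint2 : Integrable (fun W => P W * P W) μ :=
    (hP.mul hP).integrable_of_hasCompactSupport (hasCompactSupport_of_gaugeConfig _)
  -- some point where the centred square is non-zero
  have hx : ∃ X, (P X - c) ^ 2 ≠ 0 := by
    by_contra hall
    push Not at hall
    have hU := hall U
    have hV := hall V
    rw [sq_eq_zero_iff, sub_eq_zero] at hU hV
    exact hUV (hU.trans hV.symm)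
  obtain ⟨X, hX⟩ := hx
  have hpos : 0 < ∫ W, (P W - c) ^ 2 ∂μ :=
    hg.integral_pos_of_hasCompactSupport_nonneg_nonzero (hasCompactSupport_of_gaugeConfig _)
      (fun W => sq_nonneg _) hX
  have hexpand : ∫ W, (P W - c) ^ 2 ∂μ = ∫ W, P W * P W ∂μ - c * c := by
    have h1 : (fun W => (P W - c) ^ 2) = fun W => P W * P W - (2 * c) * P W + c ^ 2 := by
      funext W; ring
    have e2 : ∫ W, (P W * P W - (2 * c) * P W + c ^ 2) ∂μ =
        (∫ W, P W * P W ∂μ - ∫ W, (2 * c) * P W ∂μ) + ∫ _W, c ^ 2 ∂μ := by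
      rw [integral_add (f := fun W => P W * P W - (2 * c) * P W) (g := fun _ => c ^ 2)
        (hint2.sub (hint.const_mul _)) (integrable_const _),
        integral_sub (f := fun W => P W * P W) (g := fun W => (2 * c) * P W) hint2 (hint.const_mul _)]
    rw [h1, e2, integral_const_mul, integral_const, smul_eq_mul, probReal_univ, ← hc]
    ring
  linarith

/-- `latticeConnectedCorr` at time separation `0` is the variance-type quantity. -/
theorem latticeConnectedCorr_zero_time {N : ℕ} (ρ : G →* Matrix (Fin N) (Fin N) ℂ) (β : ℝ)
    (L : ℕ) [NeZero L] (A : LGConfig 4 G → ℝ) :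
    latticeConnectedCorr ρ β L A A 0 =
      ∫ W, A (torusLift L W) * A (torusLift L W) ∂(wilsonMeasure (d := 4) (L := L) ρ β) -
        (∫ W, A (torusLift L W) ∂(wilsonMeasure (d := 4) (L := L) ρ β)) *
          ∫ W, A (torusLift L W) ∂(wilsonMeasure (d := 4) (L := L) ρ β) := by
  unfold latticeConnectedCorr
  have h0 : ∀ W : LGConfig 4 G, configShift (-Pi.single (0 : Fin 4) ((0 : ℕ) : ℤ)) W = W := by
    intro W; funext e
    simp [Literature.MathematicalPhysics.QuantumLattice.configShift_apply]
  simp_rw [h0]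

/-- **The all-times strengthening of `HasLatticeMassGap` is FALSE for every non-abelian compact
`G`, every faithful `r`, every scheme and every `Δ > 0`**: the curvature observable has positive
variance under every Wilson measure (fully supported), while the strengthening forces the
variance to vanish (periodicity, §5).  In particular replacing `HasLatticeMassGap` by it kills the
crux for EVERY compact simple Lie group. -/
theorem not_hasLatticeMassGapAllTimes {ι : Type} (hG : ∃ a b : G, a * b ≠ b * a) (r : LatticeRep G)
    (sch : SpeciesScheme ι) {Δ : ℝ} (hΔ : 0 < Δ) : ¬ HasLatticeMassGapAllTimes r sch Δ := by
  intro h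
  obtain ⟨a, b, hab⟩ := hG
  obtain ⟨k, hk⟩ := (latticeConnectedCorr_eq_zero_of_allTimes hΔ h r.curvature r.curvature).exists
  have h0 := hk (sch.L k) le_rfl 0
  rw [latticeConnectedCorr_zero_time] at h0
  have hP : Continuous fun W : GaugeConfig 4 (2 * sch.L k + 1) G =>
      r.curvature.F (torusLift (2 * sch.L k + 1) W) :=
    (continuous_actionDensity r.continuous).comp (continuous_pi fun _ => continuous_apply _)
  have hne : r.curvature.F (torusLift (2 * sch.L k + 1) (dirConfigT _ a b)) ≠
      r.curvature.F (torusLift (2 * sch.L k + 1) (fun _ => 1)) := by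
    rw [torusLift_dirConfigT, torusLift_one]
    exact actionDensity_ne r hab
  have hvar := variance_pos r (sch.β k) (2 * sch.L k + 1) hP hne
  linarith


/-- **Corollary (type (c) finding): the crux with `HasLatticeMassGap` replaced by its all-times
strengthening fails for EVERY compact simple `G`** (pointwise in `G`; no witness `(r, sch, S, Δ)`). -/
theorem not_clauses_with_allTimes (hG : IsSimpleCompactGroup G) (r : LatticeRep G)
    (sch : SpeciesScheme (YMSpecies G)) (S : LabelledSchwingerFamily (YMSpecies G) E4) :
    ¬ (OSClauses S ∧ Converges r sch S ∧ TwoPointNontrivial S r.curvature ∧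
        ThreePointNonGaussian S r.curvature ∧
        ∃ Δ : ℝ, 0 < Δ ∧ S.HasMassGap Δ ∧ HasLatticeMassGapAllTimes r sch Δ) := by
  rintro ⟨-, -, -, -, Δ, hΔ, -, hall⟩
  exact not_hasLatticeMassGapAllTimes hG.2.1 r sch hΔ hall

end Variance







/-! ## §8 Reflection positivity upgrade: the truncated OS form is a Gram form -/

section OSForm

variable {ι : Type}

theorem osAdjoint_tensor₁ (u : 𝓢(E4, ℝ)) : osAdjoint (tensor₁ u) = thetaTensor₁ u := by
  ext x
  rw [osAdjoint_apply, thetaTensor₁_apply, tensor₁_apply, Complex.conj_ofReal]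
  rw [Subsingleton.elim (Fin.rev (0 : Fin 1)) 0]

/-- The OS two-point pairing `⟨Ψ_a, Ψ_b⟩ = 𝔖₂(θa ⊗ b)` of two real positive-time one-point functions. -/
def osPair (S : LabelledSchwingerFamily ι E4) (s : ι) (a b : 𝓢(E4, ℝ)) : ℂ :=
  S (1 + 1) (fun _ => s) (SchwartzMap.appendTensor (thetaTensor₁ a) (tensor₁ b))

/-- The truncated OS form `T(a,b) = 𝔖₂(θa ⊗ b) − 𝔖₁(θa) 𝔖₁(b)`. -/
def osTrunc (S : LabelledSchwingerFamily ι E4) (s : ι) (a b : 𝓢(E4, ℝ)) : ℂ :=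
  osPair S s a b - S 1 (fun _ => s) (thetaTensor₁ a) * S 1 (fun _ => s) (tensor₁ b)

variable {S : LabelledSchwingerFamily ι E4} (h : OSReconstructionNoE1 S) (s : ι)

/-- The OS field vector `Ψ_a` of a real positive-time one-point function. -/
def psi {a : 𝓢(E4, ℝ)} (ha : tsupport a ⊆ {y : E4 | 0 < y 0}) : h.Hilbert :=
  h.fieldVec 1 (fun _ => s) (tensor₁ a) (isTimeOrdered_tensor₁ ha)

theorem inner_psi_psi {a b : 𝓢(E4, ℝ)} (ha : tsupport a ⊆ {y : E4 | 0 < y 0})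
    (hb : tsupport b ⊆ {y : E4 | 0 < y 0}) : ⟪psi h s ha, psi h s hb⟫_ℂ = osPair S s a b := by
  unfold psi osPair
  rw [h.inner_fieldVec_fieldVec (fun _ => s) (fun _ => s) (isTimeOrdered_tensor₁ ha)
    (isTimeOrdered_tensor₁ hb) (isAppendTensorOf_appendTensor _ _), osAdjoint_tensor₁]
  simp only [Function.comp_def, append_const]

theorem inner_vacuum_psi {b : 𝓢(E4, ℝ)} (hb : tsupport b ⊆ {y : E4 | 0 < y 0}) :
    ⟪h.vacuum, psi h s hb⟫_ℂ = S 1 (fun _ => s) (tensor₁ b) := by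
  have hH : IsAppendTensorOf (n := 0) (m := 1) (tensor₁ b)
      (osAdjoint (OSReconstructionNoE1.vacGen ι 4).fn) (tensor₁ b) := by
    intro x
    erw [osAdjoint_apply]
    simp only [OSReconstructionNoE1.vacGen]
    erw [SchwartzMap.constOfSubsingleton_apply (D := Fin 0 → E4) (1 : ℂ)]
    rw [map_one, one_mul]
    exact congrArg (tensor₁ b) (funext fun i => congrArg x (Fin.ext (by simp)))
  have key := h.inner_fieldVec_fieldVec (OSReconstructionNoE1.vacGen ι 4).lab (fun _ => s)
    (OSReconstructionNoE1.vacGen ι 4).timeOrdered (isTimeOrdered_tensor₁ hb) hH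
  have hl : Fin.append ((OSReconstructionNoE1.vacGen ι 4).lab ∘ Fin.rev) (fun _ : Fin 1 => s) =
      (fun _ => s : Fin (0 + 1) → ι) := by
    funext i
    induction i using Fin.addCases with
    | left i => exact i.elim0
    | right j => simp
  rw [hl] at key
  exact key

theorem inner_psi_vacuum {a : 𝓢(E4, ℝ)} (ha : tsupport a ⊆ {y : E4 | 0 < y 0}) :
    ⟪psi h s ha, h.vacuum⟫_ℂ = S 1 (fun _ => s) (thetaTensor₁ a) := by
  have hH : IsAppendTensorOf (n := 1) (m := 0) (thetaTensor₁ a)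
      (osAdjoint (tensor₁ a)) (OSReconstructionNoE1.vacGen ι 4).fn := by
    intro x
    rw [osAdjoint_tensor₁]
    simp only [OSReconstructionNoE1.vacGen]
    erw [SchwartzMap.constOfSubsingleton_apply (D := Fin 0 → E4) (1 : ℂ)]
    rw [mul_one]
    exact congrArg (thetaTensor₁ a) (funext fun i => congrArg x (Fin.ext (by simp)))
  have key := h.inner_fieldVec_fieldVec (fun _ => s) (OSReconstructionNoE1.vacGen ι 4).lab
    (isTimeOrdered_tensor₁ ha) (OSReconstructionNoE1.vacGen ι 4).timeOrdered hH
  have hl : Fin.append ((fun _ : Fin 1 => s) ∘ Fin.rev) (OSReconstructionNoE1.vacGen ι 4).lab =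
      (fun _ => s : Fin (1 + 0) → ι) := by
    funext i
    induction i using Fin.addCases with
    | left i => simp
    | right j => exact j.elim0
  rw [hl] at key
  exact key

/-- **The truncated OS form is the Gram form of the vacuum-subtracted field vectors**
`χ_a = Ψ_a − ⟨Ω,Ψ_a⟩ Ω`: `T(a,b) = ⟪χ_a, χ_b⟫`. -/
theorem osTrunc_eq_inner (hN : S.IsNormalized) {a b : 𝓢(E4, ℝ)} (ha : tsupport a ⊆ {y : E4 | 0 < y 0})
    (hb : tsupport b ⊆ {y : E4 | 0 < y 0}) :
    osTrunc S s a b =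
      ⟪psi h s ha - ⟪h.vacuum, psi h s ha⟫_ℂ • h.vacuum, psi h s hb - ⟪h.vacuum, psi h s hb⟫_ℂ • h.vacuum⟫_ℂ := by
  have hΩ : ⟪h.vacuum, h.vacuum⟫_ℂ = 1 := by
    rw [inner_self_eq_norm_sq_to_K, h.norm_vacuum hN]; simp
  rw [inner_sub_left, inner_sub_right, inner_sub_right, inner_smul_left, inner_smul_left,
    inner_smul_right, inner_smul_right, hΩ, inner_psi_psi, inner_psi_vacuum,
    inner_vacuum_psi h s ha, inner_vacuum_psi h s hb]
  unfold osTrunc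
  ring

/-- The diagonal truncated value is a squared norm: real and non-negative. -/
theorem osTrunc_self (hN : S.IsNormalized) {a : 𝓢(E4, ℝ)} (ha : tsupport a ⊆ {y : E4 | 0 < y 0}) :
    osTrunc S s a a = ((‖psi h s ha - ⟪h.vacuum, psi h s ha⟫_ℂ • h.vacuum‖ ^ 2 : ℝ) : ℂ) := by
  rw [osTrunc_eq_inner h s hN ha ha, inner_self_eq_norm_sq_to_K]
  norm_cast

/-- **Cauchy–Schwarz for the truncated OS form** (from E2 + translations + normalisation):
`|T(a,b)|² ≤ T(a,a) · T(b,b)` (and `T(a,a) ≥ 0` real, `osTrunc_self`). -/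
theorem osTrunc_cauchySchwarz (h : OSReconstructionNoE1 S) (hN : S.IsNormalized) {a b : 𝓢(E4, ℝ)}
    (ha : tsupport a ⊆ {y : E4 | 0 < y 0})
    (hb : tsupport b ⊆ {y : E4 | 0 < y 0}) :
    ‖osTrunc S s a b‖ ^ 2 ≤ (osTrunc S s a a).re * (osTrunc S s b b).re := by
  rw [osTrunc_eq_inner h s hN ha hb, osTrunc_self h s hN ha, osTrunc_self h s hN hb, Complex.ofReal_re,
    Complex.ofReal_re]
  have := norm_inner_le_norm (𝕜 := ℂ) (psi h s ha - ⟪h.vacuum, psi h s ha⟫_ℂ • h.vacuum)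
    (psi h s hb - ⟪h.vacuum, psi h s hb⟫_ℂ • h.vacuum)
  nlinarith [norm_nonneg (⟪psi h s ha - ⟪h.vacuum, psi h s ha⟫_ℂ • h.vacuum,
    psi h s hb - ⟪h.vacuum, psi h s hb⟫_ℂ • h.vacuum⟫_ℂ),
    norm_nonneg (psi h s ha - ⟪h.vacuum, psi h s ha⟫_ℂ • h.vacuum),
    norm_nonneg (psi h s hb - ⟪h.vacuum, psi h s hb⟫_ℂ • h.vacuum)]

end OSForm

/-! ### Consequences: non-triviality is a POSITIVITY statement -/

section Diagonal

variable {ι : Type} {S : LabelledSchwingerFamily ι E4}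

theorem tsupport_thetaTest_pos {u : 𝓢(E4, ℝ)} (hu : tsupport u ⊆ {y : E4 | y 0 < 0}) :
    tsupport (thetaTest 4 u) ⊆ {y : E4 | 0 < y 0} := by
  have hK : IsClosed ((timeReflection 4) ⁻¹' tsupport u) :=
    (isClosed_tsupport _).preimage (timeReflection 4).continuous
  have hsub : Function.support (thetaTest 4 u) ⊆ (timeReflection 4) ⁻¹' tsupport u := by
    intro y hy
    rw [Function.mem_support, thetaTest_apply] at hy
    exact subset_tsupport _ (Function.mem_support.2 hy)
  refine (closure_minimal hsub hK).trans fun y hy => ?_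
  have h := hu hy
  simp only [Set.mem_setOf_eq, timeReflection_apply] at h
  simpa using h

theorem tsupport_thetaTest_neg {v : 𝓢(E4, ℝ)} (hv : tsupport v ⊆ {y : E4 | 0 < y 0}) :
    tsupport (thetaTest 4 v) ⊆ {y : E4 | y 0 < 0} := by
  have hK : IsClosed ((timeReflection 4) ⁻¹' tsupport v) :=
    (isClosed_tsupport _).preimage (timeReflection 4).continuous
  have hsub : Function.support (thetaTest 4 v) ⊆ (timeReflection 4) ⁻¹' tsupport v := by
    intro y hy
    rw [Function.mem_support, thetaTest_apply] at hy
    exact subset_tsupport _ (Function.mem_support.2 hy)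
  refine (closure_minimal hsub hK).trans fun y hy => ?_
  have h := hv hy
  simp only [Set.mem_setOf_eq, timeReflection_apply] at h
  simpa using h

theorem appendTensor_tensor₁ (u v : 𝓢(E4, ℝ)) :
    SchwartzMap.appendTensor (tensor₁ u) (tensor₁ v) = tensor₂ u v := by
  ext x
  rw [SchwartzMap.appendTensor_apply, tensor₁_apply, tensor₁_apply, tensor₂_apply]
  have h0 : (x ∘ Fin.castAdd 1) 0 = x 0 := congrArg x (Fin.ext rfl)
  have h1 : (x ∘ Fin.natAdd 1) 0 = x 1 := congrArg x (Fin.ext rfl)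
  rw [h0, h1]

theorem thetaTensor₁_thetaTest (u : 𝓢(E4, ℝ)) : thetaTensor₁ (thetaTest 4 u) = tensor₁ u := by
  unfold thetaTensor₁
  rw [thetaTest_involutive 4 u]

/-- The truncated OS form at `(θu, v)` is the truncated real two-point value of the bridge. -/
theorem osTrunc_thetaTest (S : LabelledSchwingerFamily ι E4) (s : ι) (u v : 𝓢(E4, ℝ)) :
    osTrunc S s (thetaTest 4 u) v =
      S (1 + 1) (fun _ => s) (tensor₂ u v) - S 1 (fun _ => s) (tensor₁ u) * S 1 (fun _ => s) (tensor₁ v) := by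
  unfold osTrunc osPair
  rw [thetaTensor₁_thetaTest, appendTensor_tensor₁]

/-- **Non-triviality is a positivity statement.** Under E2 + translations + `𝔖₀ = 1`, the crux's
non-triviality clause for the species `s` holds iff for ONE real positive-time `v` the truncated,
reflection-symmetric two-point value `T(v,v) = 𝔖₂(θv ⊗ v) − 𝔖₁(θv)𝔖₁(v) = ‖Ψ_v − ⟨Ω,Ψ_v⟩Ω‖²`
is (strictly) POSITIVE.  (Cauchy–Schwarz: an off-diagonal witness forces a diagonal one.) -/
theorem twoPointNontrivial_iff_diagonal (h : OSReconstructionNoE1 S) (hN : S.IsNormalized) (s : ι) :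
    TwoPointNontrivial S s ↔ ∃ v : 𝓢(E4, ℝ), tsupport v ⊆ {y : E4 | 0 < y 0} ∧ 0 < (osTrunc S s v v).re := by
  rw [twoPointNontrivial_iff_real]
  constructor
  · rintro ⟨u, v, hu, hv, hne⟩
    have hu' := tsupport_thetaTest_pos hu
    have hT : osTrunc S s (thetaTest 4 u) v ≠ 0 := by rwa [osTrunc_thetaTest, sub_ne_zero]
    have hcs := osTrunc_cauchySchwarz s h hN hu' hv
    have hpos : 0 < ‖osTrunc S s (thetaTest 4 u) v‖ ^ 2 := by positivity
    have ha0 : 0 ≤ (osTrunc S s (thetaTest 4 u) (thetaTest 4 u)).re := by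
      rw [osTrunc_self h s hN hu', Complex.ofReal_re]; positivity
    refine ⟨v, hv, ?_⟩
    by_contra hle
    push Not at hle
    nlinarith
  · rintro ⟨v, hv, hpos⟩
    refine ⟨thetaTest 4 v, v, tsupport_thetaTest_neg hv, hv, ?_⟩
    intro heq
    have h0 : osTrunc S s (thetaTest 4 (thetaTest 4 v)) v = 0 := by
      rw [osTrunc_thetaTest, heq, sub_self]
    rw [thetaTest_involutive 4 v] at h0
    rw [h0] at hpos
    simp at hpos

end Diagonal

/-! ### The lattice form of the positivity criterion -/

section LatticeDiagonal

variable {G : Type} [Group G] [TopologicalSpace G] [IsTopologicalGroup G] [CompactSpace G]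
  [MeasurableSpace G] [BorelSpace G]

/-- **The prover's target, final form.** Under the convergence clause, E2, translation invariance
and `𝔖₀ = 1` (all clauses of the crux), non-triviality of the species `s` is EQUIVALENT to: for
ONE real positive-time `v`, the truncated reflection-symmetric lattice two-point function
`⟨Φ_k(θv) Φ_k(v)⟩ − ⟨Φ_k(θv)⟩⟨Φ_k(v)⟩` of the smeared species converges to a strictly POSITIVE
number.  (The adversary's target: it tends to `0` for every such `v`.) -/
theorem twoPointNontrivial_iff_lattice_diagonal (r : LatticeRep G) (sch : SpeciesScheme (YMSpecies G))
    (S : LabelledSchwingerFamily (YMSpecies G) E4) (hconv : Converges r sch S)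
    (h : OSReconstructionNoE1 S) (hN : S.IsNormalized) (s : YMSpecies G) :
    TwoPointNontrivial S s ↔ ∃ v : 𝓢(E4, ℝ), tsupport v ⊆ {y : E4 | 0 < y 0} ∧ ∃ ℓ : ℝ, 0 < ℓ ∧
      Tendsto (fun k : ℕ =>
          latticeSchwinger r.ρ sch (fun s => s.F) k (1 + 1) (fun _ => s) ![thetaTest 4 v, v] -
            latticeSchwinger r.ρ sch (fun s => s.F) k 1 (fun _ => s) ![thetaTest 4 v] *
              latticeSchwinger r.ρ sch (fun s => s.F) k 1 (fun _ => s) ![v]) atTop (𝓝 ℓ) := by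
  rw [twoPointNontrivial_iff_diagonal h hN s]
  refine exists_congr fun v => and_congr_right fun hv => ?_
  set u := thetaTest 4 v with hu_def
  have hu : tsupport u ⊆ {y : E4 | y 0 < 0} := tsupport_thetaTest_neg hv
  have h2 := hconv (1 + 1) (by norm_num) (fun _ => s) ![u, v] (tensor₂ u v) (isTensorOf_tensor₂ u v)
    (isOffDiagonal_of_halfSpaces hu hv (isTensorOf_tensor₂ u v))
  have hu1 := hconv 1 one_ne_zero (fun _ => s) ![u] (tensor₁ u) (isTensorOf_tensor₁ u)
    (isOffDiagonal_fin_one _)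
  have hv1 := hconv 1 one_ne_zero (fun _ => s) ![v] (tensor₁ v) (isTensorOf_tensor₁ v)
    (isOffDiagonal_fin_one _)
  set f : ℕ → ℝ := fun k =>
    latticeSchwinger r.ρ sch (fun s => s.F) k (1 + 1) (fun _ => s) ![u, v] -
      latticeSchwinger r.ρ sch (fun s => s.F) k 1 (fun _ => s) ![u] *
        latticeSchwinger r.ρ sch (fun s => s.F) k 1 (fun _ => s) ![v] with hf
  have hT0 : osTrunc S s v v =
      S (1 + 1) (fun _ => s) (tensor₂ u v) - S 1 (fun _ => s) (tensor₁ u) * S 1 (fun _ => s) (tensor₁ v) := by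
    rw [← osTrunc_thetaTest S s u v, hu_def, thetaTest_involutive 4 v]
  have hT : Tendsto (fun k : ℕ => (f k : ℂ)) atTop (𝓝 (osTrunc S s v v)) := by
    rw [hT0]
    exact (h2.sub (hu1.mul hv1)).congr fun k => by simp only [hf]; push_cast; ring
  have hre : Tendsto f atTop (𝓝 (osTrunc S s v v).re) := by
    have := (Complex.continuous_re.tendsto _).comp hT
    simpa [Function.comp_def] using this
  change _ ↔ ∃ ℓ : ℝ, 0 < ℓ ∧ Tendsto f atTop (𝓝 ℓ)
  constructor
  · intro hpos
    exact ⟨_, hpos, hre⟩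
  · rintro ⟨ℓ, hℓ, hfℓ⟩
    rwa [tendsto_nhds_unique hre hfℓ]

end LatticeDiagonal

/-! ## §7 The one-point functions in closed form (the counterterm `m` is bookkeeping) -/

section OnePoint

variable {G : Type} [Group G] [TopologicalSpace G] [IsTopologicalGroup G] [CompactSpace G]
  [MeasurableSpace G] [BorelSpace G]

/-- **Closed form of the lattice one-point function** (any `β`, any species, any scheme): by
translation invariance of the torus state,
`⟨Φ_k(f)⟩ = c_s(k) a_k⁴ (⟨O_s⟩_k − m_s(k)) · ∑_{x ∈ box} f(a_k x)`.  In particular the convergence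
clause at `n = 1` only asks that `c_s(k) (⟨O_s⟩_k − m_s(k)) · a_k⁴ ∑_x f(a_k x)` converge (a Riemann
sum for `∫ f`): the additive counterterm is pure bookkeeping. -/
theorem latticeSchwinger_one (r : LatticeRep G) (sch : SpeciesScheme (YMSpecies G)) (k : ℕ)
    (s : YMSpecies G) (f : Fin 1 → 𝓢(E4, ℝ)) :
    latticeSchwinger r.ρ sch (fun s => s.F) k 1 (fun _ => s) f =
      sch.c s k * sch.a k ^ 4 *
        ((∫ U, s.F (torusLift (sch.side k) U) ∂(wilsonMeasure (d := 4) (L := sch.side k) r.ρ (sch.β k))) -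
          sch.m s k) * ∑ x ∈ Literature.Probability.LatticeModels.box 4 (sch.L k), f 0 (sch.a k • siteToE x) := by
  haveI := isProbabilityMeasure_wilsonMeasure (d := 4) (L := sch.side k) r.ρ r.continuous (sch.β k)
  set μ := wilsonMeasure (d := 4) (L := sch.side k) r.ρ (sch.β k) with hμ
  obtain ⟨C, hC⟩ := s.bounded
  have hlift : Measurable (torusLift (d := 4) (G := G) (sch.side k)) :=
    measurable_pi_lambda _ fun _ => measurable_pi_apply _
  have hint : ∀ x : Site 4, Integrable (fun U : GaugeConfig 4 (sch.side k) G =>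
      s.F (configShift (-x) (torusLift (sch.side k) U))) μ := fun x =>
    Integrable.of_bound ((s.measurable.comp ((configShift (-x)).measurable.comp hlift)).aestronglyMeasurable)
      C (Eventually.of_forall fun U => by rw [Real.norm_eq_abs]; exact hC _)
  unfold latticeSchwinger
  simp only [Fin.prod_univ_one, smearedLatticeField]
  rw [integral_const_mul, integral_finsetSum (Literature.Probability.LatticeModels.box 4 (sch.L k))
    (f := fun x U => f 0 (sch.a k • siteToE x) *
      (s.F (configShift (-x) (torusLift (sch.side k) U)) - sch.m s k)) ?_]
  · have hx : ∀ x ∈ Literature.Probability.LatticeModels.box 4 (sch.L k),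
        ∫ U, f 0 (sch.a k • siteToE x) * (s.F (configShift (-x) (torusLift (sch.side k) U)) - sch.m s k) ∂μ =
          f 0 (sch.a k • siteToE x) * ((∫ U, s.F (torusLift (sch.side k) U) ∂μ) - sch.m s k) := by
      intro x _
      rw [integral_const_mul, integral_sub (hint x) (integrable_const _), integral_const, smul_eq_mul,
        probReal_univ, one_mul, integral_configShift_torusLift]
    rw [Finset.sum_congr rfl hx, ← Finset.sum_mul]
    ring
  · intro x _
    exact ((hint x).sub (integrable_const _)).const_mul _

end OnePoint

/-! ## §6 Audit lemma: the sub-tensors of `ThreePointNonGaussian` -/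

section Audit

/-- In the non-Gaussianity clause, `f ⊗ g ⊗ h ∈ ⁰𝒮` forces the pairwise products `fg`, `gh`, `fh` to
vanish identically (evaluate at `(x,x,y)`, `(x,y,y)`, `(x,y,x)`); with the paper remark in the module
docstring (flatness of `g` or `h` at every point when `gh ≡ 0`) the two-point sub-tensors `g ⊗ h`,
`f ⊗ h`, `f ⊗ g` are then automatically in `⁰𝒮`, so the clause never evaluates `S 2` off `⁰𝒮`. -/
theorem pairwise_mul_eq_zero_of_isOffDiagonal₃ {f g h : 𝓢(E4, ℂ)} {F : 𝓢((Fin 3 → E4), ℂ)}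
    (hF : IsTensorOf F ![f, g, h]) (hod : IsOffDiagonal F) (x y : E4) :
    f x * g x * h y = 0 ∧ f x * g y * h y = 0 ∧ f x * g y * h x = 0 := by
  have e1 := hod.apply_eq_zero (x := ![x, x, y]) ⟨0, 1, by decide, by simp⟩
  have e2 := hod.apply_eq_zero (x := ![x, y, y]) ⟨1, 2, by decide, by simp⟩
  have e3 := hod.apply_eq_zero (x := ![x, y, x]) ⟨0, 2, by decide, by simp⟩
  rw [hF] at e1 e2 e3
  simp only [Fin.prod_univ_three, Matrix.cons_val_zero, Matrix.cons_val_one, Matrix.cons_val_two,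
    Matrix.head_cons, Matrix.tail_cons] at e1 e2 e3
  exact ⟨e1, e2, e3⟩

end Audit

/-! ## §9 (cycle 3, crux 8646) Every witness scheme leaves `β = 0` — LANDED, not re-checked here

§1 showed that at `β_k = 0` the uniform lattice gap `HasLatticeMassGap` is FREE (product Haar,
exact decorrelation).  The complementary exact computation — `latticeSchwinger_beta_zero` (at a step with
`β_k = 0` the curvature `n`-point function on an off-diagonal REAL tensor is EXACTLY
`(c_k (6d₀ − m_k))ⁿ ∏ᵢ a_k⁴ Σ fᵢ(a_k y)`) and `tie_beta_zero_factorises` (a one-field family tied to a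
scheme with `β_k = 0` FREQUENTLY is a c-number field on off-diagonal real tensors) — is LANDED as
`Theorems/CurvatureBoostCovariance/Negative/BetaZeroTie.lean` (p71676), and its consequences for this crux
(`factorizes_of_frequently_beta_zero`, `not_twoPointNontrivial_of_frequently_beta_zero`,
`eventually_beta_ne_zero_of_converges_nontrivial`, `hypercubicLimit_witness_beta_ne_zero`) as
`Theorems/HypercubicLimit/Negative/BetaMustLeaveZero.lean` (p72480): for EVERY `c_k, m_k, a_k, L_k` and
every faithful `r`, a scheme with `β_k = 0` frequently cannot witness `Converges ∧ TwoPointNontrivial`.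
Cycle 1 of crux 16154 REMOVED the re-checked copies from this work file: `BetaZeroTie` imports
`CurvatureBoostCovariance/Negative/Unbundled.lean`, which imports `Theses/MirrorModularBoosts.lean`, which
no longer builds from source (tree-state warning in the header) — keeping the import made this work file
unpublishable (`crux write` demands a coherent farm build).  For the live crux the conclusion is anyway
IMMEDIATE from the new conjunct: `eventually_beta_ne_zero_of_weak` and `hypercubicLimit_witness_beta_ne_zero`
(§13).  The 8646-form statement remains informative — `β_k ≠ 0` eventually is forced by
`Converges ∧ TwoPointNontrivial` alone, without `HasWeakCouplingLimit` — and is quoted from p72480. -/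

/-! ## §10 (cycle 3) Targets: the PICKED line `conditional-mean-telescoping` (7 stubs)

The lead picked `Lines/conditional-mean-telescoping.lean` (`PICKED.md`, 2026-08-16T00:22Z; skeleton
`fef2646ce76a…`, stubs `stub_telescoping` (T)+(M), `stub_latticeGapInput` (L′),
`stub_cornerFreeInfluence` (WI₂), `stub_influenceReverseHolder` (WIₙ, hardest), `stub_windowRegularity`
(W2), `stub_nonGaussianFloor` (NG), `stub_closure` (C)).  This section re-declares the line's objects
VERBATIM (same bodies, namespace `…Disproof.Targets`, so proofs below transplant textually) and records
what the standing adversary could decide.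

**Verdict (paper audit of all seven, Lean for the cheap edges): no stub is refutable by a junk or
degenerate instance; none is vacuous.**  Every clause carries its guard (`n ≤ S`, `1 ≤ R`,
`R ≤ c₀/m(β)`, `4R+4 < 2S+1`, `2(T+n+1) ≤ S`, `4n+8 ≤ S`, `S ≥ S₀(β)` chosen AFTER `β`), so no landed
`Negative/*` lemma and no torus-aliasing / all-times / `Δ ≤ 0` instance bites.  Specific checks:
* (T) `TelescopingBound`: at `R = 0` the cube has no interior edge (`cubeEdges_zero`), the exterior
  σ-algebra is everything (`exterior_zero`) and the influence is the plain `Lᵖ` norm of the centred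
  plaquette (`influence_radius_zero`) — (T) is then generalised Hölder; at `n = 0, 1` it holds with
  equality / trivially for every `R` (`telescoping_n_zero`, `telescoping_n_one`; note `eLpNorm _ 0 = 0`
  makes `influence … 0 = 0`, harmless).  For `n ≥ 2`, `R ≥ 1` the Markov shell of the radius-`R` cube
  (edges with endpoints in the `ℓ^∞`-ball of radius `R+1`) is disjoint ON THE TORUS from every other
  cube as soon as one coordinate separates the centres by `> 2R+1` with `|x k μ − x l μ| ≤ S` and
  `4R+4 < 2S+1` (both cyclic gaps are `≥ 0`: `d − 2R − 2 ≥ 0` and `2S+1−d−2R−2 ≥ S−2R−1 ≥ 0`), so the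
  tower/pull-out chain `E[∏ δp] = E[∏ Z_k]`, `Z_k = E[δp_k | ext_k]`, is sound as typed (any real `β`).
* (M) `InfluenceAntitone` is TRUE as typed — proved below (`influenceAntitone_holds`): cube monotone in
  `R` ⇒ exterior σ-algebras antitone ⇒ tower + `Lᵖ`-contractivity of `condExp` (`1 ≤ p ≤ ∞`); the guard
  `2R+2 < 2S+1` is not even needed.  Positive, so not the refuter's to land: it travels as evidence.
* (L′) `GapData`: (ii) is `HasLatticeMassGap`-shaped with `n ≤ S` (§5: essential) and is never vacuous
  or free (for fixed `β`, `n ≤ S → ∞` forces genuine decay); (iii) is an honest RP-spectral statement: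
  `θ : t ↦ 1−t` on the ODD torus `2S+1` is the mixed bond/site reflection for which the tree HAS
  `wilsonExpectation_oddReflectionPositive` (`β ≥ 0`, observables on temporal links based at
  `1 ≤ t ≤ S`, spatial at `t ≤ S+1`; the slab `[1,T]`, `2(T+n+1) ≤ S`, qualifies), so its `n = 0`
  instance is consistent and the `ε(S)B²` slack absorbs torelon/thermal sectors at fixed `β`;
  (iv)+(ii) pin `m(β)` to the plaquette mass from both sides (`2M/C₁ ≲ m ≤ M`; with `C₁ < 2` they force
  the RP square to vanish eventually), so the window `R ≤ c₀/m(β)` of (WI₂)/(WIₙ)/(W2) cannot be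
  inflated by a junk rate.  `β₁ < 0` only strengthens the hypothesis.  Open (= 8901/8941), not decidable.
* (WI₂)/(W2): the RP squares `rpSquare r β S R` (plaquette `p₀₁` at height `R`, temporal links based at
  `R`, spatial at `R, R+1`) and `reflPair x x` (action density at height `x₀ ≥ 1`) are genuine odd-torus
  RP squares for `β ≥ 0`, `1 ≤ R ≤ S` — non-negative, and `rpSquare … 1 > 0` strictly by strict
  positivity of the transfer matrix, so (W2)(c) `m(β)^q ≤ A(β,S,1)` has no sign trap; (W2)(b) at
  `R < 1/θ` forces `x = y` (an RP square); for `x ≠ y` positivity of the off-axis reflected pair is NOT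
  a consequence of axis RP alone (it would follow from diagonal RP = the route's other crux, or from
  E1 of the limit) — with `θ` small and `β₀` large it only probes near-axial pairs at distances `≥ 1/θ`
  in the asymptotically free window, where the leading (free `F²`) term is a sum of squares; plausible,
  not checkable here.  `influence r β S R i j p` is the same number for all twelve `(i,j)`, `i ≠ j`
  (coordinate permutations fix the cube and the base point; `(i,j)↔(j,i)` is `Re tr ρ(h⁻¹) = Re tr ρ(h)`).
* (WIₙ) the bet, reformulated for attackers: with `Z = E[δp | ext_R]` (bounded by `2N`),
  `‖Z‖ₙ ≤ C n^γ ‖Z‖₂ ∀ n ≥ 2` ⇔ the tail bound `P(|Z| > t‖Z‖₂) ≲ exp(−(t/C′)^{1/γ})` uniformly in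
  `β ≥ β₀`, `1 ≤ R ≤ c₀ξ`.  Consistency checks (paper): at `R = 1`, `β → ∞`, `Z` is `O(1/β)` order-2
  chaos plus a large-field part of size `O(1)` on probability `e^{−cβ}` — both give exponential tails
  in `t = |Z|/‖Z‖₂` (`γ = 1`); at `R ≍ ξ` semiclassical lumps of size `R` give `|Z| ≍ R⁻⁴` against
  `‖Z‖₂ ≍ g²(R)R⁻⁴` with probability `≍ e^{−8π²ν/g²(R)}` — again `e^{−c t}`.  So no tail-based kill;
  the `γ = 0` version is false (`‖Z‖_∞/‖Z‖₂ ≍ β` at `R = 1`) and the `L^∞` version is false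
  (triage r1-2), neither is claimed.
* (NG): the free-`F²` three-point function VANISHES at separated points in `d = 4` (helicity selection:
  `⟨F⁺F⁺⟩` is a contact term, a triangle cannot alternate `±`), so the floor constant `c₁` is `O(g²(1/s₁))`,
  not `O(1)` — consistent with the stub (fixed `s₁`, `∃ c₁`), but a supplier must produce the one-loop
  sign `σ`; nothing to refute.
* (C) closure: the subsequence is baked into the existential scheme; `HasLatticeMassGap r sch 1` with
  `a_k := m(β_k)` is clause (ii) verbatim; fine as typed. -/

namespace Targets

section Objects

variable {G : Type} [Group G] [TopologicalSpace G] [IsTopologicalGroup G] [CompactSpace G]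
  [MeasurableSpace G] [BorelSpace G]

local notation "Zd4" => Literature.Probability.LatticeModels.Site 4

/-- VERBATIM `ConditionalMeanTelescoping.cubeEdges`. -/
def cubeEdges (R : ℕ) (x : Zd4) : Set ZdEdge4 :=
  {e | (∀ μ, |e.1 μ - x μ| ≤ R) ∧ ∀ μ, |e.1 μ + (if μ = e.2 then 1 else 0) - x μ| ≤ R}

/-- VERBATIM `ConditionalMeanTelescoping.cubeEdgesT`. -/
def cubeEdgesT (L R : ℕ) (x : Zd4) : Set (Edge 4 L) :=
  torusEdge L '' cubeEdges R x

/-- VERBATIM `ConditionalMeanTelescoping.exterior`. -/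
@[reducible] def exterior (L R : ℕ) (x : Zd4) : MeasurableSpace (GaugeConfig 4 L G) :=
  cylinderEvents (X := fun _ : Edge 4 L => G) (cubeEdgesT L R x)ᶜ

/-- VERBATIM `ConditionalMeanTelescoping.torusPlaquette`. -/
def torusPlaquette (r : LatticeRep G) (L : ℕ) (i j : Fin 4) (x : Zd4) (U : GaugeConfig 4 L G) : ℝ :=
  plaquetteObs r.ρ x i j (torusLift L U)

/-- VERBATIM `ConditionalMeanTelescoping.influence`. -/
def influence (r : LatticeRep G) (β : ℝ) (S R : ℕ) (i j : Fin 4) (p : ℝ≥0∞) : ℝ :=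
  let μ := wilsonMeasure (d := 4) (L := 2 * S + 1) r.ρ β
  let X : GaugeConfig 4 (2 * S + 1) G → ℝ :=
    fun U => torusPlaquette r (2 * S + 1) i j 0 U - ∫ V, torusPlaquette r (2 * S + 1) i j 0 V ∂μ
  (eLpNorm (μ[X | exterior (2 * S + 1) R 0]) p μ).toReal

/-! ### The cube, its exterior σ-algebra, the `R = 0` edge -/

omit [Group G] [TopologicalSpace G] [IsTopologicalGroup G] [CompactSpace G] [MeasurableSpace G]
  [BorelSpace G] in
/-- The cube is monotone in its radius. -/
theorem cubeEdges_mono {R R' : ℕ} (h : R' ≤ R) (x : Zd4) : cubeEdges R' x ⊆ cubeEdges R x := by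
  rintro e ⟨h1, h2⟩
  have hc : (R' : ℤ) ≤ R := by exact_mod_cast h
  exact ⟨fun μ => (h1 μ).trans hc, fun μ => (h2 μ).trans hc⟩

omit [Group G] [TopologicalSpace G] [IsTopologicalGroup G] [CompactSpace G] [MeasurableSpace G]
  [BorelSpace G] in
/-- **The radius-`0` cube has no interior edge** (its two endpoints cannot both sit at the centre). -/
theorem cubeEdges_zero (x : Zd4) : cubeEdges 0 x = ∅ := by
  ext e
  simp only [cubeEdges, Nat.cast_zero, Set.mem_setOf_eq, Set.mem_empty_iff_false, iff_false,
    not_and, not_forall]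
  intro h1
  refine ⟨e.2, ?_⟩
  have := h1 e.2
  rw [abs_nonpos_iff, sub_eq_zero] at this
  simp [this]

omit [Group G] [TopologicalSpace G] [IsTopologicalGroup G] [CompactSpace G] [BorelSpace G] in
/-- Exterior σ-algebras are ANTITONE in the radius. -/
theorem exterior_anti {L R R' : ℕ} (h : R' ≤ R) (x : Zd4) :
    exterior (G := G) L R x ≤ exterior L R' x :=
  cylinderEvents_mono (Set.compl_subset_compl.2 (Set.image_mono (cubeEdges_mono h x)))

omit [Group G] [TopologicalSpace G] [IsTopologicalGroup G] [CompactSpace G] [BorelSpace G] in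
/-- At radius `0` the exterior σ-algebra is the whole product σ-algebra. -/
theorem exterior_zero (L : ℕ) (x : Zd4) : exterior (G := G) L 0 x = MeasurableSpace.pi := by
  simp [exterior, cubeEdgesT, cubeEdges_zero]

omit [IsTopologicalGroup G] [CompactSpace G] [BorelSpace G] in
/-- The centred torus plaquette is bounded by `2N`. -/
theorem abs_centred_torusPlaquette_le (r : LatticeRep G) (L : ℕ) (i j : Fin 4) (x : Zd4)
    (μ : Measure (GaugeConfig 4 L G)) [IsProbabilityMeasure μ] (U : GaugeConfig 4 L G) :
    |torusPlaquette r L i j x U - ∫ V, torusPlaquette r L i j x V ∂μ| ≤ 2 * r.N := by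
  have hb : ∀ V, |torusPlaquette r L i j x V| ≤ r.N := fun V =>
    abs_plaquetteObs_le_holds (ρ := r.ρ) r.mem_unitary x i j _
  have hint : |∫ V, torusPlaquette r L i j x V ∂μ| ≤ r.N := by
    refine (abs_integral_le_integral_abs).trans ?_
    calc ∫ V, |torusPlaquette r L i j x V| ∂μ ≤ ∫ _, (r.N : ℝ) ∂μ :=
          integral_mono_of_nonneg (Eventually.of_forall fun _ => abs_nonneg _) (integrable_const _)
            (Eventually.of_forall hb)
      _ = r.N := by simp
  calc |torusPlaquette r L i j x U - ∫ V, torusPlaquette r L i j x V ∂μ|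
      ≤ |torusPlaquette r L i j x U| + |∫ V, torusPlaquette r L i j x V ∂μ| := abs_sub _ _
    _ ≤ r.N + r.N := add_le_add (hb U) hint
    _ = 2 * r.N := by ring

/-- The torus plaquette is measurable. -/
theorem measurable_torusPlaquette (r : LatticeRep G) (L : ℕ) (i j : Fin 4) (x : Zd4) :
    Measurable (torusPlaquette r L i j x) := by
  haveI : SecondCountableTopology G :=
    (r.continuous.isClosedEmbedding r.injective).isEmbedding.secondCountableTopology
  exact (measurable_plaquetteObs r.ρ r.continuous x i j).comp (measurable_torusLift' L)

/-- **At radius `0` the influence is the plain `Lᵖ` norm of the centred plaquette** (the conditional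
mean given everything is the plaquette itself): (T) at `R = 0` is generalised Hölder, (M) compares
every radius with this. -/
theorem influence_radius_zero (r : LatticeRep G) (β : ℝ) (S : ℕ) (i j : Fin 4) (p : ℝ≥0∞) :
    influence r β S 0 i j p =
      (eLpNorm (fun U => torusPlaquette r (2 * S + 1) i j 0 U -
          ∫ V, torusPlaquette r (2 * S + 1) i j 0 V ∂(wilsonMeasure (d := 4) (L := 2 * S + 1) r.ρ β))
        p (wilsonMeasure (d := 4) (L := 2 * S + 1) r.ρ β)).toReal := by
  haveI := isProbabilityMeasure_wilsonMeasure (d := 4) (L := 2 * S + 1) r.ρ r.continuous β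
  simp only [influence]
  rw [exterior_zero]
  congr 2
  refine condExp_of_stronglyMeasurable (m := MeasurableSpace.pi) (μ := wilsonMeasure r.ρ β) le_rfl
    ?_ ?_
  · exact ((measurable_torusPlaquette r _ i j 0).sub measurable_const).stronglyMeasurable
  · refine Integrable.of_bound
      ((measurable_torusPlaquette r _ i j 0).sub measurable_const).aestronglyMeasurable (2 * r.N)
      (Eventually.of_forall fun U => ?_)
    rw [Real.norm_eq_abs]
    exact abs_centred_torusPlaquette_le r _ i j 0 _ U

end Objects

/-! ### (M) `InfluenceAntitone` is true as typed -/

/-- VERBATIM `ConditionalMeanTelescoping.InfluenceAntitone` (registered stub (M), second conjunct of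
`stub_telescoping`). -/
def InfluenceAntitone : Prop :=
  ∀ (G : Type) [Group G] [TopologicalSpace G] [IsTopologicalGroup G] [CompactSpace G]
    [MeasurableSpace G] [BorelSpace G] (r : LatticeRep G) (β : ℝ) (S : ℕ) (i j : Fin 4)
    (p : ℝ≥0∞), 1 ≤ p → ∀ R R' : ℕ, R' ≤ R → 2 * R + 2 < 2 * S + 1 →
      influence r β S R i j p ≤ influence r β S R' i j p

/-- **(M) holds** (every real `β`, every `1 ≤ p ≤ ∞`; the fit condition is not used): tower property
+ `Lᵖ`-contractivity of the conditional expectation along `exterior R ≤ exterior R'`. -/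
theorem influenceAntitone_holds : InfluenceAntitone := by
  intro G _ _ _ _ _ _ r β S i j p hp R R' hRR' _
  haveI := isProbabilityMeasure_wilsonMeasure (d := 4) (L := 2 * S + 1) r.ρ r.continuous β
  set μ := wilsonMeasure (d := 4) (L := 2 * S + 1) r.ρ β with hμ
  set X : GaugeConfig 4 (2 * S + 1) G → ℝ := fun U =>
    torusPlaquette r (2 * S + 1) i j 0 U - ∫ V, torusPlaquette r (2 * S + 1) i j 0 V ∂μ with hX
  have hm' : exterior (G := G) (2 * S + 1) R' 0 ≤ MeasurableSpace.pi := cylinderEvents_le_pi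
  have hm : exterior (G := G) (2 * S + 1) R 0 ≤ exterior (2 * S + 1) R' 0 := exterior_anti hRR' 0
  have htower : μ[X | exterior (2 * S + 1) R 0] =ᵐ[μ]
      μ[μ[X | exterior (2 * S + 1) R' 0] | exterior (2 * S + 1) R 0] :=
    (condExp_condExp_of_le hm hm').symm
  have hle : eLpNorm (μ[X | exterior (2 * S + 1) R 0]) p μ ≤
      eLpNorm (μ[X | exterior (2 * S + 1) R' 0]) p μ := by
    rw [eLpNorm_congr_ae htower]
    exact eLpNorm_condExp_le_eLpNorm _ hp
  have hXmem : MemLp X p μ :=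
    MemLp.of_bound ((measurable_torusPlaquette r _ i j 0).sub measurable_const).aestronglyMeasurable
      (2 * r.N) (Eventually.of_forall fun U => by
        rw [Real.norm_eq_abs]; exact abs_centred_torusPlaquette_le r _ i j 0 μ U)
  have hfin : eLpNorm (μ[X | exterior (2 * S + 1) R' 0]) p μ ≠ ∞ :=
    ((eLpNorm_condExp_le_eLpNorm _ hp).trans_lt hXmem.eLpNorm_lt_top).ne
  show (eLpNorm (μ[X | exterior (2 * S + 1) R 0]) p μ).toReal ≤
    (eLpNorm (μ[X | exterior (2 * S + 1) R' 0]) p μ).toReal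
  exact ENNReal.toReal_mono hfin hle

/-- In particular every influence is dominated by the radius-`0` one, the `Lᵖ` norm of the centred
plaquette (`≤ 2N`). -/
theorem influence_le_radius_zero {G : Type} [Group G] [TopologicalSpace G] [IsTopologicalGroup G]
    [CompactSpace G] [MeasurableSpace G] [BorelSpace G] (r : LatticeRep G) (β : ℝ) (S R : ℕ)
    (i j : Fin 4) {p : ℝ≥0∞} (hp : 1 ≤ p) (hfit : 2 * R + 2 < 2 * S + 1) :
    influence r β S R i j p ≤ influence r β S 0 i j p :=
  influenceAntitone_holds G r β S i j p hp R 0 (Nat.zero_le _) hfit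

/-! ### (T) at `n = 0` and `n = 1` -/

section SmallN

variable {G : Type} [Group G] [TopologicalSpace G] [IsTopologicalGroup G] [CompactSpace G]
  [MeasurableSpace G] [BorelSpace G]

local notation "Zd4" => Literature.Probability.LatticeModels.Site 4

/-- (T) at `n = 0`: both sides are empty products, `|∫ 1| = 1 ≤ 1`. -/
theorem telescoping_n_zero (r : LatticeRep G) (β : ℝ) (S R : ℕ) (o : Fin 0 → Fin 4 × Fin 4)
    (x : Fin 0 → Zd4) :
    let μ := wilsonMeasure (d := 4) (L := 2 * S + 1) r.ρ β
    |∫ U, ∏ k, (torusPlaquette r (2 * S + 1) (o k).1 (o k).2 (x k) U -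
        ∫ V, torusPlaquette r (2 * S + 1) (o k).1 (o k).2 (x k) V ∂μ) ∂μ|
      ≤ ∏ k, influence r β S R (o k).1 (o k).2 (0 : ℕ) := by
  haveI := isProbabilityMeasure_wilsonMeasure (d := 4) (L := 2 * S + 1) r.ρ r.continuous β
  simp

/-- (T) at `n = 1`: the left-hand side is `|∫ (X − ∫ X)| = 0`. -/
theorem telescoping_n_one (r : LatticeRep G) (β : ℝ) (S R : ℕ) (o : Fin 1 → Fin 4 × Fin 4)
    (x : Fin 1 → Zd4) :
    let μ := wilsonMeasure (d := 4) (L := 2 * S + 1) r.ρ β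
    |∫ U, ∏ k, (torusPlaquette r (2 * S + 1) (o k).1 (o k).2 (x k) U -
        ∫ V, torusPlaquette r (2 * S + 1) (o k).1 (o k).2 (x k) V ∂μ) ∂μ|
      ≤ ∏ k, influence r β S R (o k).1 (o k).2 (1 : ℕ) := by
  haveI := isProbabilityMeasure_wilsonMeasure (d := 4) (L := 2 * S + 1) r.ρ r.continuous β
  simp only [Finset.univ_unique, Fin.default_eq_zero, Finset.prod_singleton]
  have hint : Integrable (torusPlaquette r (2 * S + 1) (o 0).1 (o 0).2 (x 0))
      (wilsonMeasure (d := 4) (L := 2 * S + 1) r.ρ β) :=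
    Integrable.of_bound (measurable_torusPlaquette r _ _ _ _).aestronglyMeasurable r.N
      (Eventually.of_forall fun U => by
        rw [Real.norm_eq_abs]; exact abs_plaquetteObs_le_holds (ρ := r.ρ) r.mem_unitary _ _ _ _)
  rw [integral_sub hint (integrable_const _), integral_const, smul_eq_mul, probReal_univ, one_mul,
    sub_self, abs_zero]
  exact ENNReal.toReal_nonneg

end SmallN

end Targets

/-! ## §11 (cycle 3) The lattice mirror of the curvature: its temporal plaquettes hang DOWN

What `rpSquare`/`reflPair` of the picked line (and the closure stub's E2 inheritance, and every
lattice-RP argument about the crux's curvature species) actually compute.  Under the odd-torus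
reflection `Θ` (`GaugeConfig.timeReflect`, `t ↦ 1 − t`) a spatial plaquette based at `x` goes to the
spatial plaquette based at `θx`, but a TEMPORAL plaquette based at `x` (spanning times `[x₀, x₀+1]`)
goes to the temporal plaquette based at `θx − e₀` (spanning `[−x₀, 1−x₀]`), orientation reversed
(`Re tr` unchanged).  Hence `P_x ∘ Θ = P̃_{θx}` with `P̃ = P − ∇₀⁻E` (`torusDensity_timeReflect`,
`reflDensity_sub_torusDensity`): the lattice OS form pairs the smeared curvature `Φ_k(u)` with the
smeared REFLECTED density — a different species at the lattice scale — and NOT with `Φ_k(θ_c u)`.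
Identifying the two costs `c_k · a_k · (E smeared against ∂₀u)`, i.e. one lattice spacing times the
uncontrolled multiplicative renormalisation.  This is the recorded OBSTRUCTION to an adversary-side
"`ξ_lat(β_k) · a_k ↛ 0` is necessary" theorem for general witnesses (the natural size is
`c_k ≍ a_k⁻⁴/g²`), and the concrete swap estimate the closure prover owes for E2 of the limit. -/

section ReflectedDensity

variable {G : Type} [Group G] [TopologicalSpace G] [IsTopologicalGroup G] [CompactSpace G]
  [MeasurableSpace G] [BorelSpace G]

local notation "Zd4" => Literature.Probability.LatticeModels.Site 4

/-- VERBATIM `ConditionalMeanTelescoping.torusDensity`: the curvature species at the `ℤ⁴`-site `x`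
on the torus of side `L` (translation convention of `smearedLatticeField`). -/
def Targets.torusDensity (r : LatticeRep G) (L : ℕ) (x : Zd4) (U : GaugeConfig 4 L G) : ℝ :=
  r.curvature.F (configShift (-x) (torusLift L U))

omit [Group G] [TopologicalSpace G] [IsTopologicalGroup G] [CompactSpace G] [MeasurableSpace G]
  [BorelSpace G] in
/-- `ℤ⁴` time reflection `t ↦ 1 − t` (the lift of `Site.timeReflect`). -/
def thetaZ (x : Zd4) : Zd4 := Function.update x 0 (1 - x 0)

omit [Group G] [TopologicalSpace G] [IsTopologicalGroup G] [CompactSpace G] [MeasurableSpace G]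
  [BorelSpace G] in
@[simp] theorem thetaZ_apply_zero (x : Zd4) : thetaZ x 0 = 1 - x 0 := by simp [thetaZ]

omit [Group G] [TopologicalSpace G] [IsTopologicalGroup G] [CompactSpace G] [MeasurableSpace G]
  [BorelSpace G] in
theorem thetaZ_apply_of_ne (x : Zd4) {k : Fin 4} (hk : k ≠ 0) : thetaZ x k = x k := by
  simp [thetaZ, hk]

omit [Group G] [TopologicalSpace G] [IsTopologicalGroup G] [CompactSpace G] [MeasurableSpace G]
  [BorelSpace G] in
/-- `proj ∘ θ_ℤ = θ ∘ proj`. -/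
theorem proj_thetaZ (L : ℕ) (x : Zd4) :
    Torus.proj L (thetaZ x) = Literature.MathematicalPhysics.QuantumFieldTheory.Site.timeReflect (Torus.proj L x) := by
  ext k
  by_cases hk : k = 0
  · subst hk
    simp [Torus.proj, Literature.MathematicalPhysics.QuantumFieldTheory.Site.timeReflect]
  · simp [Torus.proj, Literature.MathematicalPhysics.QuantumFieldTheory.Site.timeReflect, hk, thetaZ]

omit [Group G] [TopologicalSpace G] [IsTopologicalGroup G] [CompactSpace G] [MeasurableSpace G]
  [BorelSpace G] in
/-- The reflected base point of a temporal plaquette: `θ(x̄ + e₀) = proj (θ_ℤ x − e₀)`. -/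
theorem timeReflect_shift_proj (L : ℕ) (x : Zd4) :
    Literature.MathematicalPhysics.QuantumFieldTheory.Site.timeReflect (Literature.MathematicalPhysics.QuantumFieldTheory.Site.shift (Torus.proj L x) 0) =
      Torus.proj L (thetaZ x - Pi.single 0 1) := by
  ext k
  by_cases hk : k = 0
  · subst hk
    simp [Torus.proj, Literature.MathematicalPhysics.QuantumFieldTheory.Site.timeReflect, Literature.MathematicalPhysics.QuantumFieldTheory.Site.shift]
  · simp [Torus.proj, Literature.MathematicalPhysics.QuantumFieldTheory.Site.timeReflect, Literature.MathematicalPhysics.QuantumFieldTheory.Site.shift, hk, thetaZ]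

omit [TopologicalSpace G] [IsTopologicalGroup G] [CompactSpace G] [MeasurableSpace G]
  [BorelSpace G] in
/-- Plaquette holonomies of the periodic lift are the torus holonomies below (inlined from the landed
`CurvatureBoostCovariance/Negative/BetaZeroMoments.lean`, whose import chain reaches the currently
non-building `Theses/MirrorModularBoosts.lean`). -/
theorem plaquetteHolonomyZd_torusLift' {S : ℕ} (U : GaugeConfig 4 S G) (y : Zd4) (i j : Fin 4) :
    plaquetteHolonomyZd (torusLift S U) y i j = plaquetteHolonomy U (Torus.proj S y) i j := by
  simp only [plaquetteHolonomyZd, plaquetteHolonomy, torusLift, torusEdge, Function.comp_apply,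
    Literature.MathematicalPhysics.QuantumFieldTheory.Site.shift, torusProj_add_single, Int.cast_one]

omit [TopologicalSpace G] [IsTopologicalGroup G] [CompactSpace G] [BorelSpace G] in
/-- The torus plaquette observable of the translated periodic lift at base point `x` (inlined, same
provenance). -/
theorem plaquetteObs_configShift_torusLift {S N : ℕ} (ρ : G →* Matrix (Fin N) (Fin N) ℂ)
    (x : Zd4) (a b : Fin 4) (U : GaugeConfig 4 S G) :
    plaquetteObs ρ 0 a b (configShift (-x) (torusLift S U)) =
      (ρ (plaquetteHolonomy U (Torus.proj S x) a b)).trace.re := by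
  simp only [plaquetteObs]
  have h : plaquetteHolonomyZd (configShift (-x) (torusLift S U)) 0 a b =
      plaquetteHolonomyZd (torusLift S U) x a b := by
    simp only [plaquetteHolonomyZd, configShift_apply, sub_neg_eq_add, zero_add,
      add_comm (Pi.single _ _) x]
  rw [h, plaquetteHolonomyZd_torusLift']

omit [IsTopologicalGroup G] [CompactSpace G] [MeasurableSpace G] [BorelSpace G] in
/-- The torus plaquette of the work files is the tree's `plaqRe` at the projected base point. -/
theorem torusPlaquette_eq_plaqRe (r : LatticeRep G) (L : ℕ) {i j : Fin 4} (hij : i < j) (x : Zd4)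
    (U : GaugeConfig 4 L G) :
    Targets.torusPlaquette r L i j x U = WilsonRP.plaqRe r.ρ U (Torus.proj L x, ⟨(i, j), hij⟩) := by
  unfold Targets.torusPlaquette WilsonRP.plaqRe plaquetteObs
  rw [plaquetteHolonomyZd_torusLift']

omit [MeasurableSpace G] [BorelSpace G] in
/-- **Temporal plaquettes hang down after reflection**: `p_{0j}(x) ∘ Θ = p_{0j}(θ_ℤ x − e₀)`. -/
theorem torusPlaquette_timeReflect_temporal (r : LatticeRep G) (L : ℕ) {j : Fin 4} (hj : 0 < j)
    (x : Zd4) (U : GaugeConfig 4 L G) :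
    Targets.torusPlaquette r L 0 j x U.timeReflect =
      Targets.torusPlaquette r L 0 j (thetaZ x - Pi.single 0 1) U := by
  rw [torusPlaquette_eq_plaqRe r L hj, torusPlaquette_eq_plaqRe r L hj,
    WilsonRP.plaqRe_timeReflect r.ρ r.continuous]
  simp only [WilsonRP.plaqReflect, ↓reduceIte, timeReflect_shift_proj]

omit [MeasurableSpace G] [BorelSpace G] in
/-- **Spatial plaquettes are carried along**: `p_{ij}(x) ∘ Θ = p_{ij}(θ_ℤ x)` for `0 < i < j`. -/
theorem torusPlaquette_timeReflect_spatial (r : LatticeRep G) (L : ℕ) {i j : Fin 4} (hi : 0 < i)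
    (hij : i < j) (x : Zd4) (U : GaugeConfig 4 L G) :
    Targets.torusPlaquette r L i j x U.timeReflect = Targets.torusPlaquette r L i j (thetaZ x) U := by
  rw [torusPlaquette_eq_plaqRe r L hij, torusPlaquette_eq_plaqRe r L hij,
    WilsonRP.plaqRe_timeReflect r.ρ r.continuous]
  simp only [WilsonRP.plaqReflect, hi.ne', ↓reduceIte, proj_thetaZ]

/-- The curvature species at `x` is the sum of its six torus plaquettes. -/
theorem torusDensity_eq_sum (r : LatticeRep G) (L : ℕ) (x : Zd4) (U : GaugeConfig 4 L G) :
    Targets.torusDensity r L x U =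
      ∑ i : Fin 4, ∑ j : Fin 4, if i < j then Targets.torusPlaquette r L i j x U else 0 := by
  unfold Targets.torusDensity
  have hcurv : r.curvature.F = actionDensity r.ρ := rfl
  rw [hcurv]
  unfold actionDensity
  refine Finset.sum_congr rfl fun i _ => Finset.sum_congr rfl fun j _ => ?_
  split_ifs
  · rw [plaquetteObs_configShift_torusLift]
    unfold Targets.torusPlaquette plaquetteObs
    rw [plaquetteHolonomyZd_torusLift']
  · rfl

/-- The **reflected density** `P̃_y`: spatial plaquettes based at `y`, temporal plaquettes based at
`y − e₀` (hanging down from `y`). -/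
def reflDensity (r : LatticeRep G) (L : ℕ) (y : Zd4) (U : GaugeConfig 4 L G) : ℝ :=
  ∑ i : Fin 4, ∑ j : Fin 4, if i < j then
    (if i = 0 then Targets.torusPlaquette r L 0 j (y - Pi.single 0 1) U
      else Targets.torusPlaquette r L i j y U) else 0

/-- **The lattice mirror of the curvature is the reflected density at the reflected site**:
`P_x ∘ Θ = P̃_{θ_ℤ x}` — NOT a translate of `P`. -/
theorem torusDensity_timeReflect (r : LatticeRep G) (L : ℕ) (x : Zd4) (U : GaugeConfig 4 L G) :
    Targets.torusDensity r L x U.timeReflect = reflDensity r L (thetaZ x) U := by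
  rw [torusDensity_eq_sum]
  unfold reflDensity
  refine Finset.sum_congr rfl fun i _ => Finset.sum_congr rfl fun j _ => ?_
  by_cases hij : i < j
  · simp only [hij, ↓reduceIte]
    by_cases hi : i = 0
    · subst hi
      simp only [↓reduceIte]
      exact torusPlaquette_timeReflect_temporal r L hij x U
    · simp only [hi, ↓reduceIte]
      exact torusPlaquette_timeReflect_spatial r L (Nat.pos_of_ne_zero (fun h => hi (Fin.ext h))) hij x U
  · simp [hij]

/-- **The Θ-swap**: reflected density minus the curvature at the same site is minus the backward
time-difference of the electric part, `P̃_y − P_y = −∑_{j>0} (E_j(y) − E_j(y − e₀))`. -/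
theorem reflDensity_sub_torusDensity (r : LatticeRep G) (L : ℕ) (y : Zd4) (U : GaugeConfig 4 L G) :
    reflDensity r L y U - Targets.torusDensity r L y U =
      -∑ j : Fin 4, if 0 < j then
        (Targets.torusPlaquette r L 0 j y U - Targets.torusPlaquette r L 0 j (y - Pi.single 0 1) U)
        else 0 := by
  rw [torusDensity_eq_sum]
  unfold reflDensity
  rw [← Finset.sum_sub_distrib, Fin.sum_univ_four, Fin.sum_univ_four, Fin.sum_univ_four,
    Fin.sum_univ_four, Fin.sum_univ_four, Fin.sum_univ_four]
  simp only [Fin.sum_univ_four, Fin.isValue, Fin.zero_lt_one, ↓reduceIte, lt_self_iff_false,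
    Fin.reduceLT, Fin.reduceEq]
  ring

/-- **Corollary (the smeared swap).**  For a real test function `w`, the "mirror-smeared" curvature
`∑_y w(y) P̃_y` differs from `∑_y w(y) P_y` by the electric part smeared against the FORWARD
difference of `w`: `∑_y w(y)(P̃_y − P_y) = ∑_y (w(y + e₀) − w(y)) E(y)` — one lattice spacing of a
derivative (summation by parts over a translation-invariant finite index set: here stated for any
finite set `Λ ⊆ ℤ⁴` invariant under `y ↦ y + e₀`, e.g. a full period box read periodically). -/
theorem sum_mul_reflDensity_sub (r : LatticeRep G) (L : ℕ) (U : GaugeConfig 4 L G) (Λ : Finset Zd4)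
    (hΛ : ∀ y, y ∈ Λ ↔ y + Pi.single 0 1 ∈ Λ) (w : Zd4 → ℝ) :
    ∑ y ∈ Λ, w y * (reflDensity r L y U - Targets.torusDensity r L y U) =
      ∑ y ∈ Λ, (w (y + Pi.single 0 1) - w y) *
        ∑ j : Fin 4, if 0 < j then Targets.torusPlaquette r L 0 j y U else 0 := by
  simp_rw [reflDensity_sub_torusDensity]
  set E : Zd4 → ℝ := fun y => ∑ j : Fin 4, if 0 < j then Targets.torusPlaquette r L 0 j y U else 0
    with hE
  have hsplit : ∀ y, (∑ j : Fin 4, if 0 < j then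
      (Targets.torusPlaquette r L 0 j y U - Targets.torusPlaquette r L 0 j (y - Pi.single 0 1) U)
      else 0) = E y - E (y - Pi.single 0 1) := by
    intro y
    simp only [hE, ← Finset.sum_sub_distrib]
    refine Finset.sum_congr rfl fun j _ => ?_
    split_ifs <;> simp
  simp_rw [hsplit]
  -- reindex the shifted sum: y ↦ y - e₀ is a bijection of Λ
  have hre : ∑ y ∈ Λ, w y * E (y - Pi.single 0 1) = ∑ y ∈ Λ, w (y + Pi.single 0 1) * E y := by
    refine Finset.sum_nbij' (fun y => y - Pi.single 0 1) (fun y => y + Pi.single 0 1) ?_ ?_ ?_ ?_ ?_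
    · intro y hy
      exact (hΛ (y - Pi.single 0 1)).2 (by simpa using hy)
    · intro y hy
      exact (hΛ y).1 hy
    · intro y _; simp
    · intro y _; simp
    · intro y _; simp
  calc ∑ y ∈ Λ, w y * -(E y - E (y - Pi.single 0 1))
      = ∑ y ∈ Λ, w y * E (y - Pi.single 0 1) - ∑ y ∈ Λ, w y * E y := by
        rw [← Finset.sum_sub_distrib]; refine Finset.sum_congr rfl fun y _ => by ring
    _ = ∑ y ∈ Λ, w (y + Pi.single 0 1) * E y - ∑ y ∈ Λ, w y * E y := by rw [hre]
    _ = ∑ y ∈ Λ, (w (y + Pi.single 0 1) - w y) * E y := by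
        rw [← Finset.sum_sub_distrib]; refine Finset.sum_congr rfl fun y _ => by ring

end ReflectedDensity

/-! ## §12 (cycle 3) `rpSquare` is a genuine odd-torus RP square: no sign trap in (W2)/(WI₂)/(NG)

The picked line's reference quantity `A(β,S,R) = rpSquare r β S R` is non-negative whenever
`β ≥ 0` and `1 ≤ R ≤ S` (`S ≥ 1`), by the tree's `wilsonExpectation_oddReflectionPositive`
(`θ t = 1 − t` on the torus `2S+1`): the plaquette `p₀₁` based at height `R` has its temporal links
based at time `R ≤ S = L/2` and its spatial links at times `R` and `R+1 ≤ S+1 = L/2+1` (the shared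
hyperplane), so its centred observable lives on `P ∪ M`.  The stubs' existential `β₀`, `S₀(β)` can
always be chosen to meet these guards (`R ≤ c₀/m(β) ≤ S₀`); outside them (`R = 0`: the plaquette
crosses the reflection plane; `R > S`: aliasing) nothing is claimed by the line. -/

section RPSquare

variable {G : Type} [Group G] [TopologicalSpace G] [IsTopologicalGroup G] [CompactSpace G]
  [MeasurableSpace G] [BorelSpace G]

local notation "Zd4" => Literature.Probability.LatticeModels.Site 4

/-- VERBATIM `ConditionalMeanTelescoping.rpSquare`. -/
def Targets.rpSquare (r : LatticeRep G) (β : ℝ) (S R : ℕ) : ℝ :=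
  let μ := wilsonMeasure (d := 4) (L := 2 * S + 1) r.ρ β
  let X : GaugeConfig 4 (2 * S + 1) G → ℝ :=
    fun U => Targets.torusPlaquette r (2 * S + 1) 0 1 (Pi.single 0 (R : ℤ)) U -
      ∫ V, Targets.torusPlaquette r (2 * S + 1) 0 1 (Pi.single 0 (R : ℤ)) V ∂μ
  ∫ U, X (GaugeConfig.timeReflect U) * X U ∂μ

omit [IsTopologicalGroup G] [CompactSpace G] [MeasurableSpace G] [BorelSpace G] in
/-- A torus plaquette depends only on its four torus links. -/
theorem dependsOn_torusPlaquette (r : LatticeRep G) (L : ℕ) (i j : Fin 4) (x : Zd4) :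
    DependsOn (Targets.torusPlaquette r L i j x)
      {torusEdge L (x, i), torusEdge L (x + Pi.single i 1, j), torusEdge L (x + Pi.single j 1, i),
        torusEdge L (x, j)} := by
  intro U V h
  unfold Targets.torusPlaquette plaquetteObs plaquetteHolonomyZd torusLift
  simp only [Function.comp_apply]
  rw [h _ (by simp), h (torusEdge L (x + Pi.single i 1, j)) (by simp),
    h (torusEdge L (x + Pi.single j 1, i)) (by simp), h (torusEdge L (x, j)) (by simp)]

omit [Group G] [TopologicalSpace G] [IsTopologicalGroup G] [CompactSpace G] [MeasurableSpace G]
  [BorelSpace G] in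
/-- Time coordinate of a projected site with small non-negative time. -/
theorem val_proj_zero {S : ℕ} {x : Zd4} {t : ℕ} (hx : x 0 = t) (ht : t < 2 * S + 1) :
    (Torus.proj (2 * S + 1) x 0).val = t := by
  simp only [Torus.proj, hx, Int.cast_natCast, ZMod.val_natCast]
  exact Nat.mod_eq_of_lt ht

omit [Group G] [TopologicalSpace G] [IsTopologicalGroup G] [CompactSpace G] [MeasurableSpace G]
  [BorelSpace G] in
/-- **The four links of `p₀₁(R e₀)` lie in `P ∪ M`** for `1 ≤ R ≤ S`. -/
theorem plaquette_edges_subset_pos_union_shared {S R : ℕ} (hR : 1 ≤ R) (hRS : R ≤ S) :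
    ({torusEdge (2 * S + 1) ((Pi.single 0 (R : ℤ) : Zd4), (0 : Fin 4)),
      torusEdge (2 * S + 1) ((Pi.single 0 (R : ℤ) : Zd4) + Pi.single (0 : Fin 4) 1, (1 : Fin 4)),
      torusEdge (2 * S + 1) ((Pi.single 0 (R : ℤ) : Zd4) + Pi.single (1 : Fin 4) 1, (0 : Fin 4)),
      torusEdge (2 * S + 1) ((Pi.single 0 (R : ℤ) : Zd4), (1 : Fin 4))} : Set (Edge 4 (2 * S + 1))) ⊆
      ((WilsonOddRP.oPosEdges ∪ WilsonOddRP.oSharedEdges : Finset (Edge 4 (2 * S + 1))) :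
        Set (Edge 4 (2 * S + 1))) := by
  haveI : Fact (1 < 2 * S + 1) := ⟨by omega⟩
  have hL2 : (2 * S + 1) / 2 = S := by omega
  have hR' : (Torus.proj (2 * S + 1) (Pi.single 0 (R : ℤ) : Zd4) 0).val = R :=
    val_proj_zero (by simp) (by omega)
  have hR1 : (Torus.proj (2 * S + 1) ((Pi.single 0 (R : ℤ) : Zd4) + Pi.single (1 : Fin 4) 1) 0).val = R :=
    val_proj_zero (by simp) (by omega)
  have hR0 : (Torus.proj (2 * S + 1) ((Pi.single 0 (R : ℤ) : Zd4) + Pi.single (0 : Fin 4) 1) 0).val =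
      R + 1 :=
    val_proj_zero (t := R + 1) (by simp) (by omega)
  intro e he
  simp only [Set.mem_insert_iff, Set.mem_singleton_iff] at he
  rw [Finset.coe_union, Set.mem_union, Finset.mem_coe, Finset.mem_coe, WilsonOddRP.mem_oPosEdges,
    WilsonOddRP.mem_oSharedEdges, WilsonOddRP.IsOPosEdge, WilsonOddRP.IsOSharedEdge, hL2]
  rcases he with rfl | rfl | rfl | rfl
  · left; simp only [torusEdge]; rw [hR']; exact ⟨hR, hRS⟩
  · simp only [torusEdge]
    rw [hR0]
    rcases Nat.lt_or_ge R S with h | h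
    · left; exact ⟨by omega, h⟩
    · right; exact ⟨one_ne_zero, by omega⟩
  · left; simp only [torusEdge]; rw [hR1]; exact ⟨hR, hRS⟩
  · left; simp only [torusEdge]; rw [hR']; exact ⟨hR, hRS⟩

/-- **`rpSquare` is non-negative** for `β ≥ 0`, `1 ≤ R ≤ S` (Osterwalder–Seiler RP on the odd
torus). -/
theorem rpSquare_nonneg (r : LatticeRep G) {β : ℝ} (hβ : 0 ≤ β) {S R : ℕ} (hR : 1 ≤ R)
    (hRS : R ≤ S) : 0 ≤ Targets.rpSquare r β S R := by
  haveI := isProbabilityMeasure_wilsonMeasure (d := 4) (L := 2 * S + 1) r.ρ r.continuous β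
  haveI : Fact (1 < 2 * S + 1) := ⟨by omega⟩
  set μ := wilsonMeasure (d := 4) (L := 2 * S + 1) r.ρ β with hμ
  set X : GaugeConfig 4 (2 * S + 1) G → ℝ := fun U =>
    Targets.torusPlaquette r (2 * S + 1) 0 1 (Pi.single 0 (R : ℤ)) U -
      ∫ V, Targets.torusPlaquette r (2 * S + 1) 0 1 (Pi.single 0 (R : ℤ)) V ∂μ with hX
  have hXm : Measurable X := (Targets.measurable_torusPlaquette r _ 0 1 _).sub measurable_const
  have hXb : ∀ U, |X U| ≤ 2 * r.N := fun U => Targets.abs_centred_torusPlaquette_le r _ 0 1 _ μ U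
  have hXdep : DependsOn X
      ((WilsonOddRP.oPosEdges ∪ WilsonOddRP.oSharedEdges : Finset (Edge 4 (2 * S + 1))) :
        Set (Edge 4 (2 * S + 1))) := by
    refine DependsOn.mono (plaquette_edges_subset_pos_union_shared hR hRS) ?_
    intro U V h
    simp only [hX]
    rw [dependsOn_torusPlaquette r (2 * S + 1) 0 1 (Pi.single 0 (R : ℤ)) h]
  set F : GaugeConfig 4 (2 * S + 1) G → ℂ := fun U => (X U : ℂ) with hF
  have hpos := wilsonExpectation_oddReflectionPositive (d := 4) (L := 2 * S + 1) r.ρ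
    (by exact ⟨S, by ring⟩) (by omega) r.continuous hβ F (Complex.measurable_ofReal.comp hXm)
    ⟨2 * r.N, fun U => by
      rw [hF, Complex.norm_real, Real.norm_eq_abs]; exact hXb U⟩
    (fun U V h => by simp only [hF, hXdep h])
  have hint : wilsonExpectation (d := 4) (L := 2 * S + 1) r.ρ β
      (fun U => conj (F U.timeReflect) * F U) = ((Targets.rpSquare r β S R : ℝ) : ℂ) := by
    simp only [wilsonExpectation, hF, Complex.conj_ofReal, ← Complex.ofReal_mul]
    rw [integral_complex_ofReal]
    rfl
  rw [hint] at hpos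
  exact_mod_cast hpos

end RPSquare

/-! ## §13 (crux `stmt-QuantumFields-16154`, cycle 1) The weak-coupling re-type: the junk witness is
gone; without non-triviality the crux is EXACTLY the weak-coupling uniform lattice gap

The live crux conjoins `sch.HasWeakCouplingLimit` (`β_k → +∞`) to the 8646 body (`hypercubicLimit_iff`,
`hypercubicLimit_imp_8646`, §0).  Recorded here, all `sorry`-free:
* `eventually_one_le_beta_of_weak`, `eventually_beta_ne_zero_of_weak`: §9's conclusion for free.
* `not_junkWitness_weak`: the §2 junk witness (vacuum family + `SpeciesScheme.zero`, `β ≡ 0`) satisfies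
  every clause but non-triviality AND fails the new conjunct — at `β ≡ 0` the lattice gap was free (§1),
  at `β_k → ∞` it is the infrared problem.
* `resetRenorm`, `hasLatticeMassGap_resetRenorm`, `converges_vacuum_resetRenorm`: the gap clause never
  reads the renormalisations `(c, m)`, and with `c ≡ 0` every lattice `n`-point function (`n ≥ 1`)
  is `0`, the vacuum family's value; hence `exists_clausesWithoutNontriviality_weak_iff`: for each `r`,
  (∃ weak-coupling witness of all clauses but the two non-triviality ones) ⇔ `WeakCouplingLatticeGap r`.
* `weakCouplingLatticeGap_iff_rates`: the scheme packaging stripped — ⇔ some `β_k → +∞`, some half-sides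
  `L_k`, some rates `ε_k > 0` (no relation among them required: the free spacing `a_k` absorbs any rate,
  the free `L_k` any threshold) with all-pairs, volume-uniform, `k`-uniformly-bounded exponential time
  clustering on the tori of half-side `≥ L_k` at coupling `β_k`.  This is the uniform lattice mass gap at
  a sequence of arbitrarily weak couplings — open (Chatterjee 1803.01950 Problem 5.1; Jaffe–Witten §5).
* `weak_false_without_nonabelian`: §3's `PUnit` kill transfers to the weak-coupling statement.
-/

section WeakCoupling

variable {ι : Type}

/-- `β_k → +∞` gives `1 ≤ β_k` for all large `k`. -/
theorem eventually_one_le_beta_of_weak {sch : SpeciesScheme ι} (hw : sch.HasWeakCouplingLimit) :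
    ∀ᶠ k in atTop, 1 ≤ sch.β k :=
  Filter.tendsto_atTop.1 hw 1

/-- **§9 for free under the new conjunct**: a weak-coupling scheme has `β_k ≠ 0` eventually. -/
theorem eventually_beta_ne_zero_of_weak {sch : SpeciesScheme ι} (hw : sch.HasWeakCouplingLimit) :
    ∀ᶠ k in atTop, sch.β k ≠ 0 :=
  (eventually_one_le_beta_of_weak hw).mono fun k hk h0 => by rw [h0] at hk; norm_num at hk

/-- For the live crux (16154) every witness triple has `β_k ≠ 0` eventually — immediate from the new
conjunct; the 8646 form (forced by `Converges ∧ TwoPointNontrivial` alone) is the landed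
`BetaMustLeaveZero.hypercubicLimit_witness_beta_ne_zero` (p72480), see §9. -/
theorem hypercubicLimit_witness_beta_ne_zero
    (h : Summit.QuantumFields.YangMills.Theses.CoincidenceRotationBootstrap.HypercubicLimit)
    (G : Type) [Group G] [TopologicalSpace G] [IsTopologicalGroup G] [CompactSpace G]
    (hG : IsCompactSimpleLieGroup G) :
    letI : MeasurableSpace G := borel G
    haveI : BorelSpace G := ⟨rfl⟩
    ∃ (r : LatticeRep G) (sch : SpeciesScheme (YMSpecies G))
      (S : LabelledSchwingerFamily (YMSpecies G) E4), Clauses r sch S ∧ ∀ᶠ k in atTop, sch.β k ≠ 0 := by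
  letI : MeasurableSpace G := borel G
  haveI : BorelSpace G := ⟨rfl⟩
  obtain ⟨r, sch, S, hw, hc⟩ := hypercubicLimit_iff.1 h G hG
  exact ⟨r, sch, S, hc, eventually_beta_ne_zero_of_weak hw⟩

variable {G : Type} [Group G] [TopologicalSpace G] [IsTopologicalGroup G] [CompactSpace G]
  [MeasurableSpace G] [BorelSpace G]

/-- **The §2 junk witness dies under the re-type**: for every compact `G` and every `r`, the vacuum
family with the degenerate scheme satisfies all clauses of the crux except the two non-triviality
clauses (§2), but its couplings `β ≡ 0` are not a weak-coupling limit. -/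
theorem not_junkWitness_weak (r : LatticeRep G) :
    ClausesWithoutNontriviality r (SpeciesScheme.zero _) (OSData.vacuum (YMSpecies G) 4).schwinger ∧
      ¬ (SpeciesScheme.zero (YMSpecies G)).HasWeakCouplingLimit :=
  ⟨clausesWithoutNontriviality_vacuum r, SpeciesScheme.not_hasWeakCouplingLimit_zero⟩

/-- The scheme with every renormalisation reset to zero (`c ≡ m ≡ 0`), same `(a_k, β_k, L_k)`. -/
def resetRenorm (sch : SpeciesScheme ι) : SpeciesScheme ι :=
  { sch with c := fun _ _ => 0, m := fun _ _ => 0 }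

omit [Group G] [TopologicalSpace G] [IsTopologicalGroup G] [CompactSpace G] [MeasurableSpace G]
  [BorelSpace G] in
@[simp] theorem resetRenorm_c (sch : SpeciesScheme ι) (s : ι) (k : ℕ) : (resetRenorm sch).c s k = 0 :=
  rfl

omit [Group G] [TopologicalSpace G] [IsTopologicalGroup G] [CompactSpace G] [MeasurableSpace G]
  [BorelSpace G] in
/-- Resetting the renormalisations does not touch the couplings. -/
theorem hasWeakCouplingLimit_resetRenorm (sch : SpeciesScheme ι) :
    (resetRenorm sch).HasWeakCouplingLimit ↔ sch.HasWeakCouplingLimit :=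
  Iff.rfl

/-- **The gap clause reads `(a_k, β_k, L_k)` only**: it is invariant under resetting `(c, m)`. -/
theorem hasLatticeMassGap_resetRenorm (r : LatticeRep G) (sch : SpeciesScheme ι) (Δ : ℝ) :
    HasLatticeMassGap r (resetRenorm sch) Δ ↔ HasLatticeMassGap r sch Δ :=
  Iff.rfl

/-- **With `c ≡ 0` every lattice `n`-point function (`n ≥ 1`) vanishes**, so the convergence clause
holds towards the vacuum family, for EVERY `(a_k, β_k, L_k)` — in particular at weak coupling. -/
theorem converges_vacuum_resetRenorm (r : LatticeRep G) (sch : SpeciesScheme (YMSpecies G)) :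
    Converges r (resetRenorm sch) (OSData.vacuum (YMSpecies G) 4).schwinger := by
  intro n hn σ f F _ _
  have hS : (OSData.vacuum (YMSpecies G) 4).schwinger n σ F = 0 := by
    simp [OSData.vacuum, LabelledSchwingerFamily.trivial_of_ne_zero (YMSpecies G) hn]
  rw [hS]
  refine tendsto_const_nhds.congr' (Eventually.of_forall fun k => ?_)
  show (0 : ℂ) = ((latticeSchwinger r.ρ (resetRenorm sch) (fun s => s.F) k n σ f : ℝ) : ℂ)
  obtain ⟨j, rfl⟩ := Nat.exists_eq_succ_of_ne_zero hn
  simp [latticeSchwinger, smearedLatticeField]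

/-- **The weak-coupling uniform lattice gap for `r`**, packaged exactly as the crux packages it:
some species scheme at weak coupling carries `HasLatticeMassGap` at some positive rate. -/
def WeakCouplingLatticeGap (r : LatticeRep G) : Prop :=
  ∃ sch : SpeciesScheme (YMSpecies G), sch.HasWeakCouplingLimit ∧
    ∃ Δ : ℝ, 0 < Δ ∧ HasLatticeMassGap r sch Δ

/-- **The crux minus both non-triviality clauses is EXACTLY the weak-coupling lattice gap** (for
each `r`): the OS clauses, the convergence clause and the continuum gap are then witnessed by the
vacuum family along `resetRenorm sch` (junk on the continuum side survives the re-type), while the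
lattice side keeps its full content.  Contrast §2 (8646): there the whole conjunction was a theorem. -/
theorem exists_clausesWithoutNontriviality_weak_iff (r : LatticeRep G) :
    (∃ (sch : SpeciesScheme (YMSpecies G)) (S : LabelledSchwingerFamily (YMSpecies G) E4),
        sch.HasWeakCouplingLimit ∧ ClausesWithoutNontriviality r sch S) ↔
      WeakCouplingLatticeGap r := by
  constructor
  · rintro ⟨sch, S, hw, -, -, Δ, hΔ, -, hlat⟩
    exact ⟨sch, hw, Δ, hΔ, hlat⟩
  · rintro ⟨sch, hw, Δ, hΔ, hlat⟩
    exact ⟨resetRenorm sch, _, (hasWeakCouplingLimit_resetRenorm sch).2 hw, osClauses_vacuum,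
      converges_vacuum_resetRenorm r sch, Δ, hΔ,
      OSData.vacuum_hasMassGap (ι := YMSpecies G) (d := 4) Δ,
      (hasLatticeMassGap_resetRenorm r sch Δ).2 hlat⟩

/-- **The weak-coupling lattice gap with the scheme packaging stripped.**  `WeakCouplingLatticeGap r`
⇔ there are couplings `β_k → +∞`, half-sides `L_k` and rates `ε_k > 0` — with NO relation among them
(`a_k := min(ε_k, 1/(k+1))` absorbs the rate with `Δ = 1`; `L'_k := max(L_k, ⌈a_k⁻²⌉)` repairs
`a_k L'_k → ∞`; the `k`-uniform constant is `≥ 0` wherever the bound is instantiated) — such that every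
pair of local gauge-invariant observables has volume-uniform exponential time clustering at rate `ε_k`
on all tori of half-side `S ≥ L_k`, for `n ≤ S`, eventually in `k`.  The IR half of the live crux is
therefore "a uniform lattice mass gap at SOME sequence of arbitrarily weak couplings", nothing more
and nothing less. -/
theorem weakCouplingLatticeGap_iff_rates (r : LatticeRep G) :
    WeakCouplingLatticeGap r ↔
      ∃ (β : ℕ → ℝ) (L : ℕ → ℕ) (ε : ℕ → ℝ), Tendsto β atTop atTop ∧ (∀ k, 0 < ε k) ∧
        ∀ A B : YMSpecies G, ∃ C : ℝ, ∀ᶠ k in atTop, ∀ S : ℕ, L k ≤ S → ∀ n : ℕ, n ≤ S →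
          |latticeConnectedCorr r.ρ (β k) (2 * S + 1) A.F B.F n| ≤ C * Real.exp (-(ε k * n)) := by
  constructor
  · rintro ⟨sch, hw, Δ, hΔ, hlat⟩
    refine ⟨sch.β, sch.L, fun k => Δ * sch.a k, hw, fun k => mul_pos hΔ (sch.a_pos k),
      fun A B => ?_⟩
    obtain ⟨C, hC⟩ := hlat A B
    exact ⟨C, hC.mono fun k hk S hS n hn => by simpa [mul_assoc] using hk S hS n hn⟩
  · rintro ⟨β, L, ε, hβ, hε, h⟩
    set a : ℕ → ℝ := fun k => min (ε k) ((k : ℝ) + 1)⁻¹ with ha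
    have ha_pos : ∀ k, 0 < a k := fun k => lt_min (hε k) (by positivity)
    have ha_le : ∀ k, a k ≤ ε k := fun k => min_le_left _ _
    have ha_tendsto : Tendsto a atTop (𝓝 0) := by
      have h1 : Tendsto (fun k : ℕ => ((k : ℝ) + 1)⁻¹) atTop (𝓝 0) :=
        tendsto_inv_atTop_zero.comp (tendsto_natCast_atTop_atTop.atTop_add tendsto_const_nhds)
      exact squeeze_zero (fun k => (ha_pos k).le) (fun k => min_le_right _ _) h1
    have hinv : Tendsto (fun k => (a k)⁻¹) atTop atTop :=
      tendsto_inv_nhdsGT_zero.comp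
        (tendsto_nhdsWithin_iff.2 ⟨ha_tendsto, Eventually.of_forall fun k => ha_pos k⟩)
    set L' : ℕ → ℕ := fun k => max (L k) ⌈(a k)⁻¹ ^ 2⌉₊ with hL'
    have hL'_tendsto : Tendsto (fun k => a k * (L' k : ℝ)) atTop atTop := by
      refine tendsto_atTop_mono (fun k => ?_) hinv
      have hak := ha_pos k
      calc (a k)⁻¹ = a k * (a k)⁻¹ ^ 2 := by field_simp
        _ ≤ a k * (⌈(a k)⁻¹ ^ 2⌉₊ : ℕ) := mul_le_mul_of_nonneg_left (Nat.le_ceil _) hak.le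
        _ ≤ a k * (L' k : ℝ) :=
            mul_le_mul_of_nonneg_left (by rw [hL']; exact_mod_cast le_max_right _ _) hak.le
    refine ⟨{ a := a, a_pos := ha_pos, tendsto_a := ha_tendsto, β := β, L := L',
              tendsto_L := hL'_tendsto, c := fun _ _ => 0, m := fun _ _ => 0 }, hβ, 1, one_pos,
      fun A B => ?_⟩
    obtain ⟨C, hC⟩ := h A B
    refine ⟨C, hC.mono fun k hk S hS n hn => ?_⟩
    have hS' : L k ≤ S := (le_max_left _ _).trans hS
    have hC0 : 0 ≤ C := by
      have h0 := hk S hS' 0 (Nat.zero_le _)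
      simp only [Nat.cast_zero, mul_zero, neg_zero, Real.exp_zero, mul_one] at h0
      exact (abs_nonneg _).trans h0
    refine (hk S hS' n hn).trans (mul_le_mul_of_nonneg_left (Real.exp_le_exp.2 ?_) hC0)
    have hn0 : (0 : ℝ) ≤ n := Nat.cast_nonneg _
    show -(ε k * n) ≤ -(1 * (a k * n))
    nlinarith [ha_le k]

/-- **Non-abelianness stays load-bearing for the weak-coupling statement** (transfer of §3 by
monotonicity): "compact, connected, linear" instead of `IsCompactSimpleLieGroup` makes the
weak-coupling crux false too (`G = PUnit`), already at the level of
`HasWeakCouplingLimit ∧ Converges ∧ TwoPointNontrivial`. -/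
theorem weak_false_without_nonabelian :
    ¬ (∀ (G : Type) [Group G] [TopologicalSpace G] [IsTopologicalGroup G] [CompactSpace G],
        ConnectedSpace G → Nonempty (LatticeRep G) →
          letI : MeasurableSpace G := borel G
          haveI : BorelSpace G := ⟨rfl⟩
          ∃ (r : LatticeRep G) (sch : SpeciesScheme (YMSpecies G))
            (S : LabelledSchwingerFamily (YMSpecies G) E4),
            sch.HasWeakCouplingLimit ∧ Converges r sch S ∧ TwoPointNontrivial S r.curvature) := by
  intro h
  refine hypercubicLimit_false_without_nonabelian fun G _ _ _ _ hconn hne => ?_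
  obtain ⟨r, sch, S, -, hconv, hnt⟩ := h G hconn hne
  exact ⟨r, sch, S, hconv, hnt⟩

end WeakCoupling

/-! ## §14 (crux 16154, cycle 1) The convergence clause UPGRADES ITSELF — the "k-uniform modulus of
continuity" obstruction of the 8646 census is gone (Banach–Steinhaus); what remains is the E/B split

LANDED as `Theorems/HypercubicLimit/Negative/ConvergesAlongTests.lean` (p122411, `--supports 16154`; import it
once the farm has built it — not imported here to keep this work file publishable today):
* `converges_two_along_tendsto`: under `Converges`, for CLOSED submodules `S₀, S₁ ≤ 𝓢(ℝ⁴, ℝ)` whose real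
  tensors are off-diagonal and sequences `u_k → u₀` in `S₀`, `v_k → v₀` in `S₁`,
  `⟨Φ^{σ₀}_k(u_k) Φ^{σ₁}_k(v_k)⟩ → 𝔖₂^σ(u₀ ⊗ v₀)` — for ANY scheme (`c_k` arbitrary).  Proof: the lattice two-point
  functionals are continuous bilinear forms (finite sums of point evaluations, tree
  `StrongCouplingIRTrivial.TwoPoint.latticeSchwinger_two_eq`), pointwise convergent on `S₀ × S₁` by the clause;
  closed subspaces of `𝓢` are Fréchet hence Baire; the tree's multilinear Banach–Steinhaus
  (`Literature.Analysis.FunctionSpaces.tendsto_apply_of_pointwise_tendsto_schwartzSubmodule`) gives joint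
  continuity of the limiting process.
* `converges_two_along_tendsto_timeSlabs`: the instance for time-reflection arguments (`u`'s vanishing on
  `{t > −δ}`, `v`'s on `{t < δ}`).
Consequences for both sides.  (i) The census bullets "passing to the limit would need a modulus of continuity
of the lattice functionals uniform in `k`, which the statement does not provide" (header, "Why the crux
resists", last two bullets; §0 remark on the M-adic restriction of the small-`β` Osterwalder–Seiler kill) are
SUPERSEDED: test functions may move with the lattice — lattice-vector approximations of continuum shifts,
cube-corner averages, `a_k`-difference quotients all converge to the right limits.  In particular the
translation clause of the crux restricted to compactly supported real product tensors in opposite time slabs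
should now follow from `Converges` + torus translation invariance (no wrap-around for compact supports once
`a_k L_k` exceeds the support radius) — not yet written out; a prover may use the same lemma for it.
(ii) What Banach–Steinhaus does NOT repair, checked by hand this cycle: the time reflection of the smeared
curvature `Φ_k(v)` is `Φ^B_k(θv) + Φ^E_k(τ_{a_k} θv)` (§11: temporal plaquettes hang down) — the magnetic part
against `θv`, the electric part against `θv` shifted by ONE lattice unit — and no reflection-covariant local
density (clover, 16-corner average, half-integer time labels) is a TRANSLATE of the Wilson action density, so
the exact RP square `⟨Θ[Φ_k(v)]·Φ_k(v)⟩` is not a value of the (one-field-reduced, §4) convergence clause at any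
test function.  The E/B split — one lattice derivative of the ELECTRIC density alone, times the free `c_k` — is
therefore the single remaining obstruction to the adversary theorem "a `k`-uniform lattice-unit clustering
rate (e.g. a frozen finite gauge group, or any non-critical `β_k`) kills `Converges ∧ TwoPointNontrivial` for
ARBITRARY `c_k`" (its spectral half is fine: RP squares are completely monotone in the time shift, and a
uniform lattice-unit rate bounds their spectral support, `G_k(s₂) ≤ e^{−2(s₂−s₁)g₀/a_k} G_k(s₁)`), and equally
to the prover's E2-inheritance without an electric-field estimate.
(iii) WHY THE SPECTRAL ROUTE CANNOT CLOSE MODEL-BLIND (worked out this cycle; saves the next seat a cycle).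
Write `b_k(s) := Φ^B_k(v_s)`, `e_k(s) := Φ^E_k(v_s)` (centred; `v_s` = `v` shifted up by `s`), `⟪X, Y⟫ := ⟨Θ[X]·Y⟩`
(symmetric, positive semidefinite on the positive-time algebra, `⟪X_t, Y⟫ = ⟪X, Y_t⟫` by translation invariance),
and `g_{XY}(n) := ⟪X, Y⟫` at total lattice time-shift `n` — by the (positive, Lüscher) transfer matrix
`g_{XY}(n) = ∫ λⁿ dμ_{XY}` with a positive-semidefinite 2×2 matrix of measures `(μ_bb, μ_be; μ_eb, μ_ee)` on `[0, 1]`.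
With `s = σ a_k` the VISIBLE quantity is
`G_k(σ a_k) = ⟪b_σ + e_{σ−1}, b_σ + e_σ⟫ = g_bb(2σ) + g_be(2σ) + g_be(2σ−1) + g_ee(2σ−1) = ∫ λ^{2σ−1} dν_k`,
`ν_k := λ μ_bb + (1+λ) μ_be + μ_ee` — ONE SIGNED measure: Cauchy–Schwarz only gives `|μ_be| ≤ √(μ_bb μ_ee)`, and the
density `λx² − (1+λ)xy + y² = (y − λx)(y − x)` is INDEFINITE (`< 0` for `λx < y < x`), so `ν_k` need not be
positive (the exact RP square `⟪b_σ+e_σ, b_σ+e_σ⟫ = ∫λ^{2σ} d(μ_bb + 2μ_be + μ_ee)` IS positive but is invisible).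
A `k`-uniform lattice-unit gap puts `supp ν_k ⊆ [0, e^{−g₀}]`, i.e. `G_k(s) = ∫_{E ≥ g₀/a_k} e^{−(2s−a_k)E} dν̃_k(E)`
with `ν̃_k` signed and supported at energies `→ ∞`; `Converges` (+ §14 Banach–Steinhaus: locally uniform in `s`)
says `G_k → G` on compact `s`-intervals, `G(s) = ∫ e^{−2sE} dρ(E)`, `ρ ≥ 0`, `ρ ≠ 0` (§8).  For POSITIVE `ν_k` this
is impossible (`G_k(s₂) ≤ e^{−2 g₀ (s₂−s₁)/a_k} G_k(s₁) → 0`); for SIGNED `ν_k` it is perfectly possible: by the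
Müntz–Szász theorem on `[e^{−2s₂}, e^{−2s₁}]` (exponents `E ≥ Λ` with `Σ 1/E = ∞`) signed combinations of
arbitrarily fast exponentials approximate any continuous function, in particular `G`, uniformly on `[s₁, s₂]`.
So no contradiction follows from RP + uniform spectral support + convergence alone: an adversary theorem of this
type needs a MODEL-SPECIFIC tie between `μ_be` and `μ_bb, μ_ee` (comparability / positive correlation of electric
and magnetic fluctuations at lattice-scale energies) — physics input about Wilson's theory, not bookkeeping.
Cycle-2 target if granted: look for that tie at β → ∞ (Gaussian/spin-wave regime, where E and B fluctuations
ARE computable) rather than model-blind. -/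

end Summit.QuantumFields.YangMills.Cruxes.HypercubicLimit.Disproof
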